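import Literature.Analysis.FunctionSpaces.HolderManifoldNemytskii
import Literature.Analysis.FunctionSpaces.HolderManifoldRegularity
import Literature.Geometry.Riemannian.GurskyViaclovskyChartStructure
import Literature.Geometry.Riemannian.GurskyViaclovskyLinearisation
import Literature.Geometry.Riemannian.GurskyViaclovskyClosednessBootstrapAux
import Literature.Geometry.Riemannian.GurskyViaclovskyClosednessExtraction
import Literature.Geometry.Riemannian.GurskyViaclovskyChartEquationC2
import Literature.Analysis.FunctionSpaces.HolderManifoldSchauder
import Literature.Analysis.FunctionSpaces.HolderManifoldModelIsomorphism
import Literature.Analysis.FunctionSpaces.HolderManifoldModelEllipticity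
import Literature.Geometry.Riemannian.EllipticMaximumPrincipleClosed
import Literature.Analysis.OperatorTheory.MethodOfContinuity
import Literature.Geometry.Riemannian.GurskyViaclovskyLinearisationChart
import Literature.Geometry.Riemannian.GurskyViaclovskyEllipticityC2
import Literature.Analysis.Calculus.EllipticityNearGraph
import Literature.Analysis.FunctionSpaces.HolderBallDataSmooth
import Mathlib.Analysis.Calculus.BumpFunction.FiniteDimension
import Literature.Analysis.PDE.EllipticDifferentiatedProblem
import Literature.Analysis.Calculus.CoordinateJets
import Literature.Analysis.Calculus.CoordinateJetsDirectional
import Literature.Analysis.PDE.DifferenceQuotientRegularity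
import Literature.Geometry.Riemannian.GurskyViaclovskyOpennessProofs
import Literature.Analysis.FunctionSpaces.HolderManifoldLaplacian
import Literature.Analysis.FunctionSpaces.HolderManifoldLaplacianLocality
import Literature.Analysis.FunctionSpaces.HolderChartRestriction
import Literature.Geometry.Riemannian.GurskyViaclovskyOpenness
import HarnessLib

/-!
# Gursky–Viaclovsky openness of the σ₂ continuity path — `gurskyViaclovsky_pathOpen_weighted_four` HOLDS (re-homed proofs)

**Gursky–Viaclovsky openness — the named fact `Literature.Geometry.Riemannian.gurskyViaclovsky_pathOpen_weighted_four`
(`GurskyViaclovskyOpenness.lean`) HOLDS**: on a closed Riemannian `4`-manifold the solvable set `𝒮` of the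
weighted `σ₂` continuity path is open (M. J. Gursky, J. A. Viaclovsky, *A fully nonlinear equation on
four-manifolds with positive scalar curvature*, J. Differential Geom. 63 (2003) 131–154, Prop. 2 and §5
[GurskyViaclovsky2003]: "the implicit function theorem (see [GT]) implies that `𝒮` is open"; D. Gilbarg,
N. S. Trudinger, *Elliptic Partial Differential Equations of Second Order* (2001), Thm. 17.6 (implicit
function theorem), Thm. 5.2 (method of continuity), Thm. 6.2/§6.3 (Schauder), Thm. 3.7 (maximum principle),
Lemma 17.16 (regularity) [GilbargTrudinger2001]).  The support file `GurskyViaclovskyOpennessProofs.lean`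
lists as "NOT here (the analytic core; why the fact is not discharged)" the Hölder-space elliptic theory on
a closed manifold; that theory has since landed (`Literature/Analysis/FunctionSpaces/HolderManifold*`,
`Literature/Analysis/PDE/{DifferenceQuotientRegularity,EllipticDifferentiatedProblem}`,
`Literature/Geometry/Riemannian/GurskyViaclovsky{Linearisation,LinearisationChart,ChartStructure,ChartEquationC2,…}`)
and this file assembles the discharge from it: the zero-finding map `Φ(t, w) = F_t(w) − q e^{−4w}` on
`ℝ × C^{2,α}_𝔄(M)` and its strict derivative; the Schauder estimate for `Δ_g − 1`; the maximum-principle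
`C⁰` bound along the continuity segment; invertibility of the linearisation (Prop. 2) by the method of
continuity; elliptic regularity of `C^{2,α}` solutions (Lemma 17.16: difference quotients, differentiation
of the equation, induction); persistence of admissibility; and the openness theorem
`gurskyViaclovsky_pathOpen_weighted_four_holds` (EXACT name).
RE-HOMED into `Literature/` by the Hodge foundations lane (`lit-hodgefound`, seat p20, generation 40): verbatim
DECLARATION-LEVEL ports (the declarations needed, in dependency order, each Part with a neutralised module
docstring) of `Summits/SmoothPoincare4/SmoothPoincare4/Theorems/EntropyRungChangGurskyYang{StubPathMapStrictFDeriv (3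
declarations), StubModelEstimate (2), HelperSegmentSupBound (1), StubLinearisedInvertibleOfChartRep (5),
HelperLinearisedChartRep (1), StubLinearisedInvertible (1), StubRegularityOfInduction (1), HelperRegularityInduction (1),
HelperDifferentiateEquation (1), HelperDqRegularityStep (1), HelperRegularityInductionHolds (1),
StubBackgroundScalarTendsto (6), ∅ (2)}.lean`, namespace `Summit.SmoothPoincare4.SmoothPoincare4.Theorems.MargerinRails`
re-rooted as `Literature.Geometry.Riemannian.GurskyViaclovskyOpen` (the in-tree `stub_…`/`helper_…` theorem names are
kept so that twins have the same short names; they are proved theorems).  Theorem-only file: no definition, no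
new named fact (D-0026); imports Mathlib/Literature only; every declaration carries the citation of the printed
statement it formalises or serves.  The Summits originals stay in place (transitional duplication).  WHAT THIS
IS NOT: nothing here bears on the smooth Poincaré conjecture in dimension four or on any summit statement; it
is elliptic PDE on a closed 4-manifold.
-/

noncomputable section

/-!
## Part 1 — port of `Summits/SmoothPoincare4/SmoothPoincare4/Theorems/EntropyRungChangGurskyYangStubPathMapStrictFDeriv.lean` (3 declarations kept)

# The zero-finding map `Φ(t, w) = F_t(w) − q e^{−4w}` of the openness step is strictly differentiable
# `ℝ × C^{2,α}_𝔄(M) → C^{0,α}_𝔄(M)`, with the tree's linearisation as `∂_w Φ`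

For Hölder chart data `𝔄` on the compact `M`, a smooth Riemannian `g`, a smooth `q` and `0 ≤ α ≤ 1`
there is a map `Φ : ℝ × C^{2,α}_𝔄(M) → C^{0,α}_𝔄(M)`, `Φ(t, w)(x) = F_t(w)(x) − q(x) e^{−4 w(x)}`
(`F_t = backgroundPathOperator g t`, the weighted `σ₂` path operator on the background,
`GurskyViaclovskyOpennessProofs.lean`), strictly differentiable everywhere, whose partial derivative in `w`
is pointwise the linearisation `𝓛_{t,w}φ + 4q e^{−4w}φ` (`GurskyViaclovskyLinearisation.lean`).
Assembly of Literature pieces: the `C²` chart equation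
(`backgroundPathOperator_chart_eq_chartOperator_of_contMDiff_two`, `GurskyViaclovskyChartEquationC2.lean`),
the globally smooth chart structure function (`exists_contDiff_chartStructure`,
`GurskyViaclovskyChartStructure.lean`), smooth superposition operators on chart Hölder spaces
(`exists_contDiff_manifoldNemytskii`, `HolderManifoldNemytskii.lean`), and uniqueness of derivatives along
`s ↦ (t, w + sφ)` (`hasDerivAt_backgroundPathOperator`).

References: M. J. Gursky, J. A. Viaclovsky, J. Differential Geom. 63 (2003) 131–154, §2 (proof of Prop. 2)
and §5 [GurskyViaclovsky2003]; D. Gilbarg, N. S. Trudinger, *Elliptic Partial Differential Equations of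
Second Order* (2001), Thm. 17.6 [GilbargTrudinger2001].
-/

section Part1

-- spaces of iterated continuous linear maps need a deeper instance search
set_option maxSynthPendingDepth 3

open _root_.Set _root_.Function _root_.Filter
open scoped _root_.Manifold _root_.ContDiff _root_.Topology _root_.NNReal

namespace Literature.Geometry.Riemannian.GurskyViaclovskyOpen

open Literature.Analysis.FunctionSpaces Literature.Geometry.Riemannian
open Literature.Geometry.Riemannian.GurskyViaclovskyPath
open Literature.Geometry.Lorentzian Literature.Geometry.Lorentzian.PseudoRiemannianMetric
open Literature.Geometry.Lorentzian.MetricCoord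

/-! ### The chart data at a centre `c` -/

section ChartData

variable {M : Type} [TopologicalSpace M] [ChartedSpace (EuclideanSpace ℝ (Fin 4)) M]
  [IsManifold (𝓡 4) ∞ M]
  (g : PseudoRiemannianMetric (𝓡 4) ∞ (EuclideanSpace ℝ (Fin 4)) (TangentSpace (𝓡 4) : M → Type _))
  [g.HasLeviCivita]

/-- **The chart structure data at a centre `c`.** Components `G` of the pulled-back metric on the
chart target (smooth, symmetric, nondegenerate: `IsMetricOn`), the Weyl weight `W = |W_g|² ∘ chart⁻¹`
and the right side `Q = q ∘ chart⁻¹` (both smooth on the target), and the chart form of the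
background path operator for every `C²` function `w`:
`F_t(w)(chart⁻¹ y) = chartOperator G t (W y) y (−Dŵ(y)) (−D²ŵ(y))`, `ŵ = w ∘ chart⁻¹`.
[cite: GurskyViaclovsky2003, §1 (change1)–(PDE)] -/
theorem chart_structure_data (hg : g.IsRiemannian) {q : M → ℝ}
    (hq : ContMDiff (𝓡 4) 𝓘(ℝ) ∞ q) (c : M) :
    ∃ (G : EuclideanSpace ℝ (Fin 4) →
        EuclideanSpace ℝ (Fin 4) →L[ℝ] EuclideanSpace ℝ (Fin 4) →L[ℝ] ℝ)
      (W Q : EuclideanSpace ℝ (Fin 4) → ℝ),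
      IsMetricOn G (chartAt (EuclideanSpace ℝ (Fin 4)) c).target ∧
      ContDiffOn ℝ ∞ W (chartAt (EuclideanSpace ℝ (Fin 4)) c).target ∧
      ContDiffOn ℝ ∞ Q (chartAt (EuclideanSpace ℝ (Fin 4)) c).target ∧
      (∀ y, Q y = q ((chartAt (EuclideanSpace ℝ (Fin 4)) c).symm y)) ∧
      ∀ (t : ℝ) (w : M → ℝ), ContMDiff (𝓡 4) 𝓘(ℝ) 2 w →
        ∀ y ∈ (chartAt (EuclideanSpace ℝ (Fin 4)) c).target,
          backgroundPathOperator g t w ((chartAt (EuclideanSpace ℝ (Fin 4)) c).symm y) =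
            chartOperator G t (W y) y
              (-fderiv ℝ (fun z => w ((chartAt (EuclideanSpace ℝ (Fin 4)) c).symm z)) y)
              (-fderiv ℝ (fderiv ℝ (fun z => w ((chartAt (EuclideanSpace ℝ (Fin 4)) c).symm z))) y) := by
  classical
  -- the inverse chart at `c` and the pulled-back metric (as in the closedness programme)
  set U : TopologicalSpace.Opens (EuclideanSpace ℝ (Fin 4)) :=
    ⟨(chartAt (EuclideanSpace ℝ (Fin 4)) c).target,
      (chartAt (EuclideanSpace ℝ (Fin 4)) c).open_target⟩
  set Φ : U → M := fun u ↦ (chartAt (EuclideanSpace ℝ (Fin 4)) c).symm u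
  have hΦ : ContMDiff 𝓘(ℝ, EuclideanSpace ℝ (Fin 4)) 𝓘(ℝ, EuclideanSpace ℝ (Fin 4)) (∞ + 1) Φ :=
    ChartInverseSelf.contMDiff_symm c
  have hΦ' : ∀ u, Function.Injective
      (mfderiv 𝓘(ℝ, EuclideanSpace ℝ (Fin 4)) 𝓘(ℝ, EuclideanSpace ℝ (Fin 4)) Φ u) :=
    ChartInverseSelf.injective_mfderiv_symm c
  have hdim : Module.finrank ℝ (EuclideanSpace ℝ (Fin 4)) =
      Module.finrank ℝ (EuclideanSpace ℝ (Fin 4)) := rfl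
  have hpb : contMDiff_pullbackBilin 𝓘(ℝ, EuclideanSpace ℝ (Fin 4)) M
      𝓘(ℝ, EuclideanSpace ℝ (Fin 4)) U ∞ := contMDiff_pullbackBilin_holds
  set gU := g.comap hpb Φ hΦ hΦ' hdim
  haveI : gU.HasLeviCivita := gU.hasLeviCivita
  set G : EuclideanSpace ℝ (Fin 4) →
      EuclideanSpace ℝ (Fin 4) →L[ℝ] EuclideanSpace ℝ (Fin 4) →L[ℝ] ℝ :=
    Function.extend (Subtype.val : U → EuclideanSpace ℝ (Fin 4))
      (fun y : U ↦ (gU.val y :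
        EuclideanSpace ℝ (Fin 4) →L[ℝ] EuclideanSpace ℝ (Fin 4) →L[ℝ] ℝ)) (fun _ ↦ 0) with hGdef
  have hG : ∀ y : U, gU.val y = G y := fun y ↦ by
    rw [hGdef, Subtype.val_injective.extend_apply]
  have hmet : IsMetricOn G (U : Set (EuclideanSpace ℝ (Fin 4))) := OpensChart.isMetricOn_repr hG
  have hgUR : gU.IsRiemannian := fun z v hv ↦ by
    have h1 : gU.val z v v = g.val (Φ z)
        (mfderiv 𝓘(ℝ, EuclideanSpace ℝ (Fin 4)) 𝓘(ℝ, EuclideanSpace ℝ (Fin 4)) Φ z v)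
        (mfderiv 𝓘(ℝ, EuclideanSpace ℝ (Fin 4)) 𝓘(ℝ, EuclideanSpace ℝ (Fin 4)) Φ z v) := rfl
    rw [h1]
    exact hg _ _ fun h0 ↦ hv ((hΦ' z) (by
      rw [h0]
      exact ((mfderiv 𝓘(ℝ, EuclideanSpace ℝ (Fin 4)) 𝓘(ℝ, EuclideanSpace ℝ (Fin 4)) Φ
        z).map_zero).symm))
  -- the Weyl weight and the right-hand side in the chart
  set W : EuclideanSpace ℝ (Fin 4) → ℝ :=
    fun z ↦ g.weylNormSq ((chartAt (EuclideanSpace ℝ (Fin 4)) c).symm z)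
  have hWy : ∀ y : U, W y = gU.weylNormSq y := fun y ↦
    (g.weylNormSq_comap hpb hΦ hΦ' hdim hg y).symm
  have hW : ContDiffOn ℝ ∞ W (U : Set (EuclideanSpace ℝ (Fin 4))) :=
    contDiffOn_of_eq_weylNormSq gU hG hgUR hWy
  set Q : EuclideanSpace ℝ (Fin 4) → ℝ :=
    fun z ↦ q ((chartAt (EuclideanSpace ℝ (Fin 4)) c).symm z)
  have hQ : ContDiffOn ℝ ∞ Q (U : Set (EuclideanSpace ℝ (Fin 4))) :=
    contDiffOn_comp_chart_symm hq c Subset.rfl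
  refine ⟨G, W, Q, hmet, hW, hQ, fun y => rfl, fun t w hw y hy => ?_⟩
  -- the chart equation for `C²` functions, in the `u = −w` convention of the tree
  have h := backgroundPathOperator_chart_eq_chartOperator_of_contMDiff_two g hg t (u := fun m => -w m)
    hw.neg c hy
  simp only [neg_neg] at h
  have e1 : fderiv ℝ (fun z => -w ((chartAt (EuclideanSpace ℝ (Fin 4)) c).symm z)) y =
      -fderiv ℝ (fun z => w ((chartAt (EuclideanSpace ℝ (Fin 4)) c).symm z)) y := fderiv_neg
  have e2 : fderiv ℝ (fderiv ℝ fun z => -w ((chartAt (EuclideanSpace ℝ (Fin 4)) c).symm z)) y =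
      -fderiv ℝ (fderiv ℝ fun z => w ((chartAt (EuclideanSpace ℝ (Fin 4)) c).symm z)) y := by
    have e : fderiv ℝ (fun z => -w ((chartAt (EuclideanSpace ℝ (Fin 4)) c).symm z)) =
        fun z => -fderiv ℝ (fun z' => w ((chartAt (EuclideanSpace ℝ (Fin 4)) c).symm z')) z := by
      funext z; exact fderiv_neg
    rw [e]
    exact fderiv_neg
  rw [e1, e2] at h
  exact h

end ChartData

/-! ### The stub -/

/-- Evaluation at a point is a continuous linear functional on `C^{k,r}_𝔄(M)`. [cite: GurskyViaclovsky2003, §2 (proof of Prop. 2) and §5 (the zero-finding map of the implicit function theorem; Gilbarg–Trudinger Thm. 17.6)] -/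
theorem hasFDerivAt_eval {ι : Type} [Fintype ι] {E : Type} [NormedAddCommGroup E] [NormedSpace ℝ E]
    {N : Type*} [TopologicalSpace N] [ChartedSpace E N] (𝔄 : HolderChartData ι E N) {k : ℕ}
    {r : ℝ≥0} (x : N) :
    ∃ ev : HolderManifoldFunction 𝔄 ℝ k r →L[ℝ] ℝ, ∀ u, ev u = u x :=
  ⟨{ toFun := fun u => u x,
      map_add' := fun _ _ => rfl,
      map_smul' := fun _ _ => rfl,
      cont := HolderManifoldFunction.continuous_eval x }, fun _ => rfl⟩

/-- **THE ZERO-FINDING MAP `Φ(t, w) = F_t(w) − q e^{−4w}` IS STRICTLY DIFFERENTIABLE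
`ℝ × C^{2,α}_𝔄 → C^{0,α}_𝔄` WITH `∂_w Φ = 𝓛_{t,w} + 4q e^{−4w}`** (see the Part docstring for the proof). [cite: GurskyViaclovsky2003, §2 proof of Prop. 2 and §5]
[cite: GilbargTrudinger2001, Thm. 17.6] -/
theorem stub_pathMapStrictFDeriv :
    ∀ (M : Type) [TopologicalSpace M] [T2Space M] [ChartedSpace (EuclideanSpace ℝ (Fin 4)) M]
      [IsManifold (𝓡 4) ∞ M] [CompactSpace M] {ι : Type} [Fintype ι]
      (𝔄 : HolderChartData ι (EuclideanSpace ℝ (Fin 4)) M)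
      (g : PseudoRiemannianMetric (𝓡 4) ∞ (EuclideanSpace ℝ (Fin 4)) (TangentSpace (𝓡 4) : M → Type _))
      [g.HasLeviCivita], g.IsRiemannian →
      ∀ (q : M → ℝ), ContMDiff (𝓡 4) 𝓘(ℝ) ∞ q → ∀ {α : ℝ≥0} (_hα : α ≤ 1),
      ∃ Φ : ℝ × HolderManifoldFunction 𝔄 ℝ 2 α → HolderManifoldFunction 𝔄 ℝ 0 α,
        (∀ (t : ℝ) (w : HolderManifoldFunction 𝔄 ℝ 2 α) (x : M),
          Φ (t, w) x = backgroundPathOperator g t w x - q x * Real.exp (-4 * w x)) ∧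
        ∀ (t : ℝ) (w : HolderManifoldFunction 𝔄 ℝ 2 α),
          ∃ Φ' : ℝ × HolderManifoldFunction 𝔄 ℝ 2 α →L[ℝ] HolderManifoldFunction 𝔄 ℝ 0 α,
            HasStrictFDerivAt Φ Φ' (t, w) ∧
            ∀ (φ : HolderManifoldFunction 𝔄 ℝ 2 α) (x : M),
              Φ' ((0 : ℝ), φ) x =
                linearisedBackgroundOperator g t w φ x + 4 * q x * Real.exp (-4 * w x) * φ x := by
  intro M _ _ _ _ _ ι _ 𝔄 g _ hg q hq α hα
  classical
  -- the structure function and the chart data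
  obtain ⟨𝒩, h𝒩, h𝒩_eq⟩ := exists_contDiff_chartStructure (E := EuclideanSpace ℝ (Fin 4))
  choose G W Q hmet hW hQ hQ_eq hchart using fun j : ι => chart_structure_data g hg hq (𝔄.center j)
  -- the cut-off frozen coefficients `Cⱼ = ηⱼ • (W, Q, G, ♯, Γ, Ric)` as members of `C^{0,α}_b`
  have hCfun : ∀ j, ContDiffOn ℝ ∞ (fun y => (W j y, Q j y, G j y, sharpAt (G j) y, chrAt (G j) y,
      ricAt (G j) y)) (𝔄.chart j).target := fun j =>
    (hW j).prodMk ((hQ j).prodMk ((hmet j).contDiffOn.prodMk ((hmet j).contDiffOn_sharpAt.prodMk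
      ((hmet j).contDiffOn_chrAt.prodMk (hmet j).contDiffOn_ricAt))))
  have hC : ∀ j, ContDiff ℝ ∞ fun y => 𝔄.cutoff j y • (W j y, Q j y, G j y, sharpAt (G j) y,
      chrAt (G j) y, ricAt (G j) y) := fun j =>
    (𝔄.contDiff_cutoff j).smul_of_contDiffOn (𝔄.chart j).open_target (hCfun j)
      (𝔄.tsupport_cutoff_subset j)
  have hCc : ∀ j, HasCompactSupport fun y => 𝔄.cutoff j y • (W j y, Q j y, G j y, sharpAt (G j) y,
      chrAt (G j) y, ricAt (G j) y) := fun j => (𝔄.hasCompactSupport_cutoff j).smul_right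
  let C : ι → ContDiffHolderFunction (EuclideanSpace ℝ (Fin 4)) (ℝ × (ℝ × ((EuclideanSpace ℝ (Fin 4) →L[ℝ]
      EuclideanSpace ℝ (Fin 4) →L[ℝ] ℝ) × (((EuclideanSpace ℝ (Fin 4) →L[ℝ] ℝ) →L[ℝ]
      EuclideanSpace ℝ (Fin 4)) × ((EuclideanSpace ℝ (Fin 4) →L[ℝ] EuclideanSpace ℝ (Fin 4) →L[ℝ]
      EuclideanSpace ℝ (Fin 4)) × (EuclideanSpace ℝ (Fin 4) →L[ℝ] EuclideanSpace ℝ (Fin 4) →L[ℝ] ℝ))))))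
      0 α := fun j => ⟨_, MemContDiffHolder.of_contDiff_of_hasCompactSupport (hC j) (hCc j) hα⟩
  have hC_apply : ∀ j y, C j y = 𝔄.cutoff j y • (W j y, Q j y, G j y, sharpAt (G j) y, chrAt (G j) y,
      ricAt (G j) y) := fun j y => rfl
  -- the smooth map through the charts
  obtain ⟨Φ, hΦ, hΦ_eq⟩ :=
    exists_contDiff_manifoldNemytskii 𝔄 hα (fun _ => 𝒩) (fun _ => h𝒩) C
  -- its pointwise value
  have hval : ∀ (t : ℝ) (w : HolderManifoldFunction 𝔄 ℝ 2 α) (x : M),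
      Φ (t, w) x = backgroundPathOperator g t w x - q x * Real.exp (-4 * w x) := by
    intro t w x
    have hw2 : ContMDiff (𝓡 4) 𝓘(ℝ) 2 (w : M → ℝ) := w.contMDiff
    rw [hΦ_eq]
    have key : ∀ j, 𝔄.ρ j x * 𝒩 (t, C j (𝔄.chart j x), w x,
        fderiv ℝ (fun y => w ((𝔄.chart j).symm y)) (𝔄.chart j x),
        fderiv ℝ (fderiv ℝ (fun y => w ((𝔄.chart j).symm y))) (𝔄.chart j x)) =
        𝔄.ρ j x * (backgroundPathOperator g t w x - q x * Real.exp (-4 * w x)) := by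
      intro j
      by_cases hx : 𝔄.ρ j x = 0
      · rw [hx, zero_mul, zero_mul]
      · have hxs : x ∈ (𝔄.chart j).source := by
          by_contra h
          exact hx (𝔄.ρ_eq_zero h)
        have hy : 𝔄.chart j x ∈ (𝔄.chart j).target := (𝔄.chart j).map_source hxs
        have hη : 𝔄.cutoff j (𝔄.chart j x) = 1 := (𝔄.cutoff_eventuallyEq_one hx).self_of_nhds
        rw [hC_apply, hη, one_smul, h𝒩_eq, ← hchart j t w hw2 _ hy, hQ_eq,
          (𝔄.chart j).left_inv hxs]
    rw [Finset.sum_congr rfl fun j _ => key j]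
    have hsum := 𝔄.sum_smul_eq x (backgroundPathOperator g t w x - q x * Real.exp (-4 * w x))
    simpa only [smul_eq_mul] using hsum
  refine ⟨Φ, hval, fun t w => ?_⟩
  -- strict differentiability from smoothness
  have hsd : HasStrictFDerivAt Φ (fderiv ℝ Φ (t, w)) (t, w) :=
    hΦ.contDiffAt.hasStrictFDerivAt (by simp)
  refine ⟨fderiv ℝ Φ (t, w), hsd, fun φ x => ?_⟩
  -- evaluate at `x` along the line `s ↦ (t, w + s • φ)`
  obtain ⟨ev, hev⟩ := hasFDerivAt_eval 𝔄 (k := 0) (r := α) x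
  have hline : HasDerivAt (fun s : ℝ => ((t, w + s • φ) : ℝ × HolderManifoldFunction 𝔄 ℝ 2 α))
      (((0 : ℝ), φ) : ℝ × HolderManifoldFunction 𝔄 ℝ 2 α) 0 := by
    have h1 : HasDerivAt (fun s : ℝ => w + s • φ) φ 0 := by
      simpa using ((hasDerivAt_id (0 : ℝ)).smul_const φ).const_add w
    exact (hasDerivAt_const (0 : ℝ) t).prodMk h1
  have hcomp : HasDerivAt (fun s : ℝ => ev (Φ (t, w + s • φ))) (ev (fderiv ℝ Φ (t, w) ((0 : ℝ), φ))) 0 := by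
    have h0 : ((t, w + (0 : ℝ) • φ) : ℝ × HolderManifoldFunction 𝔄 ℝ 2 α) = (t, w) := by simp
    have hF : HasFDerivAt (fun p => ev (Φ p)) (ev ∘L fderiv ℝ Φ (t, w))
        ((t, w + (0 : ℝ) • φ) : ℝ × HolderManifoldFunction 𝔄 ℝ 2 α) := by
      rw [h0]
      exact ev.hasFDerivAt.comp _ hsd.hasFDerivAt
    have h := hF.comp_hasDerivAt (0 : ℝ) hline
    simpa only [Function.comp_def, ContinuousLinearMap.comp_apply] using h
  -- the same function computed pointwise
  have hfun : (fun s : ℝ => ev (Φ (t, w + s • φ))) = fun s =>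
      backgroundPathOperator g t (fun y => w y + s * φ y) x -
        q x * Real.exp (-4 * (w x + s * φ x)) := by
    funext s
    have hcoe : ((w + s • φ : HolderManifoldFunction 𝔄 ℝ 2 α) : M → ℝ) = fun y => w y + s * φ y := by
      funext y
      simp only [HolderManifoldFunction.coe_add, HolderManifoldFunction.coe_smul, Pi.add_apply,
        Pi.smul_apply, smul_eq_mul]
    rw [hev, hval, hcoe]
  have hpt : HasDerivAt (fun s : ℝ => backgroundPathOperator g t (fun y => w y + s * φ y) x -
      q x * Real.exp (-4 * (w x + s * φ x)))
      (linearisedBackgroundOperator g t w φ x - q x * (Real.exp (-4 * (w x + 0 * φ x)) * (-4 * φ x)))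
      0 := by
    refine (hasDerivAt_backgroundPathOperator g (w.contMDiff x) (φ.contMDiff x) t).sub ?_
    have h1 : HasDerivAt (fun s : ℝ => -4 * (w x + s * φ x)) (-4 * φ x) 0 := by
      simpa using (((hasDerivAt_id (0 : ℝ)).mul_const (φ x)).const_add (w x)).const_mul (-4 : ℝ)
    exact (h1.exp).const_mul (q x)
  rw [hfun] at hcomp
  have huniq := hcomp.unique hpt
  rw [hev] at huniq
  rw [huniq]
  simp only [zero_mul, add_zero]
  ring

end Literature.Geometry.Riemannian.GurskyViaclovskyOpen

end Part1

/-!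
## Part 2 — port of `Summits/SmoothPoincare4/SmoothPoincare4/Theorems/EntropyRungChangGurskyYangStubModelEstimate.lean` (2 declarations kept)

# The Schauder estimate for the model operator `L₀ = Δ_g − 1` on `C^{2,α}_𝔄(M)`

On a closed Riemannian `4`-manifold with Hölder chart data `𝔄` and `0 < α < 1`,
`‖u‖_{C^{2,α}_𝔄} ≤ C ‖(Δ_g − 1) u‖_{C^{0,α}_𝔄}` for all `u ∈ C^{2,α}_𝔄(M)` (`stub_modelEstimate`; the
hypothesis `hest` of `Literature.Analysis.FunctionSpaces.exists_modelOperator_continuousLinearEquiv_of_estimate`):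
the tree's global Schauder estimate `exists_schauder_global` for the chart representation of `Δ_g − 1`
(`dalembertianPieceCLM_apply_eq`), its coefficient hypotheses (`gramInv_symm`,
`exists_bound_holderWith_of_hasCompactSupport`, `gramInv_quadratic_pos`,
`exists_ellipticity_const_of_continuousOn`), and the maximum-principle bound
`HolderManifoldFunction.norm_apply_le_card_mul_norm_modelOperator` removing the `sup |u|` term.

References: D. Gilbarg, N. S. Trudinger (2001), Thm. 3.7, Thm. 6.2, §6.3, Thm. 6.14 [GilbargTrudinger2001];
M. J. Gursky, J. A. Viaclovsky, J. Differential Geom. 63 (2003), Prop. 2 and §5 [GurskyViaclovsky2003].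
-/

section Part2

open _root_.Set _root_.Function _root_.Filter
open scoped _root_.Manifold _root_.ContDiff _root_.Topology _root_.NNReal
open Literature.Analysis.FunctionSpaces Literature.Geometry.Riemannian
open Literature.Geometry.Lorentzian Literature.Geometry.Lorentzian.PseudoRiemannianMetric

namespace Literature.Geometry.Riemannian.GurskyViaclovskyOpen

/-- An algebraic rearrangement identifying the chart representation of `Δ_g − 1`:
`p(η(ΣΣ G D² + Σ F D + 0·r)) − p r = p(ΣΣ (ηG) D² + Σ (ηF) D + (−1) r)`. [cite: GilbargTrudinger2001, Thm. 6.2 and §6.3 with Thm. 3.7 (global Schauder estimate for Δ_g − 1 on a closed manifold)] -/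
theorem modelEstimate_rep_algebra {κ : Type*} [Fintype κ] (p η r : ℝ) (G D2 : κ → κ → ℝ)
    (F D1 : κ → ℝ) :
    p * (η * ((∑ i, ∑ i', G i i' * D2 i i') + (∑ l, F l * D1 l) + 0 * r)) - p * r =
      p * ((∑ i, ∑ i', η * G i i' * D2 i i') + (∑ l, η * F l * D1 l) + (-1) * r) := by
  have e2 : (∑ i, ∑ i', η * G i i' * D2 i i') = η * ∑ i, ∑ i', G i i' * D2 i i' := by
    rw [Finset.mul_sum]
    refine Finset.sum_congr rfl fun i _ => ?_
    rw [Finset.mul_sum]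
    exact Finset.sum_congr rfl fun i' _ => by ring
  have e1 : (∑ l, η * F l * D1 l) = η * ∑ l, F l * D1 l := by
    rw [Finset.mul_sum]
    exact Finset.sum_congr rfl fun l _ => by ring
  rw [e2, e1]
  ring

/-- **THE SCHAUDER ESTIMATE FOR THE MODEL OPERATOR `Δ_g − 1` on `C^{2,α}_𝔄(M)`**
(Gilbarg–Trudinger Thm. 6.2 patched over the charts = the tree's `exists_schauder_global`,
specialised to the chart representation of `Δ_g` (`dalembertianPieceCLM_apply_eq`, coefficients
`gramInv`, `firstOrderCoeff`, smooth on the chart targets, uniformly elliptic for Riemannian `g` on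
the compact thickenings), plus the a-priori bound `sup|u| ≤ sup|(Δ_g − 1)u|` of the maximum
principle and `‖f x‖ ≤ card ι · ‖f‖` (`norm_apply_le`)). This is exactly the hypothesis `hest` of
`exists_modelOperator_continuousLinearEquiv_of_estimate` (`HolderManifoldModelIsomorphism.lean`).
[cite: GilbargTrudinger2001, Thm. 6.2 and §6.3, Thm. 6.14] -/
theorem stub_modelEstimate :
    ∀ (M : Type) [TopologicalSpace M] [T2Space M] [ChartedSpace (EuclideanSpace ℝ (Fin 4)) M]
      [IsManifold (𝓡 4) ∞ M] [CompactSpace M] {ι : Type} [Fintype ι]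
      (𝔄 : HolderChartData ι (EuclideanSpace ℝ (Fin 4)) M)
      (g : PseudoRiemannianMetric (𝓡 4) ∞ (EuclideanSpace ℝ (Fin 4)) (TangentSpace (𝓡 4) : M → Type _))
      [g.HasLeviCivita], g.IsRiemannian → ∀ {α : ℝ≥0}, 0 < α → ∀ (hα1 : α < 1),
      ∃ C : ℝ, ∀ u : HolderManifoldFunction 𝔄 ℝ (0 + 2) α, ‖u‖ ≤ C * ‖modelOperatorCLM 𝔄 g hα1.le u‖ := by
  intro M _ _ _ _ _ ι _ 𝔄 g _ hg α hα0 hα1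
  -- the orthonormal frame of the model space
  set bE : OrthonormalBasis (Fin 4) ℝ (EuclideanSpace ℝ (Fin 4)) :=
    EuclideanSpace.basisFun (Fin 4) ℝ
  have h1top : ((1 : ℕ) : WithTop ℕ∞) ≤ ((⊤ : ℕ∞) : WithTop ℕ∞) := WithTop.coe_le_coe.mpr le_top
  -- Step 1: closed thickenings `K'_j` of `K_j = chart_j(tsupport ρ_j)` on which `η_j = 1`
  obtain ⟨ρ₁, hρ₁, hη1⟩ := 𝔄.exists_cthickening_cutoff_eq_one
  set K' : ι → Set (EuclideanSpace ℝ (Fin 4)) := fun j =>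
    Metric.cthickening ρ₁ (𝔄.chart j '' tsupport (𝔄.ρ j))
  have hK'c : ∀ j, IsCompact (K' j) := fun j => (𝔄.isCompact_image_tsupport j).1.cthickening
  have hK't : ∀ j, K' j ⊆ (𝔄.chart j).target := fun j y hy =>
    𝔄.mem_target_of_cutoff_ne_zero (by rw [hη1 j y hy]; exact one_ne_zero)
  have hthick : ∀ j, Metric.thickening ρ₁ (𝔄.chart j '' tsupport (𝔄.ρ j)) ⊆ K' j := fun j =>
    Metric.thickening_subset_cthickening _ _
  -- Step 2: the ellipticity constant of `Ĝ⁻¹` on the compact sets `K'_j`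
  have hl' : ∀ j, ∃ lam : ℝ, 0 < lam ∧ ∀ y ∈ K' j, ∀ ξ : Fin 4 → ℝ, lam * ∑ i, ξ i ^ 2 ≤
      ∑ i, ∑ i', gramInv bE.toBasis g (𝔄.center j) y i i' * ξ i * ξ i' := fun j =>
    exists_ellipticity_const_of_continuousOn (hK'c j)
      (fun i i' => (contDiffOn_gramInv bE.toBasis g (𝔄.center j) i i').continuousOn.mono (hK't j))
      (fun y hy ξ hξ => gramInv_quadratic_pos bE.toBasis g (𝔄.center j) hg (hK't j hy) hξ)
  choose lam hlam0 hlam using hl'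
  obtain ⟨l, hl, hlle⟩ := exists_pos_forall_le_of_finite hlam0
  -- Step 3: the coefficients `η_j Ĝ⁻¹`, `η_j b`, `−1` and their bounds
  set acoef : ι → Fin 4 → Fin 4 → EuclideanSpace ℝ (Fin 4) → ℝ := fun j i i' y =>
    𝔄.cutoff j y * gramInv bE.toBasis g (𝔄.center j) y i i' with hacoef
  set bcoef : ι → Fin 4 → EuclideanSpace ℝ (Fin 4) → ℝ := fun j l' y =>
    𝔄.cutoff j y * firstOrderCoeff bE.toBasis g (𝔄.center j) l' y with hbcoef
  set ccoef : ι → EuclideanSpace ℝ (Fin 4) → ℝ := fun _ _ => -1 with hccoef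
  have haS : ∀ j i i', ContDiff ℝ ∞ (acoef j i i') := fun j i i' =>
    ContDiffHolderFunction.contDiff_cutoff_mul (𝔄.contDiff_cutoff j) (𝔄.chart j).open_target
      (contDiffOn_gramInv bE.toBasis g (𝔄.center j) i i') (𝔄.tsupport_cutoff_subset j)
  have hbS : ∀ j l', ContDiff ℝ ∞ (bcoef j l') := fun j l' =>
    ContDiffHolderFunction.contDiff_cutoff_mul (𝔄.contDiff_cutoff j) (𝔄.chart j).open_target
      (contDiffOn_firstOrderCoeff bE.toBasis g (𝔄.center j) l') (𝔄.tsupport_cutoff_subset j)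
  choose Zs Zh hZ using fun j i i' => exists_bound_holderWith_of_hasCompactSupport
    ((haS j i i').of_le (by exact_mod_cast h1top))
    (ContDiffHolderFunction.hasCompactSupport_cutoff_mul (𝔄.hasCompactSupport_cutoff j) _) hα1.le
  choose Ws Wh hW using fun j l' => exists_bound_holderWith_of_hasCompactSupport
    ((hbS j l').of_le (by exact_mod_cast h1top))
    (ContDiffHolderFunction.hasCompactSupport_cutoff_mul (𝔄.hasCompactSupport_cutoff j) _) hα1.le
  set Ka : ℝ≥0 := Finset.univ.sup (fun q : ι × Fin 4 × Fin 4 =>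
    Zs q.1 q.2.1 q.2.2 + Zh q.1 q.2.1 q.2.2)
  set Kb : ℝ≥0 := Finset.univ.sup (fun q : ι × Fin 4 => Ws q.1 q.2 + Wh q.1 q.2)
  have hKa' : ∀ j i i', Zs j i i' ≤ Ka ∧ Zh j i i' ≤ Ka := fun j i i' => by
    have h := Finset.le_sup
      (f := fun q : ι × Fin 4 × Fin 4 => Zs q.1 q.2.1 q.2.2 + Zh q.1 q.2.1 q.2.2)
      (Finset.mem_univ (j, i, i'))
    exact ⟨le_self_add.trans h, le_add_self.trans h⟩
  have hKb' : ∀ j l', Ws j l' ≤ Kb ∧ Wh j l' ≤ Kb := fun j l' => by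
    have h := Finset.le_sup (f := fun q : ι × Fin 4 => Ws q.1 q.2 + Wh q.1 q.2)
      (Finset.mem_univ (j, l'))
    exact ⟨le_self_add.trans h, le_add_self.trans h⟩
  have ha0 : ∀ j i i' y, ‖acoef j i i' y‖ ≤ Ka := fun j i i' y =>
    ((hZ j i i').1 y).trans (NNReal.coe_le_coe.2 (hKa' j i i').1)
  -- Step 4: the global Schauder estimate with these data
  obtain ⟨C, -, hC⟩ := exists_schauder_global 𝔄 bE hα0 hα1 hl (Fintype.card (Fin 4) * Ka) Ka Kb 1
    hρ₁
  have hsymm : ∀ j i i' y, acoef j i i' y = acoef j i' i y := fun j i i' y =>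
    congrArg (fun t : ℝ => 𝔄.cutoff j y * t) (gramInv_symm bE.toBasis g (𝔄.center j) y i i')
  have hlow : ∀ j, ∀ y ∈ Metric.thickening ρ₁ (𝔄.chart j '' tsupport (𝔄.ρ j)), ∀ ξ : Fin 4 → ℝ,
      l * ∑ i, ξ i ^ 2 ≤ ∑ i, ∑ i', acoef j i i' y * ξ i * ξ i' := fun j y hy ξ => by
    have hyK : y ∈ K' j := hthick j hy
    calc l * ∑ i, ξ i ^ 2 ≤ lam j * ∑ i, ξ i ^ 2 :=
          mul_le_mul_of_nonneg_right (hlle j) (Finset.sum_nonneg fun i _ => sq_nonneg _)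
      _ ≤ ∑ i, ∑ i', gramInv bE.toBasis g (𝔄.center j) y i i' * ξ i * ξ i' := hlam j y hyK ξ
      _ = ∑ i, ∑ i', acoef j i i' y * ξ i * ξ i' := by simp only [hacoef, hη1 j y hyK, one_mul]
  have hup : ∀ j, ∀ y ∈ Metric.thickening ρ₁ (𝔄.chart j '' tsupport (𝔄.ρ j)), ∀ ξ : Fin 4 → ℝ,
      ∑ i, ∑ i', acoef j i i' y * ξ i * ξ i' ≤ (Fintype.card (Fin 4) * Ka : ℝ) * ∑ i, ξ i ^ 2 :=
    fun j y _ ξ => quadratic_le_card_mul_of_abs_le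
      (fun i i' => by rw [← Real.norm_eq_abs]; exact ha0 j i i' y) ξ
  have haH : ∀ j i i', HolderOnWith Ka α (acoef j i i')
      (Metric.thickening ρ₁ (𝔄.chart j '' tsupport (𝔄.ρ j))) := fun j i i' =>
    ((hZ j i i').2.mono (hKa' j i i').2).holderOnWith _
  have hb0 : ∀ j l' y, y ∈ Metric.thickening ρ₁ (𝔄.chart j '' tsupport (𝔄.ρ j)) →
      ‖bcoef j l' y‖ ≤ Kb := fun j l' y _ =>
    ((hW j l').1 y).trans (NNReal.coe_le_coe.2 (hKb' j l').1)
  have hbH : ∀ j l', HolderOnWith Kb α (bcoef j l')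
      (Metric.thickening ρ₁ (𝔄.chart j '' tsupport (𝔄.ρ j))) := fun j l' =>
    ((hW j l').2.mono (hKb' j l').2).holderOnWith _
  have hc0 : ∀ j, ∀ y ∈ Metric.thickening ρ₁ (𝔄.chart j '' tsupport (𝔄.ρ j)),
      ‖ccoef j y‖ ≤ (1 : ℝ≥0) := fun j y _ => by simp [hccoef]
  have hcH : ∀ j, HolderOnWith 1 α (ccoef j)
      (Metric.thickening ρ₁ (𝔄.chart j '' tsupport (𝔄.ρ j))) := fun j y _ y' _ => by
    simp only [hccoef, PseudoEMetricSpace.edist_self, zero_le]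
  specialize hC acoef bcoef ccoef hsymm hlow hup (fun j i i' y _ => ha0 j i i' y) haH hb0 hbH
    hc0 hcH
  -- Step 5: conclusion
  refine ⟨C * (1 + Fintype.card ι), fun u => ?_⟩
  have hA : ∀ x, ‖u x‖ ≤ Fintype.card ι * ‖modelOperatorCLM 𝔄 g hα1.le u‖ := fun x =>
    u.norm_apply_le_card_mul_norm_modelOperator 𝔄 g hg hα1.le x
  have key : ‖u‖ ≤ C * (‖modelOperatorCLM 𝔄 g hα1.le u‖ +
      Fintype.card ι * ‖modelOperatorCLM 𝔄 g hα1.le u‖) := by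
    refine hC (modelOperatorCLM 𝔄 g hα1.le) ?_ u _ hA
    -- the chart representation of `Δ_g − 1`
    intro v j y
    have hv : (⇑(modelOperatorCLM 𝔄 g hα1.le v) : M → ℝ) = g.dalembertian ⇑v - ⇑v :=
      funext fun x => rfl
    have hL : dalembertianPieceCLM 𝔄 bE.toBasis g hα1.le j v y =
        𝔄.piece (fun _ : M => (1 : ℝ)) j y * (𝔄.cutoff j y *
          ((∑ a, ∑ b, gramInv bE.toBasis g (𝔄.center j) y a b *
              fderiv ℝ (fderiv ℝ (chartRestrictCLM 𝔄 hα1.le j (𝔄.cutoff j) (𝔄.contDiff_cutoff j)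
                (𝔄.hasCompactSupport_cutoff j) (𝔄.tsupport_cutoff_subset j) v :
                  EuclideanSpace ℝ (Fin 4) → ℝ)) y (bE.toBasis a) (bE.toBasis b)) +
            (∑ l', firstOrderCoeff bE.toBasis g (𝔄.center j) l' y *
              fderiv ℝ (chartRestrictCLM 𝔄 hα1.le j (𝔄.cutoff j) (𝔄.contDiff_cutoff j)
                (𝔄.hasCompactSupport_cutoff j) (𝔄.tsupport_cutoff_subset j) v :
                  EuclideanSpace ℝ (Fin 4) → ℝ) y (bE.toBasis l')) +
            0 * (chartRestrictCLM 𝔄 hα1.le j (𝔄.cutoff j) (𝔄.contDiff_cutoff j)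
                (𝔄.hasCompactSupport_cutoff j) (𝔄.tsupport_cutoff_subset j) v) y)) := by
      simp only [dalembertianPieceCLM, ContinuousLinearMap.coe_comp, Function.comp_apply,
        ContDiffHolderFunction.coeffCLM_apply, smul_eq_mul,
        ContDiffHolderFunction.localizedOperatorCLM_apply]
    rw [hv, 𝔄.piece_sub, Pi.sub_apply, ← dalembertianPieceCLM_apply_eq 𝔄 bE.toBasis g hα1.le j v y,
      hL, HolderChartData.piece_eq_piece_one_mul 𝔄 hα1.le v j y]
    simp only [OrthonormalBasis.coe_toBasis, iteratedFDeriv_two_apply, Matrix.cons_val_zero,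
      Matrix.cons_val_one, hacoef, hbcoef, hccoef]
    exact modelEstimate_rep_algebra _ _ _ _ _ _ _
  calc ‖u‖ ≤ C * (‖modelOperatorCLM 𝔄 g hα1.le u‖ +
      Fintype.card ι * ‖modelOperatorCLM 𝔄 g hα1.le u‖) := key
    _ = C * (1 + Fintype.card ι) * ‖modelOperatorCLM 𝔄 g hα1.le u‖ := by ring

end Literature.Geometry.Riemannian.GurskyViaclovskyOpen

end Part2

/-!
## Part 3 — port of `Summits/SmoothPoincare4/SmoothPoincare4/Theorems/EntropyRungChangGurskyYangHelperSegmentSupBound.lean` (1 declarations kept)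

# The maximum-principle `C⁰` bound, uniform along the method-of-continuity segment

At an admissible solution `w` of the weighted path equation on the background (`backgroundScalar g w > 0`,
`backgroundPathOperator g t w = q e^{−4w}`, `t ≤ 1`, `q > 0`) consider the segment
`L_s = (1 − s)(Δ_g − 1) + s(−L)`, `s ∈ [0, 1]`, from the model operator to minus the linearisation
`L = 𝓛_{t,w} + 4 q e^{−4w}` (`GurskyViaclovskyPath.linearisedBackgroundOperator`). `helper_segmentSupBound`:
there is `C₀`, independent of `s` and `u`, with `sup|u| ≤ C₀ · sup|L_s u|` for every `s ∈ [0,1]` and every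
`u ∈ C²(M)` — `L_s u = ⟨P_s, Hess_g u⟩_g + du(b_s) + c_s u` with `P_s ≥ 0` (ellipticity
`neg_principalForm_apply_self_nonneg` at an admissible solution, Gursky–Viaclovsky Prop. 1 (ii)) and
`c_s ≤ −min(1, c₁)`, `c₁ = 4 min_M q e^{−4w} > 0`, so the closed-manifold maximum principle
`mul_abs_le_of_maximumPrinciple` (`EllipticMaximumPrincipleClosed.lean`) applies.

References: M. J. Gursky, J. A. Viaclovsky, J. Differential Geom. 63 (2003), §2, Prop. 2 [GurskyViaclovsky2003];
D. Gilbarg, N. S. Trudinger (2001), Thm. 3.7 and Thm. 5.2 [GilbargTrudinger2001].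
-/

section Part3

open _root_.Set _root_.Filter
open scoped _root_.Manifold _root_.ContDiff _root_.Topology

namespace Literature.Geometry.Riemannian.GurskyViaclovskyOpen

open Literature.Geometry.Riemannian
open Literature.Geometry.Riemannian.GurskyViaclovskyPath
open Literature.Geometry.Lorentzian (PseudoRiemannianMetric)
open Literature.Geometry.Lorentzian.PseudoRiemannianMetric

/-- **Uniform `C⁰` bound along the continuity segment** (Gursky–Viaclovsky 2003, proof of
Prop. 2, with Gilbarg–Trudinger 2001, Thm. 3.7 / Thm. 5.2). Let `M` be a closed `4`-manifold with
a smooth Riemannian `g`, `q > 0` continuous, `t ≤ 1`, and `w ∈ C²(M)` an admissible solution of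
the background path equation (`backgroundScalar g w > 0`,
`backgroundPathOperator g t w = q e^{−4w}`). Then there is `C₀` such that for every `s ∈ [0,1]`,
every `u ∈ C²(M)` and every `B` with
`|(1−s)(Δ_g u − u) − s(𝓛_{t,w} u + 4 q e^{−4w} u)| ≤ B` on `M`, one has `|u| ≤ C₀ B` on `M`:
the operator `L_s = (1−s)(Δ_g − 1) + s(−(𝓛 + 4qe^{−4w}))` is
`⟨(1−s)g − sP, Hess_g u⟩_g + du(−s b) + c_s u` with `(1−s)g − sP ≥ 0`
(`neg_principalForm_apply_self_nonneg`) and `c_s = −(1−s) − 4sqe^{−4w} ≤ −min(1, 4 min qe^{−4w})`,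
so `mul_abs_le_of_maximumPrinciple` applies with a constant independent of `s`.
[cite: GurskyViaclovsky2003, §2, proof of Prop. 2] -/
theorem helper_segmentSupBound :
    ∀ (M : Type) [TopologicalSpace M] [T2Space M] [ChartedSpace (EuclideanSpace ℝ (Fin 4)) M]
      [IsManifold (modelWithCornersSelf ℝ (EuclideanSpace ℝ (Fin 4))) ((⊤ : ℕ∞) : WithTop ℕ∞) M]
      [CompactSpace M]
      (g : Literature.Geometry.Lorentzian.PseudoRiemannianMetric
        (modelWithCornersSelf ℝ (EuclideanSpace ℝ (Fin 4))) ((⊤ : ℕ∞) : WithTop ℕ∞)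
        (EuclideanSpace ℝ (Fin 4))
        (TangentSpace (modelWithCornersSelf ℝ (EuclideanSpace ℝ (Fin 4))) : M → Type _))
      [g.HasLeviCivita], g.IsRiemannian →
      ∀ (q : M → ℝ), Continuous q → (∀ x, 0 < q x) → ∀ (t : ℝ), t ≤ 1 →
      ∀ (w : M → ℝ), ContMDiff (modelWithCornersSelf ℝ (EuclideanSpace ℝ (Fin 4)))
        (modelWithCornersSelf ℝ ℝ) 2 w →
      (∀ x, 0 < Literature.Geometry.Riemannian.GurskyViaclovskyPath.backgroundScalar g w x) →
      (∀ x, Literature.Geometry.Riemannian.GurskyViaclovskyPath.backgroundPathOperator g t w x =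
        q x * Real.exp (-4 * w x)) →
      ∃ C₀ : ℝ, ∀ s ∈ Set.Icc (0 : ℝ) 1, ∀ (u : M → ℝ),
        ContMDiff (modelWithCornersSelf ℝ (EuclideanSpace ℝ (Fin 4))) (modelWithCornersSelf ℝ ℝ) 2 u →
        ∀ B : ℝ, (∀ y, |(1 - s) * (g.dalembertian u y - u y)
          - s * (Literature.Geometry.Riemannian.GurskyViaclovskyPath.linearisedBackgroundOperator g t w u y
            + 4 * q y * Real.exp (-4 * w y) * u y)| ≤ B) →
        ∀ x, |u x| ≤ C₀ * B := by
  intro M _ _ _ _ _ g _ hg q hqc hq t ht w hw hρ heq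
  rcases isEmpty_or_nonempty M with hM | hM
  · exact ⟨0, fun s _ u _ B _ x ↦ (IsEmpty.false x).elim⟩
  -- the zeroth-order coefficient `4 q e^{-4w}` is bounded below by `c₁ > 0` on the compact `M`
  have hcont : Continuous fun x ↦ q x * Real.exp (-4 * w x) :=
    hqc.mul (Real.continuous_exp.comp (continuous_const.mul hw.continuous))
  obtain ⟨x₀, -, hx₀⟩ := isCompact_univ.exists_isMinOn univ_nonempty hcont.continuousOn
  set c₁ := 4 * (q x₀ * Real.exp (-4 * w x₀)) with hc₁
  have hc₁pos : 0 < c₁ := by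
    have := mul_pos (hq x₀) (Real.exp_pos (-4 * w x₀))
    positivity
  -- the constant of the segment, independent of `s` and `u`
  set c₀ := min 1 c₁ with hc₀
  have hc₀pos : 0 < c₀ := lt_min one_pos hc₁pos
  have hc₀le1 : c₀ ≤ 1 := min_le_left _ _
  have hc₀lec₁ : c₀ ≤ c₁ := min_le_right _ _
  have h2le : (2 : ℕ∞ω) ≤ ∞ := WithTop.coe_le_coe.mpr le_top
  refine ⟨c₀⁻¹, fun s hs u hu B hB x ↦ ?_⟩
  obtain ⟨hs0, hs1⟩ := hs
  rw [le_inv_mul_iff₀ hc₀pos]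
  refine mul_abs_le_of_maximumPrinciple g (fun x v hv ↦ hg x v hv)
    (P := fun x ↦ (1 - s) • g.toBilinForm x + (-s) • principalForm g t w x) ?_ ?_
    (fun x ↦ (-s) • firstOrderField g t w x)
    (c := fun x ↦ -(1 - s) - s * (4 * q x * Real.exp (-4 * w x))) hc₀pos ?_ hu ?_ x
  · -- symmetry of `P_s = (1-s) g - s P`
    intro x v v'
    have hR : g.ricci x v v' = g.ricci x v' v := (g.ricci_symm_holds h2le x).eq v v'
    have hH : g.hessian w x v v' = g.hessian w x v' v := (g.hessian_symm_holds (hw x)).eq v v'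
    simp only [LinearMap.add_apply, LinearMap.smul_apply, smul_eq_mul, principalForm_apply,
      toBilinForm_apply]
    rw [hR, hH, g.symm x v v', mul_comm (mvfderiv (𝓡 4) w x v) (mvfderiv (𝓡 4) w x v')]
  · -- `P_s ≥ 0`: `g ≥ 0` (Riemannian) and `-P ≥ 0` (ellipticity at the admissible solution)
    intro x v
    have h1 : 0 ≤ g.val x v v := by
      by_cases hv : v = 0
      · subst hv; simp
      · exact (hg x v hv).le
    have h2 : 0 ≤ -(principalForm g t w x v v) :=
      neg_principalForm_apply_self_nonneg g hg ht (hρ x) (hq x) (heq x) v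
    simp only [LinearMap.add_apply, LinearMap.smul_apply, smul_eq_mul, toBilinForm_apply]
    nlinarith [mul_nonneg (sub_nonneg.2 hs1) h1, mul_nonneg hs0 h2]
  · -- `c_s ≤ -c₀`
    intro x
    have hmin : q x₀ * Real.exp (-4 * w x₀) ≤ q x * Real.exp (-4 * w x) := hx₀ (mem_univ x)
    have h4 : c₁ ≤ 4 * q x * Real.exp (-4 * w x) := by rw [hc₁]; linarith
    nlinarith [mul_le_mul_of_nonneg_left hc₀le1 (sub_nonneg.2 hs1),
      mul_le_mul_of_nonneg_left (hc₀lec₁.trans h4) hs0]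
  · -- `L_s u` is the given combination
    intro y
    have hd : g.dalembertian u y = g.trace y (g.hessian u y) := rfl
    have key : g.innerBilin y ((1 - s) • g.toBilinForm y + (-s) • principalForm g t w y)
          (g.hessian u y)
        + mvfderiv (𝓡 4) u y ((-s) • firstOrderField g t w y)
        + (-(1 - s) - s * (4 * q y * Real.exp (-4 * w y))) * u y
      = (1 - s) * (g.dalembertian u y - u y)
        - s * (linearisedBackgroundOperator g t w u y + 4 * q y * Real.exp (-4 * w y) * u y) := by
      simp only [innerBilin_add_left, innerBilin_smul_left, map_smul, smul_eq_mul,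
        linearisedBackgroundOperator]
      rw [g.innerBilin_comm y (g.toBilinForm y), innerBilin_toBilinForm, hd]
      ring
    rw [key]
    exact hB y

end Literature.Geometry.Riemannian.GurskyViaclovskyOpen

end Part3

/-!
## Part 4 — port of `Summits/SmoothPoincare4/SmoothPoincare4/Theorems/EntropyRungChangGurskyYangStubLinearisedInvertibleOfChartRep.lean` (5 declarations kept)

# Invertibility of the linearised path operator from its chart representation (method of continuity)

Gursky–Viaclovsky 2003, Prop. 2: at a smooth admissible solution `w` of the weighted `σ₂` path equation
(`t ≤ 1`, `q > 0`) the linearisation `L = 𝓛_{t,w} + 4 q e^{−4w}` is an invertible bounded operator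
`C^{2,α}_𝔄(M) → C^{0,α}_𝔄(M)`. Here this is derived from a chart-representation package of `−L` (a
hypothesis, supplied by `helper_linearisedChartRep` below) by the METHOD OF CONTINUITY (Gilbarg–Trudinger
Thm. 5.2, `bijective_of_surjective_of_forall_norm_le_lineMap`) along `L_s = (1 − s)(Δ_g − 1) + s(−L)`:
the model operator has its own package (`modelOperator_chartRepPackage`) and is onto
(`modelOperator_bijective_of_estimate` + `stub_modelEstimate`); one constant of `exists_schauder_global`
serves all `s`, the `sup |u|` term is removed by `helper_segmentSupBound`, and
`ContinuousLinearEquiv.ofBijective` concludes (`stub_linearisedInvertible_of_chartRep`; lemmas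
`segment_rep_algebra`, `norm_segment_le`, `holderOnWith_segment`).

References: M. J. Gursky, J. A. Viaclovsky, J. Differential Geom. 63 (2003), Prop. 2, §5 [GurskyViaclovsky2003];
D. Gilbarg, N. S. Trudinger (2001), Thm. 5.2, Thm. 6.2, §6.3 [GilbargTrudinger2001].
-/

section Part4

open _root_.Set _root_.Function _root_.Filter
open scoped _root_.Manifold _root_.ContDiff _root_.Topology _root_.NNReal
open Literature.Analysis.FunctionSpaces Literature.Geometry.Riemannian
  Literature.Geometry.Riemannian.GurskyViaclovskyPath
open Literature.Geometry.Lorentzian Literature.Geometry.Lorentzian.PseudoRiemannianMetric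

namespace Literature.Geometry.Riemannian.GurskyViaclovskyOpen

/-- The chart representation of a convex combination of two represented operators. [cite: GilbargTrudinger2001, Thm. 5.2 (method of continuity) with GurskyViaclovsky2003, Prop. 2] -/
theorem segment_rep_algebra {κ : Type*} [Fintype κ] (s p r c₀ c₁ : ℝ) (G₀ G₁ D2 : κ → κ → ℝ)
    (F₀ F₁ D1 : κ → ℝ) :
    (1 - s) * (p * ((∑ i, ∑ i', G₀ i i' * D2 i i') + (∑ l, F₀ l * D1 l) + c₀ * r)) +
        s * (p * ((∑ i, ∑ i', G₁ i i' * D2 i i') + (∑ l, F₁ l * D1 l) + c₁ * r)) =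
      p * ((∑ i, ∑ i', ((1 - s) * G₀ i i' + s * G₁ i i') * D2 i i') +
        (∑ l, ((1 - s) * F₀ l + s * F₁ l) * D1 l) + ((1 - s) * c₀ + s * c₁) * r) := by
  have h2 : (∑ i, ∑ i', ((1 - s) * G₀ i i' + s * G₁ i i') * D2 i i') =
      (1 - s) * (∑ i, ∑ i', G₀ i i' * D2 i i') + s * ∑ i, ∑ i', G₁ i i' * D2 i i' := by
    simp only [Finset.mul_sum, ← Finset.sum_add_distrib]
    exact Finset.sum_congr rfl fun i _ => Finset.sum_congr rfl fun i' _ => by ring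
  have h1 : (∑ l, ((1 - s) * F₀ l + s * F₁ l) * D1 l) =
      (1 - s) * (∑ l, F₀ l * D1 l) + s * ∑ l, F₁ l * D1 l := by
    simp only [Finset.mul_sum, ← Finset.sum_add_distrib]
    exact Finset.sum_congr rfl fun l _ => by ring
  rw [h2, h1]
  ring

/-- `‖(1−s)x + s y‖ ≤ A + B` for `s ∈ [0,1]`, `‖x‖ ≤ A`, `‖y‖ ≤ B`. [cite: GilbargTrudinger2001, Thm. 5.2 (method of continuity) with GurskyViaclovsky2003, Prop. 2] -/
theorem norm_segment_le {s : ℝ} (hs : s ∈ Icc (0 : ℝ) 1) {x y : ℝ} {A B : ℝ≥0} (hx : ‖x‖ ≤ A)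
    (hy : ‖y‖ ≤ B) : ‖(1 - s) * x + s * y‖ ≤ ((A + B : ℝ≥0) : ℝ) := by
  refine (norm_add_le _ _).trans ?_
  rw [norm_mul, norm_mul, Real.norm_of_nonneg (sub_nonneg.2 hs.2), Real.norm_of_nonneg hs.1,
    NNReal.coe_add]
  nlinarith [hs.1, hs.2, norm_nonneg x, norm_nonneg y, A.coe_nonneg, B.coe_nonneg]

/-- Hölder bound of a convex combination on a set: the constants add (`s ∈ [0,1]`). [cite: GilbargTrudinger2001, Thm. 5.2 (method of continuity) with GurskyViaclovsky2003, Prop. 2] -/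
theorem holderOnWith_segment {X : Type*} [PseudoMetricSpace X] {S : Set X} {r : ℝ≥0} {s : ℝ}
    (hs : s ∈ Icc (0 : ℝ) 1) {f f' : X → ℝ} {A B : ℝ≥0} (hf : HolderOnWith A r f S)
    (hf' : HolderOnWith B r f' S) :
    HolderOnWith (A + B) r (fun x => (1 - s) * f x + s * f' x) S := by
  have key : ∀ c : ℝ, 0 ≤ c → c ≤ 1 → ∀ u v : ℝ, edist (c * u) (c * v) ≤ edist u v := by
    intro c hc0 hc1 u v
    have h := edist_smul₀ c u v
    simp only [smul_eq_mul, ENNReal.smul_def] at h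
    rw [h]
    refine mul_le_of_le_one_left zero_le (ENNReal.coe_le_one_iff.2 ?_)
    rw [← NNReal.coe_le_coe, coe_nnnorm, Real.norm_of_nonneg hc0, NNReal.coe_one]
    exact hc1
  intro x hx y hy
  calc edist ((1 - s) * f x + s * f' x) ((1 - s) * f y + s * f' y)
      ≤ edist ((1 - s) * f x) ((1 - s) * f y) + edist (s * f' x) (s * f' y) :=
        edist_add_add_le _ _ _ _
    _ ≤ edist (f x) (f y) + edist (f' x) (f' y) :=
        add_le_add (key _ (sub_nonneg.2 hs.2) (by linarith [hs.1]) _ _) (key _ hs.1 hs.2 _ _)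
    _ ≤ A * edist x y ^ (r : ℝ) + B * edist x y ^ (r : ℝ) :=
        add_le_add (hf x hx y hy) (hf' x hx y hy)
    _ = ((A + B : ℝ≥0) : ENNReal) * edist x y ^ (r : ℝ) := by rw [ENNReal.coe_add, add_mul]

/-- **The Schauder input package of the model operator `L₀ = Δ_g − 1`** (the data assembled in
`stub_modelEstimate`, recorded with its representation): coefficients `η_j Ĝ⁻¹`
(symmetric, uniformly elliptic on the plateau thickenings: `gramInv_symm`, `gramInv_quadratic_pos`,
`exists_ellipticity_const_of_continuousOn`), `η_j b`, `−1`, bounded and Hölder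
(`exists_bound_holderWith_of_hasCompactSupport`), and the representation of every operator acting
pointwise as `Δ_g − 1` (`dalembertianPieceCLM_apply_eq`). [cite: GilbargTrudinger2001, §6.1] -/
theorem modelOperator_chartRepPackage
    (M : Type) [TopologicalSpace M] [ChartedSpace (EuclideanSpace ℝ (Fin 4)) M]
    [IsManifold (𝓡 4) ∞ M] [CompactSpace M] {ι : Type} [Fintype ι]
    (𝔄 : HolderChartData ι (EuclideanSpace ℝ (Fin 4)) M)
    (g : PseudoRiemannianMetric (𝓡 4) ∞ (EuclideanSpace ℝ (Fin 4))
      (TangentSpace (𝓡 4) : M → Type _))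
    [g.HasLeviCivita] (hg : g.IsRiemannian) {α : ℝ≥0} (hα1 : α < 1) :
    ∃ (a : ι → Fin 4 → Fin 4 → EuclideanSpace ℝ (Fin 4) → ℝ)
      (b : ι → Fin 4 → EuclideanSpace ℝ (Fin 4) → ℝ) (c : ι → EuclideanSpace ℝ (Fin 4) → ℝ)
      (ρ₁ l L : ℝ) (Ka Kb Kc : ℝ≥0),
      0 < ρ₁ ∧ 0 < l ∧ (∀ j i i' x, a j i i' x = a j i' i x) ∧
      (∀ j, ∀ x ∈ Metric.thickening ρ₁ (𝔄.chart j '' tsupport (𝔄.ρ j)), ∀ ξ : Fin 4 → ℝ,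
        l * ∑ i, ξ i ^ 2 ≤ ∑ i, ∑ i', a j i i' x * ξ i * ξ i') ∧
      (∀ j, ∀ x ∈ Metric.thickening ρ₁ (𝔄.chart j '' tsupport (𝔄.ρ j)), ∀ ξ : Fin 4 → ℝ,
        ∑ i, ∑ i', a j i i' x * ξ i * ξ i' ≤ L * ∑ i, ξ i ^ 2) ∧
      (∀ j i i', ∀ x ∈ Metric.thickening ρ₁ (𝔄.chart j '' tsupport (𝔄.ρ j)), ‖a j i i' x‖ ≤ Ka) ∧
      (∀ j i i', HolderOnWith Ka α (a j i i')
        (Metric.thickening ρ₁ (𝔄.chart j '' tsupport (𝔄.ρ j)))) ∧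
      (∀ j l' x, x ∈ Metric.thickening ρ₁ (𝔄.chart j '' tsupport (𝔄.ρ j)) → ‖b j l' x‖ ≤ Kb) ∧
      (∀ j l', HolderOnWith Kb α (b j l')
        (Metric.thickening ρ₁ (𝔄.chart j '' tsupport (𝔄.ρ j)))) ∧
      (∀ j, ∀ x ∈ Metric.thickening ρ₁ (𝔄.chart j '' tsupport (𝔄.ρ j)), ‖c j x‖ ≤ Kc) ∧
      (∀ j, HolderOnWith Kc α (c j) (Metric.thickening ρ₁ (𝔄.chart j '' tsupport (𝔄.ρ j)))) ∧
      ∀ (L₀ : HolderManifoldFunction 𝔄 ℝ 2 α →L[ℝ] HolderManifoldFunction 𝔄 ℝ 0 α),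
        (∀ (u : HolderManifoldFunction 𝔄 ℝ 2 α) (x : M), L₀ u x = g.dalembertian u x - u x) →
        ∀ (u : HolderManifoldFunction 𝔄 ℝ 2 α) (j : ι) (y : EuclideanSpace ℝ (Fin 4)),
          𝔄.piece (L₀ u) j y = 𝔄.piece (fun _ : M => (1 : ℝ)) j y *
            ((∑ i, ∑ i', a j i i' y * iteratedFDeriv ℝ 2
                (chartRestrictCLM 𝔄 hα1.le j (𝔄.cutoff j) (𝔄.contDiff_cutoff j)
                  (𝔄.hasCompactSupport_cutoff j) (𝔄.tsupport_cutoff_subset j) u :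
                    EuclideanSpace ℝ (Fin 4) → ℝ) y
                ![(EuclideanSpace.basisFun (Fin 4) ℝ) i, (EuclideanSpace.basisFun (Fin 4) ℝ) i']) +
              (∑ l', b j l' y * fderiv ℝ
                (chartRestrictCLM 𝔄 hα1.le j (𝔄.cutoff j) (𝔄.contDiff_cutoff j)
                  (𝔄.hasCompactSupport_cutoff j) (𝔄.tsupport_cutoff_subset j) u :
                    EuclideanSpace ℝ (Fin 4) → ℝ) y ((EuclideanSpace.basisFun (Fin 4) ℝ) l')) +
              c j y * (chartRestrictCLM 𝔄 hα1.le j (𝔄.cutoff j) (𝔄.contDiff_cutoff j)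
                  (𝔄.hasCompactSupport_cutoff j) (𝔄.tsupport_cutoff_subset j) u) y) := by
  -- adapted from the proof of `stub_modelEstimate`
  set bE : OrthonormalBasis (Fin 4) ℝ (EuclideanSpace ℝ (Fin 4)) :=
    EuclideanSpace.basisFun (Fin 4) ℝ
  have h1top : ((1 : ℕ) : WithTop ℕ∞) ≤ ((⊤ : ℕ∞) : WithTop ℕ∞) := WithTop.coe_le_coe.mpr le_top
  obtain ⟨ρ₁, hρ₁, hη1⟩ := 𝔄.exists_cthickening_cutoff_eq_one
  set K' : ι → Set (EuclideanSpace ℝ (Fin 4)) := fun j =>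
    Metric.cthickening ρ₁ (𝔄.chart j '' tsupport (𝔄.ρ j))
  have hK'c : ∀ j, IsCompact (K' j) := fun j => (𝔄.isCompact_image_tsupport j).1.cthickening
  have hK't : ∀ j, K' j ⊆ (𝔄.chart j).target := fun j y hy =>
    𝔄.mem_target_of_cutoff_ne_zero (by rw [hη1 j y hy]; exact one_ne_zero)
  have hthick : ∀ j, Metric.thickening ρ₁ (𝔄.chart j '' tsupport (𝔄.ρ j)) ⊆ K' j := fun j =>
    Metric.thickening_subset_cthickening _ _
  have hl' : ∀ j, ∃ lam : ℝ, 0 < lam ∧ ∀ y ∈ K' j, ∀ ξ : Fin 4 → ℝ, lam * ∑ i, ξ i ^ 2 ≤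
      ∑ i, ∑ i', gramInv bE.toBasis g (𝔄.center j) y i i' * ξ i * ξ i' := fun j =>
    exists_ellipticity_const_of_continuousOn (hK'c j)
      (fun i i' => (contDiffOn_gramInv bE.toBasis g (𝔄.center j) i i').continuousOn.mono (hK't j))
      (fun y hy ξ hξ => gramInv_quadratic_pos bE.toBasis g (𝔄.center j) hg (hK't j hy) hξ)
  choose lam hlam0 hlam using hl'
  obtain ⟨l, hl, hlle⟩ := exists_pos_forall_le_of_finite hlam0
  set acoef : ι → Fin 4 → Fin 4 → EuclideanSpace ℝ (Fin 4) → ℝ := fun j i i' y =>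
    𝔄.cutoff j y * gramInv bE.toBasis g (𝔄.center j) y i i' with hacoef
  set bcoef : ι → Fin 4 → EuclideanSpace ℝ (Fin 4) → ℝ := fun j l' y =>
    𝔄.cutoff j y * firstOrderCoeff bE.toBasis g (𝔄.center j) l' y with hbcoef
  set ccoef : ι → EuclideanSpace ℝ (Fin 4) → ℝ := fun _ _ => -1 with hccoef
  have haS : ∀ j i i', ContDiff ℝ ∞ (acoef j i i') := fun j i i' =>
    ContDiffHolderFunction.contDiff_cutoff_mul (𝔄.contDiff_cutoff j) (𝔄.chart j).open_target
      (contDiffOn_gramInv bE.toBasis g (𝔄.center j) i i') (𝔄.tsupport_cutoff_subset j)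
  have hbS : ∀ j l', ContDiff ℝ ∞ (bcoef j l') := fun j l' =>
    ContDiffHolderFunction.contDiff_cutoff_mul (𝔄.contDiff_cutoff j) (𝔄.chart j).open_target
      (contDiffOn_firstOrderCoeff bE.toBasis g (𝔄.center j) l') (𝔄.tsupport_cutoff_subset j)
  choose Zs Zh hZ using fun j i i' => exists_bound_holderWith_of_hasCompactSupport
    ((haS j i i').of_le (by exact_mod_cast h1top))
    (ContDiffHolderFunction.hasCompactSupport_cutoff_mul (𝔄.hasCompactSupport_cutoff j) _) hα1.le
  choose Ws Wh hW using fun j l' => exists_bound_holderWith_of_hasCompactSupport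
    ((hbS j l').of_le (by exact_mod_cast h1top))
    (ContDiffHolderFunction.hasCompactSupport_cutoff_mul (𝔄.hasCompactSupport_cutoff j) _) hα1.le
  set Ka : ℝ≥0 := Finset.univ.sup (fun q : ι × Fin 4 × Fin 4 =>
    Zs q.1 q.2.1 q.2.2 + Zh q.1 q.2.1 q.2.2)
  set Kb : ℝ≥0 := Finset.univ.sup (fun q : ι × Fin 4 => Ws q.1 q.2 + Wh q.1 q.2)
  have hKa' : ∀ j i i', Zs j i i' ≤ Ka ∧ Zh j i i' ≤ Ka := fun j i i' => by
    have h := Finset.le_sup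
      (f := fun q : ι × Fin 4 × Fin 4 => Zs q.1 q.2.1 q.2.2 + Zh q.1 q.2.1 q.2.2)
      (Finset.mem_univ (j, i, i'))
    exact ⟨le_self_add.trans h, le_add_self.trans h⟩
  have hKb' : ∀ j l', Ws j l' ≤ Kb ∧ Wh j l' ≤ Kb := fun j l' => by
    have h := Finset.le_sup (f := fun q : ι × Fin 4 => Ws q.1 q.2 + Wh q.1 q.2)
      (Finset.mem_univ (j, l'))
    exact ⟨le_self_add.trans h, le_add_self.trans h⟩
  have ha0 : ∀ j i i' y, ‖acoef j i i' y‖ ≤ Ka := fun j i i' y =>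
    ((hZ j i i').1 y).trans (NNReal.coe_le_coe.2 (hKa' j i i').1)
  refine ⟨acoef, bcoef, ccoef, ρ₁, l, Fintype.card (Fin 4) * Ka, Ka, Kb, 1, hρ₁, hl,
    fun j i i' y => ?_, fun j y hy ξ => ?_, fun j y _ ξ => ?_, fun j i i' y _ => ha0 j i i' y,
    fun j i i' => ((hZ j i i').2.mono (hKa' j i i').2).holderOnWith _,
    fun j l' y _ => ((hW j l').1 y).trans (NNReal.coe_le_coe.2 (hKb' j l').1),
    fun j l' => ((hW j l').2.mono (hKb' j l').2).holderOnWith _,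
    fun j y _ => by simp [hccoef],
    fun j y _ y' _ => by simp only [hccoef, PseudoEMetricSpace.edist_self, zero_le],
    fun L₀ hL₀ v j y => ?_⟩
  · exact congrArg (fun t : ℝ => 𝔄.cutoff j y * t) (gramInv_symm bE.toBasis g (𝔄.center j) y i i')
  · have hyK : y ∈ K' j := hthick j hy
    calc l * ∑ i, ξ i ^ 2 ≤ lam j * ∑ i, ξ i ^ 2 :=
          mul_le_mul_of_nonneg_right (hlle j) (Finset.sum_nonneg fun i _ => sq_nonneg _)
      _ ≤ ∑ i, ∑ i', gramInv bE.toBasis g (𝔄.center j) y i i' * ξ i * ξ i' := hlam j y hyK ξ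
      _ = ∑ i, ∑ i', acoef j i i' y * ξ i * ξ i' := by simp only [hacoef, hη1 j y hyK, one_mul]
  · exact quadratic_le_card_mul_of_abs_le
      (fun i i' => by rw [← Real.norm_eq_abs]; exact ha0 j i i' y) ξ
  · have hv : (⇑(L₀ v) : M → ℝ) = g.dalembertian ⇑v - ⇑v := funext fun x => hL₀ v x
    have hL : dalembertianPieceCLM 𝔄 bE.toBasis g hα1.le j v y =
        𝔄.piece (fun _ : M => (1 : ℝ)) j y * (𝔄.cutoff j y *
          ((∑ a, ∑ b, gramInv bE.toBasis g (𝔄.center j) y a b *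
              fderiv ℝ (fderiv ℝ (chartRestrictCLM 𝔄 hα1.le j (𝔄.cutoff j) (𝔄.contDiff_cutoff j)
                (𝔄.hasCompactSupport_cutoff j) (𝔄.tsupport_cutoff_subset j) v :
                  EuclideanSpace ℝ (Fin 4) → ℝ)) y (bE.toBasis a) (bE.toBasis b)) +
            (∑ l', firstOrderCoeff bE.toBasis g (𝔄.center j) l' y *
              fderiv ℝ (chartRestrictCLM 𝔄 hα1.le j (𝔄.cutoff j) (𝔄.contDiff_cutoff j)
                (𝔄.hasCompactSupport_cutoff j) (𝔄.tsupport_cutoff_subset j) v :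
                  EuclideanSpace ℝ (Fin 4) → ℝ) y (bE.toBasis l')) +
            0 * (chartRestrictCLM 𝔄 hα1.le j (𝔄.cutoff j) (𝔄.contDiff_cutoff j)
                (𝔄.hasCompactSupport_cutoff j) (𝔄.tsupport_cutoff_subset j) v) y)) := by
      simp only [dalembertianPieceCLM, ContinuousLinearMap.coe_comp, Function.comp_apply,
        ContDiffHolderFunction.coeffCLM_apply, smul_eq_mul,
        ContDiffHolderFunction.localizedOperatorCLM_apply]
    rw [hv, 𝔄.piece_sub, Pi.sub_apply, ← dalembertianPieceCLM_apply_eq 𝔄 bE.toBasis g hα1.le j v y,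
      hL, HolderChartData.piece_eq_piece_one_mul 𝔄 hα1.le v j y]
    simp only [OrthonormalBasis.coe_toBasis, iteratedFDeriv_two_apply, Matrix.cons_val_zero,
      Matrix.cons_val_one, hacoef, hbcoef, hccoef]
    exact modelEstimate_rep_algebra _ _ _ _ _ _ _

/-- **INVERTIBILITY OF THE LINEARISED PATH OPERATOR FROM ITS CHART REPRESENTATION**
(Gursky–Viaclovsky 2003, Prop. 2, by the method of continuity, Gilbarg–Trudinger 2001, Thm. 5.2):
GIVEN the chart-representation package of `−(𝓛_{t,w} + 4 q e^{−4w})` (previous Parts), every bounded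
`L : C^{2,α}_𝔄 → C^{0,α}_𝔄` acting pointwise as `𝓛_{t,w} + 4 q e^{−4w}` is invertible: along
`L_s = (1 − s)(Δ_g − 1) + s(−L)` one Schauder constant (`exists_schauder_global`) and one
maximum-principle constant (`helper_segmentSupBound`) give `‖u‖ ≤ C‖L_s u‖` uniformly in
`s ∈ [0,1]`; `Δ_g − 1` is onto (`stub_modelEstimate`, `modelOperator_bijective_of_estimate`), so
`−L`, hence `L`, is bijective.
[cite: GurskyViaclovsky2003, Prop. 2; GilbargTrudinger2001, Thm. 5.2] -/
theorem stub_linearisedInvertible_of_chartRep :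
    ∀ (M : Type) [TopologicalSpace M] [T2Space M] [ChartedSpace (EuclideanSpace ℝ (Fin 4)) M]
      [IsManifold (modelWithCornersSelf ℝ (EuclideanSpace ℝ (Fin 4))) ((⊤ : ℕ∞) : WithTop ℕ∞) M]
      [CompactSpace M] {ι : Type} [Fintype ι]
      (𝔄 : Literature.Analysis.FunctionSpaces.HolderChartData ι (EuclideanSpace ℝ (Fin 4)) M)
      (g : Literature.Geometry.Lorentzian.PseudoRiemannianMetric
        (modelWithCornersSelf ℝ (EuclideanSpace ℝ (Fin 4))) ((⊤ : ℕ∞) : WithTop ℕ∞)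
        (EuclideanSpace ℝ (Fin 4))
        (TangentSpace (modelWithCornersSelf ℝ (EuclideanSpace ℝ (Fin 4))) : M → Type _))
      [g.HasLeviCivita], g.IsRiemannian →
      ∀ (q : M → ℝ), ContMDiff (modelWithCornersSelf ℝ (EuclideanSpace ℝ (Fin 4)))
        (modelWithCornersSelf ℝ ℝ) ((⊤ : ℕ∞) : WithTop ℕ∞) q → (∀ x, 0 < q x) →
      ∀ {α : NNReal}, 0 < α → ∀ (hα1 : α < 1) (t : ℝ), t ≤ 1 →
      ∀ (w : M → ℝ), ContMDiff (modelWithCornersSelf ℝ (EuclideanSpace ℝ (Fin 4)))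
        (modelWithCornersSelf ℝ ℝ) ((⊤ : ℕ∞) : WithTop ℕ∞) w →
      (∀ x, 0 < Literature.Geometry.Riemannian.GurskyViaclovskyPath.backgroundScalar g w x) →
      (∀ x, Literature.Geometry.Riemannian.GurskyViaclovskyPath.backgroundPathOperator g t w x =
        q x * Real.exp (-4 * w x)) →
      (∃ (a : ι → Fin 4 → Fin 4 → EuclideanSpace ℝ (Fin 4) → ℝ)
        (b : ι → Fin 4 → EuclideanSpace ℝ (Fin 4) → ℝ) (c : ι → EuclideanSpace ℝ (Fin 4) → ℝ)
        (ρ₁ l L : ℝ) (Ka Kb Kc : NNReal),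
        0 < ρ₁ ∧ 0 < l ∧ (∀ j i i' x, a j i i' x = a j i' i x) ∧
        (∀ j, ∀ x ∈ Metric.thickening ρ₁ (𝔄.chart j '' tsupport (𝔄.ρ j)), ∀ ξ : Fin 4 → ℝ,
          l * ∑ i, ξ i ^ 2 ≤ ∑ i, ∑ i', a j i i' x * ξ i * ξ i') ∧
        (∀ j, ∀ x ∈ Metric.thickening ρ₁ (𝔄.chart j '' tsupport (𝔄.ρ j)), ∀ ξ : Fin 4 → ℝ,
          ∑ i, ∑ i', a j i i' x * ξ i * ξ i' ≤ L * ∑ i, ξ i ^ 2) ∧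
        (∀ j i i', ∀ x ∈ Metric.thickening ρ₁ (𝔄.chart j '' tsupport (𝔄.ρ j)), ‖a j i i' x‖ ≤ Ka) ∧
        (∀ j i i', HolderOnWith Ka α (a j i i')
          (Metric.thickening ρ₁ (𝔄.chart j '' tsupport (𝔄.ρ j)))) ∧
        (∀ j l' x, x ∈ Metric.thickening ρ₁ (𝔄.chart j '' tsupport (𝔄.ρ j)) → ‖b j l' x‖ ≤ Kb) ∧
        (∀ j l', HolderOnWith Kb α (b j l')
          (Metric.thickening ρ₁ (𝔄.chart j '' tsupport (𝔄.ρ j)))) ∧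
        (∀ j, ∀ x ∈ Metric.thickening ρ₁ (𝔄.chart j '' tsupport (𝔄.ρ j)), ‖c j x‖ ≤ Kc) ∧
        (∀ j, HolderOnWith Kc α (c j) (Metric.thickening ρ₁ (𝔄.chart j '' tsupport (𝔄.ρ j)))) ∧
        ∀ (L' : Literature.Analysis.FunctionSpaces.HolderManifoldFunction 𝔄 ℝ 2 α →L[ℝ]
            Literature.Analysis.FunctionSpaces.HolderManifoldFunction 𝔄 ℝ 0 α),
          (∀ (φ : Literature.Analysis.FunctionSpaces.HolderManifoldFunction 𝔄 ℝ 2 α) (x : M),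
            L' φ x = Literature.Geometry.Riemannian.GurskyViaclovskyPath.linearisedBackgroundOperator
              g t w φ x + 4 * q x * Real.exp (-4 * w x) * φ x) →
          ∀ (u : Literature.Analysis.FunctionSpaces.HolderManifoldFunction 𝔄 ℝ 2 α) (j : ι)
            (y : EuclideanSpace ℝ (Fin 4)) (v : EuclideanSpace ℝ (Fin 4) → ℝ),
            v = Literature.Analysis.FunctionSpaces.chartRestrictCLM 𝔄 hα1.le j (𝔄.cutoff j)
                    (𝔄.contDiff_cutoff j) (𝔄.hasCompactSupport_cutoff j)
                    (𝔄.tsupport_cutoff_subset j) u →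
            𝔄.piece ((-L') u) j y = 𝔄.piece (fun _ : M => (1 : ℝ)) j y *
              ((∑ i, ∑ i', a j i i' y * iteratedFDeriv ℝ 2 v y
                  ![(EuclideanSpace.basisFun (Fin 4) ℝ) i, (EuclideanSpace.basisFun (Fin 4) ℝ) i']) +
                (∑ l', b j l' y * fderiv ℝ v y ((EuclideanSpace.basisFun (Fin 4) ℝ) l')) +
                c j y * v y)) →
      ∀ L : Literature.Analysis.FunctionSpaces.HolderManifoldFunction 𝔄 ℝ 2 α →L[ℝ]
          Literature.Analysis.FunctionSpaces.HolderManifoldFunction 𝔄 ℝ 0 α,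
        (∀ (φ : Literature.Analysis.FunctionSpaces.HolderManifoldFunction 𝔄 ℝ 2 α) (x : M),
          L φ x = Literature.Geometry.Riemannian.GurskyViaclovskyPath.linearisedBackgroundOperator
            g t w φ x + 4 * q x * Real.exp (-4 * w x) * φ x) →
        L.IsInvertible := by
  intro M _ _ _ _ _ ι _ 𝔄 g _ hg q hq hq0 α hα0 hα1 t ht w hw hpos heq hpkg L hL
  set bE : OrthonormalBasis (Fin 4) ℝ (EuclideanSpace ℝ (Fin 4)) :=
    EuclideanSpace.basisFun (Fin 4) ℝ
  -- Step 0: the two coefficient packages (model operator; `−L`, the hypothesis)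
  obtain ⟨a₀, b₀, c₀, ρ₀, l₀, U₀, Ka₀, Kb₀, Kc₀, hρ₀, hl₀, hsy₀, hlo₀, hup₀, ha₀, haH₀, hb₀, hbH₀,
    hc₀, hcH₀, hrep₀⟩ := modelOperator_chartRepPackage M 𝔄 g hg hα1
  obtain ⟨a₁, b₁, c₁, ρ₁, l₁, U₁, Ka₁, Kb₁, Kc₁, hρ₁, hl₁, hsy₁, hlo₁, hup₁, ha₁, haH₁, hb₁, hbH₁,
    hc₁, hcH₁, hrep₁⟩ := hpkg
  -- Step 1: the model operator `L₀ = Δ_g − 1` on `C^{2,α}_𝔄`, onto by stub O5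
  obtain ⟨C₅, hC₅⟩ := stub_modelEstimate M 𝔄 g hg hα0 hα1
  obtain ⟨L₀, hL₀, h₀⟩ : ∃ L₀ : HolderManifoldFunction 𝔄 ℝ 2 α →L[ℝ] HolderManifoldFunction 𝔄 ℝ 0 α,
      (∀ (u : HolderManifoldFunction 𝔄 ℝ 2 α) (x : M), L₀ u x = g.dalembertian u x - u x) ∧
        Surjective L₀ :=
    ⟨modelOperatorCLM (k := 0) 𝔄 g hα1.le, fun u x => rfl,
      (modelOperator_bijective_of_estimate 𝔄 g (by norm_num) hg hα0 hα1.le hC₅).2⟩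
  -- Step 2: one Schauder constant for the whole segment (common coefficient bounds)
  set K : ι → Set (EuclideanSpace ℝ (Fin 4)) := fun j => 𝔄.chart j '' tsupport (𝔄.ρ j)
  have hT₀ : ∀ j, Metric.thickening (min ρ₀ ρ₁) (K j) ⊆ Metric.thickening ρ₀ (K j) := fun j =>
    Metric.thickening_mono (min_le_left _ _) _
  have hT₁ : ∀ j, Metric.thickening (min ρ₀ ρ₁) (K j) ⊆ Metric.thickening ρ₁ (K j) := fun j =>
    Metric.thickening_mono (min_le_right _ _) _
  obtain ⟨C, -, hC⟩ := exists_schauder_global 𝔄 bE hα0 hα1 (lt_min hl₀ hl₁) (max U₀ U₁)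
    (Ka₀ + Ka₁) (Kb₀ + Kb₁) (Kc₀ + Kc₁) (lt_min hρ₀ hρ₁)
  -- Step 3: the maximum-principle constant, uniform along the segment
  have h2top : ((2 : ℕ) : WithTop ℕ∞) ≤ ((⊤ : ℕ∞) : WithTop ℕ∞) := WithTop.coe_le_coe.mpr le_top
  obtain ⟨C₀, hC₀⟩ := helper_segmentSupBound M g hg q hq.continuous hq0 t ht w
    (hw.of_le (by exact_mod_cast h2top)) hpos heq
  -- Step 4: the uniform estimate `‖u‖ ≤ C' ‖L_s u‖` along `L_s = (1 − s) L₀ + s (−L)`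
  have key : ∀ s ∈ Icc (0 : ℝ) 1, ∀ u : HolderManifoldFunction 𝔄 ℝ 2 α,
      ‖u‖ ≤ C * (1 + C₀ * Fintype.card ι) * ‖((1 - s) • L₀ + s • (-L)) u‖ := by
    intro s hs u
    -- the coefficients of `L_s`
    set aS : ι → Fin 4 → Fin 4 → EuclideanSpace ℝ (Fin 4) → ℝ := fun j i i' y =>
      (1 - s) * a₀ j i i' y + s * a₁ j i i' y with haS
    set bS : ι → Fin 4 → EuclideanSpace ℝ (Fin 4) → ℝ := fun j l' y =>
      (1 - s) * b₀ j l' y + s * b₁ j l' y with hbS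
    set cS : ι → EuclideanSpace ℝ (Fin 4) → ℝ := fun j y => (1 - s) * c₀ j y + s * c₁ j y with hcS
    have hquad : ∀ j y (ξ : Fin 4 → ℝ), (∑ i, ∑ i', aS j i i' y * ξ i * ξ i') =
        (1 - s) * (∑ i, ∑ i', a₀ j i i' y * ξ i * ξ i') + s * ∑ i, ∑ i', a₁ j i i' y * ξ i * ξ i' :=
      fun j y ξ => by
        simp only [haS, Finset.mul_sum, ← Finset.sum_add_distrib]
        exact Finset.sum_congr rfl fun i _ => Finset.sum_congr rfl fun i' _ => by ring
    set f : HolderManifoldFunction 𝔄 ℝ 0 α := ((1 - s) • L₀ + s • (-L)) u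
    -- the `sup |u|` bound by the maximum principle
    have hfy : ∀ y, f y = (1 - s) * (g.dalembertian u y - u y) -
        s * (linearisedBackgroundOperator g t w u y + 4 * q y * Real.exp (-4 * w y) * u y) := by
      intro y
      show (1 - s) * L₀ u y + s * (-(L u y)) = _
      rw [hL₀, hL]
      ring
    have hA : ∀ x, ‖u x‖ ≤ C₀ * (Fintype.card ι * ‖f‖) := fun x => by
      rw [Real.norm_eq_abs]
      refine hC₀ s hs u u.contMDiff _ (fun y => ?_) x
      rw [← hfy y, ← Real.norm_eq_abs]
      exact f.norm_apply_le y
    -- the Schauder estimate for `L_s`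
    have hS : ‖u‖ ≤ C * (‖f‖ + C₀ * (Fintype.card ι * ‖f‖)) := by
      refine hC aS bS cS (fun j i i' y => by
          show (1 - s) * a₀ j i i' y + s * a₁ j i i' y = (1 - s) * a₀ j i' i y + s * a₁ j i' i y
          rw [hsy₀ j i i' y, hsy₁ j i i' y])
        (fun j y hy ξ => ?_) (fun j y hy ξ => ?_)
        (fun j i i' y hy => norm_segment_le hs (ha₀ j i i' y (hT₀ j hy)) (ha₁ j i i' y (hT₁ j hy)))
        (fun j i i' =>
          holderOnWith_segment hs ((haH₀ j i i').mono (hT₀ j)) ((haH₁ j i i').mono (hT₁ j)))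
        (fun j l' y hy => norm_segment_le hs (hb₀ j l' y (hT₀ j hy)) (hb₁ j l' y (hT₁ j hy)))
        (fun j l' => holderOnWith_segment hs ((hbH₀ j l').mono (hT₀ j)) ((hbH₁ j l').mono (hT₁ j)))
        (fun j y hy => norm_segment_le hs (hc₀ j y (hT₀ j hy)) (hc₁ j y (hT₁ j hy)))
        (fun j => holderOnWith_segment hs ((hcH₀ j).mono (hT₀ j)) ((hcH₁ j).mono (hT₁ j)))
        ((1 - s) • L₀ + s • (-L)) (fun v j y => ?_) u _ hA
      · -- uniform ellipticity with `min l₀ l₁`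
        have hξ : 0 ≤ ∑ i, ξ i ^ 2 := Finset.sum_nonneg fun i _ => sq_nonneg _
        rw [hquad]
        nlinarith [mul_le_mul_of_nonneg_left ((mul_le_mul_of_nonneg_right (min_le_left l₀ l₁)
          hξ).trans (hlo₀ j y (hT₀ j hy) ξ)) (sub_nonneg.2 hs.2), mul_le_mul_of_nonneg_left
          ((mul_le_mul_of_nonneg_right (min_le_right l₀ l₁) hξ).trans (hlo₁ j y (hT₁ j hy) ξ)) hs.1]
      · -- upper bound with `max U₀ U₁`
        have hξ : 0 ≤ ∑ i, ξ i ^ 2 := Finset.sum_nonneg fun i _ => sq_nonneg _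
        rw [hquad]
        nlinarith [mul_le_mul_of_nonneg_left ((hup₀ j y (hT₀ j hy) ξ).trans
          (mul_le_mul_of_nonneg_right (le_max_left U₀ U₁) hξ)) (sub_nonneg.2 hs.2),
          mul_le_mul_of_nonneg_left ((hup₁ j y (hT₁ j hy) ξ).trans
          (mul_le_mul_of_nonneg_right (le_max_right U₀ U₁) hξ)) hs.1]
      · -- the chart representation of `L_s`
        have e : (⇑(((1 - s) • L₀ + s • (-L)) v) : M → ℝ) = (1 - s) • ⇑(L₀ v) + s • ⇑((-L) v) :=
          rfl
        rw [e, 𝔄.piece_add, 𝔄.piece_smul, 𝔄.piece_smul, Pi.add_apply, Pi.smul_apply,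
          Pi.smul_apply, smul_eq_mul, smul_eq_mul, hrep₀ L₀ hL₀ v j y, hrep₁ L hL v j y _ rfl]
        exact segment_rep_algebra _ _ _ _ _ _ _ _ _ _ _
    calc ‖u‖ ≤ C * (‖f‖ + C₀ * (Fintype.card ι * ‖f‖)) := hS
      _ = C * (1 + C₀ * Fintype.card ι) * ‖f‖ := by ring
  -- Step 5: the method of continuity: `−L` is bijective, hence so is `L`
  have hbij : Bijective (-L) :=
    Literature.Analysis.OperatorTheory.bijective_of_surjective_of_forall_norm_le_lineMap L₀ (-L)
      key h₀
  have hinj : Injective L := fun x y hxy =>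
    hbij.1 (by rw [neg_apply, neg_apply, hxy])
  have hsurj : Surjective L := fun y => by
    obtain ⟨x, hx⟩ := hbij.2 (-y)
    refine ⟨x, neg_inj.1 ?_⟩
    rwa [neg_apply] at hx
  -- Step 6: the open mapping theorem
  exact ⟨ContinuousLinearEquiv.ofBijective L (LinearMap.ker_eq_bot.2 hinj)
    (LinearMap.range_eq_top.2 hsurj), ContinuousLinearEquiv.coe_ofBijective _ _ _⟩

end Literature.Geometry.Riemannian.GurskyViaclovskyOpen

end Part4

/-!
## Part 5 — port of `Summits/SmoothPoincare4/SmoothPoincare4/Theorems/EntropyRungChangGurskyYangHelperLinearisedChartRep.lean` (1 declarations kept)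

# The Schauder input package of the linearised path operator on `C^{2,α}_𝔄(M)`

On a closed Riemannian `4`-manifold with Hölder chart data `𝔄`, `0 < α < 1`, a smooth positive `q`,
`t ≤ 1` and a smooth admissible solution `w` of `backgroundPathOperator g t w = q e^{−4w}`, the operator
`−(𝓛_{t,w} + 4q e^{−4w})`, realised by any bounded `L' : C^{2,α}_𝔄 →L C^{0,α}_𝔄` acting pointwise as the
linearisation, has chart by chart the representation `ρ̂_j · (Σ a D² ũ_j + Σ b D ũ_j + c ũ_j)` with
symmetric, uniformly elliptic, bounded, Hölder coefficients on the thickenings of the chart pieces — the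
hypothesis list of `Literature.Analysis.FunctionSpaces.exists_schauder_global` (`helper_linearisedChartRep`).
Pieces: `exists_linearised_chartRep` (`GurskyViaclovskyLinearisationChart.lean`),
`HolderChartData.exists_cthickening_cutoff_eq_one`, `exists_bound_holderWith_of_hasCompactSupport`,
`exists_ellipticity_const_of_continuousOn`, `chartRestrictCLM_eventuallyEq`.

References: M. J. Gursky, J. A. Viaclovsky, J. Differential Geom. 63 (2003), §2 (proof of Prop. 2), §5
[GurskyViaclovsky2003]; D. Gilbarg, N. S. Trudinger (2001), Thm. 6.2, §6.1 [GilbargTrudinger2001].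
-/

section Part5

open _root_.Set _root_.Function _root_.Filter
open scoped _root_.Manifold _root_.ContDiff _root_.Topology _root_.NNReal
open Literature.Analysis.FunctionSpaces Literature.Geometry.Riemannian
open Literature.Geometry.Riemannian.GurskyViaclovskyPath
open Literature.Geometry.Lorentzian Literature.Geometry.Lorentzian.PseudoRiemannianMetric

namespace Literature.Geometry.Riemannian.GurskyViaclovskyOpen

set_option maxHeartbeats 800000 in
-- many opaque constants and a long conjunction
/-- **HELPER O2a — THE SCHAUDER INPUT PACKAGE OF `−(𝓛_{t,w} + 4q e^{−4w})`** at a smooth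
admissible solution `w` with `t ≤ 1`: chart
coefficients `a, b, c` for every chart of `𝔄`, a plateau radius `ρ₁`, ellipticity constants
`0 < l ≤ L` and sup/Hölder constants `Ka, Kb, Kc` on the `ρ₁`-thickenings of the chart pieces,
and the chart-piece representation of `(−L') u` for every bounded `L'` acting pointwise as
`𝓛_{t,w} + 4q e^{−4w}` — the hypotheses of `exists_schauder_global` for `Lop := −L'`. See the
module docstring for the assembly. [cite: GurskyViaclovsky2003, §2, proof of Prop. 2] -/
theorem helper_linearisedChartRep :
    ∀ (M : Type) [TopologicalSpace M] [T2Space M] [ChartedSpace (EuclideanSpace ℝ (Fin 4)) M]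
      [IsManifold (modelWithCornersSelf ℝ (EuclideanSpace ℝ (Fin 4))) ((⊤ : ℕ∞) : WithTop ℕ∞) M]
      [CompactSpace M] {ι : Type} [Fintype ι]
      (𝔄 : Literature.Analysis.FunctionSpaces.HolderChartData ι (EuclideanSpace ℝ (Fin 4)) M)
      (g : Literature.Geometry.Lorentzian.PseudoRiemannianMetric
        (modelWithCornersSelf ℝ (EuclideanSpace ℝ (Fin 4))) ((⊤ : ℕ∞) : WithTop ℕ∞)
        (EuclideanSpace ℝ (Fin 4))
        (TangentSpace (modelWithCornersSelf ℝ (EuclideanSpace ℝ (Fin 4))) : M → Type _))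
      [g.HasLeviCivita], g.IsRiemannian →
      ∀ (q : M → ℝ), ContMDiff (modelWithCornersSelf ℝ (EuclideanSpace ℝ (Fin 4)))
        (modelWithCornersSelf ℝ ℝ) ((⊤ : ℕ∞) : WithTop ℕ∞) q → (∀ x, 0 < q x) →
      ∀ {α : NNReal}, 0 < α → ∀ (hα1 : α < 1) (t : ℝ), t ≤ 1 →
      ∀ (w : M → ℝ), ContMDiff (modelWithCornersSelf ℝ (EuclideanSpace ℝ (Fin 4)))
        (modelWithCornersSelf ℝ ℝ) ((⊤ : ℕ∞) : WithTop ℕ∞) w →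
      (∀ x, 0 < Literature.Geometry.Riemannian.GurskyViaclovskyPath.backgroundScalar g w x) →
      (∀ x, Literature.Geometry.Riemannian.GurskyViaclovskyPath.backgroundPathOperator g t w x =
        q x * Real.exp (-4 * w x)) →
      ∃ (a : ι → Fin 4 → Fin 4 → EuclideanSpace ℝ (Fin 4) → ℝ)
        (b : ι → Fin 4 → EuclideanSpace ℝ (Fin 4) → ℝ) (c : ι → EuclideanSpace ℝ (Fin 4) → ℝ)
        (ρ₁ l L : ℝ) (Ka Kb Kc : NNReal),
        0 < ρ₁ ∧ 0 < l ∧ (∀ j i i' x, a j i i' x = a j i' i x) ∧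
        (∀ j, ∀ x ∈ Metric.thickening ρ₁ (𝔄.chart j '' tsupport (𝔄.ρ j)), ∀ ξ : Fin 4 → ℝ,
          l * ∑ i, ξ i ^ 2 ≤ ∑ i, ∑ i', a j i i' x * ξ i * ξ i') ∧
        (∀ j, ∀ x ∈ Metric.thickening ρ₁ (𝔄.chart j '' tsupport (𝔄.ρ j)), ∀ ξ : Fin 4 → ℝ,
          ∑ i, ∑ i', a j i i' x * ξ i * ξ i' ≤ L * ∑ i, ξ i ^ 2) ∧
        (∀ j i i', ∀ x ∈ Metric.thickening ρ₁ (𝔄.chart j '' tsupport (𝔄.ρ j)), ‖a j i i' x‖ ≤ Ka) ∧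
        (∀ j i i', HolderOnWith Ka α (a j i i')
          (Metric.thickening ρ₁ (𝔄.chart j '' tsupport (𝔄.ρ j)))) ∧
        (∀ j l' x, x ∈ Metric.thickening ρ₁ (𝔄.chart j '' tsupport (𝔄.ρ j)) → ‖b j l' x‖ ≤ Kb) ∧
        (∀ j l', HolderOnWith Kb α (b j l')
          (Metric.thickening ρ₁ (𝔄.chart j '' tsupport (𝔄.ρ j)))) ∧
        (∀ j, ∀ x ∈ Metric.thickening ρ₁ (𝔄.chart j '' tsupport (𝔄.ρ j)), ‖c j x‖ ≤ Kc) ∧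
        (∀ j, HolderOnWith Kc α (c j) (Metric.thickening ρ₁ (𝔄.chart j '' tsupport (𝔄.ρ j)))) ∧
        ∀ (L' : Literature.Analysis.FunctionSpaces.HolderManifoldFunction 𝔄 ℝ 2 α →L[ℝ]
            Literature.Analysis.FunctionSpaces.HolderManifoldFunction 𝔄 ℝ 0 α),
          (∀ (φ : Literature.Analysis.FunctionSpaces.HolderManifoldFunction 𝔄 ℝ 2 α) (x : M),
            L' φ x = Literature.Geometry.Riemannian.GurskyViaclovskyPath.linearisedBackgroundOperator
              g t w φ x + 4 * q x * Real.exp (-4 * w x) * φ x) →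
          ∀ (u : Literature.Analysis.FunctionSpaces.HolderManifoldFunction 𝔄 ℝ 2 α) (j : ι)
            (y : EuclideanSpace ℝ (Fin 4)),
            𝔄.piece ((-L') u) j y = 𝔄.piece (fun _ : M => (1 : ℝ)) j y *
              ((∑ i, ∑ i', a j i i' y * iteratedFDeriv ℝ 2
                  (Literature.Analysis.FunctionSpaces.chartRestrictCLM 𝔄 hα1.le j (𝔄.cutoff j)
                    (𝔄.contDiff_cutoff j) (𝔄.hasCompactSupport_cutoff j)
                    (𝔄.tsupport_cutoff_subset j) u : EuclideanSpace ℝ (Fin 4) → ℝ) y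
                  ![(EuclideanSpace.basisFun (Fin 4) ℝ) i, (EuclideanSpace.basisFun (Fin 4) ℝ) i']) +
                (∑ l', b j l' y * fderiv ℝ
                  (Literature.Analysis.FunctionSpaces.chartRestrictCLM 𝔄 hα1.le j (𝔄.cutoff j)
                    (𝔄.contDiff_cutoff j) (𝔄.hasCompactSupport_cutoff j)
                    (𝔄.tsupport_cutoff_subset j) u : EuclideanSpace ℝ (Fin 4) → ℝ) y
                  ((EuclideanSpace.basisFun (Fin 4) ℝ) l')) +
                c j y * (Literature.Analysis.FunctionSpaces.chartRestrictCLM 𝔄 hα1.le j (𝔄.cutoff j)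
                    (𝔄.contDiff_cutoff j) (𝔄.hasCompactSupport_cutoff j)
                    (𝔄.tsupport_cutoff_subset j) u) y) := by
  intro M _ _ _ _ _ ι _ 𝔄 g _ hg q hq hq0 α hα0 hα1 t ht w hw hpos heq
  classical
  have h1top : ((1 : ℕ) : WithTop ℕ∞) ≤ ((⊤ : ℕ∞) : WithTop ℕ∞) := WithTop.coe_le_coe.mpr le_top
  -- Step 1: closed thickenings `K'_j` of `K_j = chart_j(tsupport ρ_j)` on which `η_j = 1`
  obtain ⟨ρ₁, hρ₁, hη1⟩ := 𝔄.exists_cthickening_cutoff_eq_one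
  set K' : ι → Set (EuclideanSpace ℝ (Fin 4)) := fun j =>
    Metric.cthickening ρ₁ (𝔄.chart j '' tsupport (𝔄.ρ j)) with hK'
  have hK'c : ∀ j, IsCompact (K' j) := fun j => (𝔄.isCompact_image_tsupport j).1.cthickening
  have hK't : ∀ j, K' j ⊆ (𝔄.chart j).target := fun j y hy =>
    𝔄.mem_target_of_cutoff_ne_zero (by rw [hη1 j y hy]; exact one_ne_zero)
  have hthick : ∀ j, Metric.thickening ρ₁ (𝔄.chart j '' tsupport (𝔄.ρ j)) ⊆ K' j := fun j =>
    Metric.thickening_subset_cthickening _ _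
  -- Step 2: the chart coefficients of the linearisation at every chart centre
  choose A B Cc hA hB hCc hAsymm hApos hrep0 using fun j : ι =>
    exists_linearised_chartRep g hg hq hq0 ht hw hpos heq (𝔄.center j)
  have hl' : ∀ j, ∃ lam : ℝ, 0 < lam ∧ ∀ y ∈ K' j, ∀ ξ : Fin 4 → ℝ, lam * ∑ i, ξ i ^ 2 ≤
      ∑ i, ∑ i', A j i i' y * ξ i * ξ i' := fun j =>
    exists_ellipticity_const_of_continuousOn (hK'c j)
      (fun i i' => (hA j i i').continuousOn.mono (hK't j))
      (fun y hy ξ hξ => hApos j y (hK't j hy) ξ hξ)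
  choose lam hlam0 hlam using hl'
  obtain ⟨l, hl, hlle⟩ := exists_pos_forall_le_of_finite hlam0
  -- Step 3: the cut-off coefficients `η_j A_j`, `η_j B_j`, `η_j C_j` and their bounds
  set acoef : ι → Fin 4 → Fin 4 → EuclideanSpace ℝ (Fin 4) → ℝ := fun j i i' y =>
    𝔄.cutoff j y * A j i i' y with hacoef
  set bcoef : ι → Fin 4 → EuclideanSpace ℝ (Fin 4) → ℝ := fun j l' y =>
    𝔄.cutoff j y * B j l' y with hbcoef
  set ccoef : ι → EuclideanSpace ℝ (Fin 4) → ℝ := fun j y => 𝔄.cutoff j y * Cc j y with hccoef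
  have haS : ∀ j i i', ContDiff ℝ ∞ (acoef j i i') := fun j i i' =>
    ContDiffHolderFunction.contDiff_cutoff_mul (𝔄.contDiff_cutoff j) (𝔄.chart j).open_target
      (hA j i i') (𝔄.tsupport_cutoff_subset j)
  have hbS : ∀ j l', ContDiff ℝ ∞ (bcoef j l') := fun j l' =>
    ContDiffHolderFunction.contDiff_cutoff_mul (𝔄.contDiff_cutoff j) (𝔄.chart j).open_target
      (hB j l') (𝔄.tsupport_cutoff_subset j)
  have hcS : ∀ j, ContDiff ℝ ∞ (ccoef j) := fun j =>
    ContDiffHolderFunction.contDiff_cutoff_mul (𝔄.contDiff_cutoff j) (𝔄.chart j).open_target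
      (hCc j) (𝔄.tsupport_cutoff_subset j)
  choose Zs Zh hZ using fun j i i' => exists_bound_holderWith_of_hasCompactSupport
    ((haS j i i').of_le (by exact_mod_cast h1top))
    (ContDiffHolderFunction.hasCompactSupport_cutoff_mul (𝔄.hasCompactSupport_cutoff j) _) hα1.le
  choose Ws Wh hW using fun j l' => exists_bound_holderWith_of_hasCompactSupport
    ((hbS j l').of_le (by exact_mod_cast h1top))
    (ContDiffHolderFunction.hasCompactSupport_cutoff_mul (𝔄.hasCompactSupport_cutoff j) _) hα1.le
  choose Vs Vh hV using fun j => exists_bound_holderWith_of_hasCompactSupport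
    ((hcS j).of_le (by exact_mod_cast h1top))
    (ContDiffHolderFunction.hasCompactSupport_cutoff_mul (𝔄.hasCompactSupport_cutoff j) _) hα1.le
  set Ka : ℝ≥0 := Finset.univ.sup (fun p : ι × Fin 4 × Fin 4 =>
    Zs p.1 p.2.1 p.2.2 + Zh p.1 p.2.1 p.2.2) with hKa
  set Kb : ℝ≥0 := Finset.univ.sup (fun p : ι × Fin 4 => Ws p.1 p.2 + Wh p.1 p.2) with hKb
  set Kc : ℝ≥0 := Finset.univ.sup (fun j : ι => Vs j + Vh j) with hKc
  have hKa' : ∀ j i i', Zs j i i' ≤ Ka ∧ Zh j i i' ≤ Ka := fun j i i' => by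
    have h := Finset.le_sup
      (f := fun p : ι × Fin 4 × Fin 4 => Zs p.1 p.2.1 p.2.2 + Zh p.1 p.2.1 p.2.2)
      (Finset.mem_univ (j, i, i'))
    exact ⟨le_self_add.trans h, le_add_self.trans h⟩
  have hKb' : ∀ j l', Ws j l' ≤ Kb ∧ Wh j l' ≤ Kb := fun j l' => by
    have h := Finset.le_sup (f := fun p : ι × Fin 4 => Ws p.1 p.2 + Wh p.1 p.2)
      (Finset.mem_univ (j, l'))
    exact ⟨le_self_add.trans h, le_add_self.trans h⟩
  have hKc' : ∀ j, Vs j ≤ Kc ∧ Vh j ≤ Kc := fun j => by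
    have h := Finset.le_sup (f := fun j : ι => Vs j + Vh j) (Finset.mem_univ j)
    exact ⟨le_self_add.trans h, le_add_self.trans h⟩
  have ha0 : ∀ j i i' y, ‖acoef j i i' y‖ ≤ Ka := fun j i i' y =>
    ((hZ j i i').1 y).trans (NNReal.coe_le_coe.2 (hKa' j i i').1)
  have hsymm : ∀ j i i' y, acoef j i i' y = acoef j i' i y := fun j i i' y =>
    congrArg (fun s : ℝ => 𝔄.cutoff j y * s) (hAsymm j i i' y)
  have hlow : ∀ j, ∀ y ∈ Metric.thickening ρ₁ (𝔄.chart j '' tsupport (𝔄.ρ j)), ∀ ξ : Fin 4 → ℝ,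
      l * ∑ i, ξ i ^ 2 ≤ ∑ i, ∑ i', acoef j i i' y * ξ i * ξ i' := fun j y hy ξ => by
    have hyK : y ∈ K' j := hthick j hy
    calc l * ∑ i, ξ i ^ 2 ≤ lam j * ∑ i, ξ i ^ 2 :=
          mul_le_mul_of_nonneg_right (hlle j) (Finset.sum_nonneg fun i _ => sq_nonneg _)
      _ ≤ ∑ i, ∑ i', A j i i' y * ξ i * ξ i' := hlam j y hyK ξ
      _ = ∑ i, ∑ i', acoef j i i' y * ξ i * ξ i' := by simp only [hacoef, hη1 j y hyK, one_mul]
  have hup : ∀ j, ∀ y ∈ Metric.thickening ρ₁ (𝔄.chart j '' tsupport (𝔄.ρ j)), ∀ ξ : Fin 4 → ℝ,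
      ∑ i, ∑ i', acoef j i i' y * ξ i * ξ i' ≤ (Fintype.card (Fin 4) * Ka : ℝ) * ∑ i, ξ i ^ 2 :=
    fun j y _ ξ => quadratic_le_card_mul_of_abs_le
      (fun i i' => by rw [← Real.norm_eq_abs]; exact ha0 j i i' y) ξ
  have haH : ∀ j i i', HolderOnWith Ka α (acoef j i i')
      (Metric.thickening ρ₁ (𝔄.chart j '' tsupport (𝔄.ρ j))) := fun j i i' =>
    ((hZ j i i').2.mono (hKa' j i i').2).holderOnWith _
  have hb0 : ∀ j l' y, y ∈ Metric.thickening ρ₁ (𝔄.chart j '' tsupport (𝔄.ρ j)) →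
      ‖bcoef j l' y‖ ≤ Kb := fun j l' y _ =>
    ((hW j l').1 y).trans (NNReal.coe_le_coe.2 (hKb' j l').1)
  have hbH : ∀ j l', HolderOnWith Kb α (bcoef j l')
      (Metric.thickening ρ₁ (𝔄.chart j '' tsupport (𝔄.ρ j))) := fun j l' =>
    ((hW j l').2.mono (hKb' j l').2).holderOnWith _
  have hc0 : ∀ j, ∀ y ∈ Metric.thickening ρ₁ (𝔄.chart j '' tsupport (𝔄.ρ j)),
      ‖ccoef j y‖ ≤ Kc := fun j y _ =>
    ((hV j).1 y).trans (NNReal.coe_le_coe.2 (hKc' j).1)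
  have hcH : ∀ j, HolderOnWith Kc α (ccoef j)
      (Metric.thickening ρ₁ (𝔄.chart j '' tsupport (𝔄.ρ j))) := fun j =>
    ((hV j).2.mono (hKc' j).2).holderOnWith _
  refine ⟨acoef, bcoef, ccoef, ρ₁, l, Fintype.card (Fin 4) * Ka, Ka, Kb, Kc, hρ₁, hl, hsymm, hlow,
    hup, fun j i i' y _ => ha0 j i i' y, haH, hb0, hbH, hc0, hcH, ?_⟩
  -- Step 4: the chart-piece representation of `(-L') u`
  intro L' hL' u j y
  by_cases hy : y ∈ (𝔄.chart j).target
  · by_cases hρ : 𝔄.ρ j ((𝔄.chart j).symm y) = 0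
    · rw [𝔄.piece_apply_of_mem _ hy, 𝔄.piece_apply_of_mem _ hy, hρ, zero_smul, zero_smul,
        zero_mul]
    · -- near `y` the chart restriction is `u ∘ chart_j⁻¹` and `η_j = 1`
      have hR : ((chartRestrictCLM 𝔄 hα1.le j (𝔄.cutoff j) (𝔄.contDiff_cutoff j)
          (𝔄.hasCompactSupport_cutoff j) (𝔄.tsupport_cutoff_subset j) u :
            ContDiffHolderFunction (EuclideanSpace ℝ (Fin 4)) ℝ 2 α) :
              EuclideanSpace ℝ (Fin 4) → ℝ) =ᶠ[𝓝 y]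
          fun z => u ((𝔄.chart j).symm z) := by
        have h := chartRestrictCLM_eventuallyEq 𝔄 hα1.le u hρ
        rwa [(𝔄.chart j).right_inv hy] at h
      have hη : 𝔄.cutoff j y = 1 := by
        have h := (𝔄.cutoff_eventuallyEq_one hρ).self_of_nhds
        rwa [(𝔄.chart j).right_inv hy] at h
      have hR0 : (chartRestrictCLM 𝔄 hα1.le j (𝔄.cutoff j) (𝔄.contDiff_cutoff j)
          (𝔄.hasCompactSupport_cutoff j) (𝔄.tsupport_cutoff_subset j) u :
            ContDiffHolderFunction (EuclideanSpace ℝ (Fin 4)) ℝ 2 α) y =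
          u ((𝔄.chart j).symm y) := hR.self_of_nhds
      have hR1 := hR.fderiv_eq (𝕜 := ℝ)
      have hR2 := (Filter.EventuallyEq.iteratedFDeriv ℝ hR 2).self_of_nhds
      have key := hrep0 j u u.contMDiff y hy
      have hLu : ((-L') u) ((𝔄.chart j).symm y) = -(L' u ((𝔄.chart j).symm y)) := rfl
      rw [𝔄.piece_apply_of_mem _ hy, 𝔄.piece_apply_of_mem _ hy, hR2, hR1, hR0, hLu, hL' u, key]
      simp only [smul_eq_mul, mul_one, hacoef, hbcoef, hccoef, hη, one_mul]
  · rw [𝔄.piece_apply_of_not_mem _ hy, 𝔄.piece_apply_of_not_mem _ hy, zero_mul]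

end Literature.Geometry.Riemannian.GurskyViaclovskyOpen

end Part5

/-!
## Part 6 — port of `Summits/SmoothPoincare4/SmoothPoincare4/Theorems/EntropyRungChangGurskyYangStubLinearisedInvertible.lean` (1 declarations kept)

# Gursky–Viaclovsky Prop. 2: the linearisation at a smooth admissible solution is invertible

At a smooth admissible solution `w` of the weighted `σ₂` path equation (`t ≤ 1`, `q > 0` smooth) every
bounded `L : C^{2,α}_𝔄(M) → C^{0,α}_𝔄(M)` acting pointwise as `𝓛_{t,w} + 4 q e^{−4w}` is invertible
(`stub_linearisedInvertible`): the chart-representation package `helper_linearisedChartRep` fed to the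
method-of-continuity assembly `stub_linearisedInvertible_of_chartRep`.

References: M. J. Gursky, J. A. Viaclovsky, J. Differential Geom. 63 (2003), Prop. 2, §5 [GurskyViaclovsky2003];
D. Gilbarg, N. S. Trudinger (2001), Thm. 5.2, Thm. 6.2 [GilbargTrudinger2001].
-/

section Part6

open _root_.Set _root_.Function _root_.Filter
open scoped _root_.Manifold _root_.ContDiff _root_.Topology _root_.NNReal
open Literature.Analysis.FunctionSpaces Literature.Geometry.Riemannian
  Literature.Geometry.Riemannian.GurskyViaclovskyPath
open Literature.Geometry.Lorentzian Literature.Geometry.Lorentzian.PseudoRiemannianMetric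

namespace Literature.Geometry.Riemannian.GurskyViaclovskyOpen

/-- **GURSKY–VIACLOVSKY PROP. 2: THE LINEARISATION AT A SMOOTH ADMISSIBLE SOLUTION WITH
`t ≤ 1` IS AN ISOMORPHISM `C^{2,α}_𝔄 → C^{0,α}_𝔄`.** Every bounded `L` acting pointwise as
`φ ↦ 𝓛_{t,w}φ + 4q e^{−4w}φ` is invertible: the chart representation of `−L`
(`helper_linearisedChartRep`) and the method of continuity from `Δ_g − 1`
(`stub_linearisedInvertible_of_chartRep`).
[cite: GurskyViaclovsky2003, §2, Prop. 2; GilbargTrudinger2001, Thm. 5.2 and Thm. 6.2] -/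
theorem stub_linearisedInvertible :
    ∀ (M : Type) [TopologicalSpace M] [T2Space M] [ChartedSpace (EuclideanSpace ℝ (Fin 4)) M]
      [IsManifold (𝓡 4) ∞ M] [CompactSpace M] {ι : Type} [Fintype ι]
      (𝔄 : HolderChartData ι (EuclideanSpace ℝ (Fin 4)) M)
      (g : PseudoRiemannianMetric (𝓡 4) ∞ (EuclideanSpace ℝ (Fin 4)) (TangentSpace (𝓡 4) : M → Type _))
      [g.HasLeviCivita], g.IsRiemannian →
      ∀ (q : M → ℝ), ContMDiff (𝓡 4) 𝓘(ℝ) ∞ q → (∀ x, 0 < q x) → ∀ {α : ℝ≥0}, 0 < α → α < 1 →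
      ∀ (t : ℝ), t ≤ 1 → ∀ (w : M → ℝ), ContMDiff (𝓡 4) 𝓘(ℝ) ∞ w →
      (∀ x, 0 < backgroundScalar g w x) →
      (∀ x, backgroundPathOperator g t w x = q x * Real.exp (-4 * w x)) →
      ∀ L : HolderManifoldFunction 𝔄 ℝ 2 α →L[ℝ] HolderManifoldFunction 𝔄 ℝ 0 α,
        (∀ (φ : HolderManifoldFunction 𝔄 ℝ 2 α) (x : M),
          L φ x = linearisedBackgroundOperator g t w φ x + 4 * q x * Real.exp (-4 * w x) * φ x) →
        L.IsInvertible := by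
  intro M _ _ _ _ _ ι _ 𝔄 g _ hg q hq hq0 α hα0 hα1 t ht w hw hpos heq L hL
  obtain ⟨a, b, c, ρ₁, l, U, Ka, Kb, Kc, h1, h2, h3, h4, h5, h6, h7, h8, h9, h10, h11, hrep⟩ :=
    helper_linearisedChartRep M 𝔄 g hg q hq hq0 hα0 hα1 t ht w hw hpos heq
  exact stub_linearisedInvertible_of_chartRep M 𝔄 g hg q hq hq0 hα0 hα1 t ht w hw hpos heq
    ⟨a, b, c, ρ₁, l, U, Ka, Kb, Kc, h1, h2, h3, h4, h5, h6, h7, h8, h9, h10, h11,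
      fun L' hL' u j y v hv => by subst hv; exact hrep L' hL' u j y⟩ L hL

end Literature.Geometry.Riemannian.GurskyViaclovskyOpen

end Part6

/-!
## Part 7 — port of `Summits/SmoothPoincare4/SmoothPoincare4/Theorems/EntropyRungChangGurskyYangStubRegularityOfInduction.lean` (1 declarations kept)

# `C^{2,α}_𝔄` solutions of the weighted `σ₂` path equation are `C^∞`, from the chart-level regularity induction

The manifold-level assembly of the regularity half of Gilbarg–Trudinger's Lemma 17.16 as used by
Gursky–Viaclovsky (2003), §5 ("since `f ∈ C^∞(M)`, it follows from classical elliptic regularity theory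
that `u_t ∈ C^∞(M)`"): `stub_regularity_of_induction` reduces the manifold statement to the chart-level
induction (hypothesis; supplied by `helper_regularityInduction` below) — cut `w ∘ chart⁻¹` off by a bump
(`memContDiffHolder_smul_comp_symm`), write the equation near `chart x₀` as `H(c(y), J²v(y)) = 0` with the
globally smooth chart structure function (`exists_contDiff_chartStructure`,
`backgroundPathOperator_chart_eq_chartOperator_of_contMDiff_two`), get strict ellipticity along the graph from
admissibility and `t ≤ 1` (`fderiv_jetOperator_single_pos_of_contDiffAt_two`, made uniform by
`exists_ellipticity_nhds_graph_of_pos`), run the induction for every order and return through the chart.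

References: M. J. Gursky, J. A. Viaclovsky, J. Differential Geom. 63 (2003), §5 [GurskyViaclovsky2003];
D. Gilbarg, N. S. Trudinger (2001), Lemma 17.16, §4.1 [GilbargTrudinger2001].
-/

section Part7

set_option maxSynthPendingDepth 3

open _root_.Set _root_.Function _root_.Filter _root_.Metric
open scoped _root_.Manifold _root_.ContDiff _root_.Topology _root_.NNReal

/-! ### The stub -/

namespace Literature.Geometry.Riemannian.GurskyViaclovskyOpen

open Literature.Analysis.FunctionSpaces Literature.Analysis.Calculus Literature.Geometry.Riemannian
open Literature.Geometry.Riemannian.GurskyViaclovskyPath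
open Literature.Geometry.Lorentzian Literature.Geometry.Lorentzian.PseudoRiemannianMetric
open Literature.Geometry.Lorentzian.MetricCoord

set_option maxHeartbeats 1600000 in
/-- **`stub_regularity` FROM THE REGULARITY INDUCTION** (Gilbarg–Trudinger Lemma 17.16,
regularity half, assembled on the manifold; see the module docstring for the construction): given
the chart-level induction `helper_regularityInduction`, every admissible `C^{2,α}_𝔄` solution `w` of
the weighted `σ₂` path equation with `t ≤ 1` and smooth positive right side is `C^∞`.
[cite: GurskyViaclovsky2003, §5] [cite: GilbargTrudinger2001, Lemma 17.16] -/
theorem stub_regularity_of_induction :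
    (∀ {ι : Type} [Fintype ι] [DecidableEq ι] {E : Type} [NormedAddCommGroup E] [InnerProductSpace ℝ E]
      [FiniteDimensional ℝ E] [MeasurableSpace E] [BorelSpace E] [Nontrivial E]
      (bE : OrthonormalBasis ι ℝ E) {α : NNReal}, 0 < α → α < 1 → ∀ (m : ℕ)
      {P : Type} [NormedAddCommGroup P] [NormedSpace ℝ P] [FiniteDimensional ℝ P]
      (H : P × Literature.Analysis.Calculus.CJet ι 2 → ℝ),
      ContDiff ℝ ((⊤ : ℕ∞) : WithTop ℕ∞) H →
      ∀ (c : E → P) (v : E → ℝ) (x₀ : E) (R : ℝ), 0 < R →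
      ContDiffOn ℝ (m + 1) c (Metric.ball x₀ R) →
      (∃ Bc : NNReal, (∀ y ∈ Metric.ball x₀ R, ∀ j ≤ m + 1, ‖iteratedFDeriv ℝ j c y‖ ≤ Bc) ∧
        HolderOnWith Bc α (iteratedFDeriv ℝ (m + 1) c) (Metric.ball x₀ R)) →
      ContDiffOn ℝ 2 v (Metric.ball x₀ R) →
      (∃ Bv : NNReal, (∀ y ∈ Metric.ball x₀ R, ∀ j ≤ 2, ‖iteratedFDeriv ℝ j v y‖ ≤ Bv) ∧
        HolderOnWith Bv α (iteratedFDeriv ℝ 2 v) (Metric.ball x₀ R)) →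
      (∀ y ∈ Metric.ball x₀ R, H (c y, Literature.Analysis.Calculus.cjetOf bE 2 v y) = 0) →
      (∃ l δ : ℝ, 0 < l ∧ 0 < δ ∧ ∀ y ∈ Metric.ball x₀ R,
        ∀ (p' : P) (J' : Literature.Analysis.Calculus.CJet ι 2),
          ‖p' - c y‖ < δ → ‖J' - Literature.Analysis.Calculus.cjetOf bE 2 v y‖ < δ →
          ∀ η : E →L[ℝ] ℝ, l * ‖η‖ ^ 2 ≤
            fderiv ℝ H (p', J') ((0 : P), Pi.single (Fin.last 2)
              (fun I : Fin 2 → ι => η (bE (I 0)) * η (bE (I 1))))) →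
      ∀ ρ : ℝ, 0 < ρ → ρ < R →
        ContDiffOn ℝ (m + 3) v (Metric.ball x₀ ρ) ∧
        ∃ B' : NNReal, (∀ y ∈ Metric.ball x₀ ρ, ∀ j ≤ m + 3, ‖iteratedFDeriv ℝ j v y‖ ≤ B') ∧
          HolderOnWith B' α (iteratedFDeriv ℝ (m + 3) v) (Metric.ball x₀ ρ)) →
    ∀ (M : Type) [TopologicalSpace M] [T2Space M] [ChartedSpace (EuclideanSpace ℝ (Fin 4)) M]
      [IsManifold (modelWithCornersSelf ℝ (EuclideanSpace ℝ (Fin 4))) ((⊤ : ℕ∞) : WithTop ℕ∞) M]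
      [CompactSpace M] {ι : Type} [Fintype ι]
      (𝔄 : Literature.Analysis.FunctionSpaces.HolderChartData ι (EuclideanSpace ℝ (Fin 4)) M)
      (g : Literature.Geometry.Lorentzian.PseudoRiemannianMetric
        (modelWithCornersSelf ℝ (EuclideanSpace ℝ (Fin 4))) ((⊤ : ℕ∞) : WithTop ℕ∞)
        (EuclideanSpace ℝ (Fin 4))
        (TangentSpace (modelWithCornersSelf ℝ (EuclideanSpace ℝ (Fin 4))) : M → Type _))
      [g.HasLeviCivita], g.IsRiemannian →
      ∀ (q : M → ℝ), ContMDiff (modelWithCornersSelf ℝ (EuclideanSpace ℝ (Fin 4)))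
        (modelWithCornersSelf ℝ ℝ) ((⊤ : ℕ∞) : WithTop ℕ∞) q → (∀ x, 0 < q x) →
      ∀ {α : NNReal}, 0 < α → α < 1 →
      ∀ (t : ℝ), t ≤ 1 → ∀ (w : Literature.Analysis.FunctionSpaces.HolderManifoldFunction 𝔄 ℝ 2 α),
      (∀ x, 0 < Literature.Geometry.Riemannian.GurskyViaclovskyPath.backgroundScalar g w x) →
      (∀ x, Literature.Geometry.Riemannian.GurskyViaclovskyPath.backgroundPathOperator g t w x =
        q x * Real.exp (-4 * w x)) →
      ContMDiff (modelWithCornersSelf ℝ (EuclideanSpace ℝ (Fin 4))) (modelWithCornersSelf ℝ ℝ)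
        ((⊤ : ℕ∞) : WithTop ℕ∞) (w : M → ℝ) := by
  intro hind M _ _ _ _ _ ι _ 𝔄 g _ hg q hq hq0 α hα0 hα1 t ht w hadm heq x₀
  classical
  have hw2 : ContMDiff (𝓡 4) 𝓘(ℝ) 2 (w : M → ℝ) := w.contMDiff
  /- (1) a chart of the data whose source contains `x₀` -/
  obtain ⟨j, hj⟩ : ∃ j, 𝔄.ρ j x₀ ≠ 0 := by
    by_contra! h
    have h1 := 𝔄.sum_smul_eq x₀ (1 : ℝ)
    simp only [h, zero_smul, Finset.sum_const_zero] at h1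
    exact zero_ne_one h1
  set c₀ : M := 𝔄.center j with hc₀
  have hx₀ : x₀ ∈ (chartAt (EuclideanSpace ℝ (Fin 4)) c₀).source := by
    by_contra h
    exact hj (𝔄.ρ_eq_zero h)
  set y₀ : (EuclideanSpace ℝ (Fin 4)) := chartAt (EuclideanSpace ℝ (Fin 4)) c₀ x₀ with hy₀def
  have hy₀ : y₀ ∈ (chartAt (EuclideanSpace ℝ (Fin 4)) c₀).target := (chartAt (EuclideanSpace ℝ (Fin 4)) c₀).map_source hx₀
  obtain ⟨ε, hε, hεt⟩ := Metric.isOpen_iff.1 (chartAt (EuclideanSpace ℝ (Fin 4)) c₀).open_target y₀ hy₀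
  /- (2) the pulled-back metric on the chart target and its components -/
  set U : TopologicalSpace.Opens (EuclideanSpace ℝ (Fin 4)) :=
    ⟨(chartAt (EuclideanSpace ℝ (Fin 4)) c₀).target, (chartAt (EuclideanSpace ℝ (Fin 4)) c₀).open_target⟩ with hUdef
  have hUt : (U : Set (EuclideanSpace ℝ (Fin 4))) = (chartAt (EuclideanSpace ℝ (Fin 4)) c₀).target := rfl
  set Φ : U → M := fun u ↦ (chartAt (EuclideanSpace ℝ (Fin 4)) c₀).symm u with hΦdef
  have hΦ : ContMDiff 𝓘(ℝ, (EuclideanSpace ℝ (Fin 4))) 𝓘(ℝ, (EuclideanSpace ℝ (Fin 4))) (∞ + 1) Φ := ChartInverseSelf.contMDiff_symm c₀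
  have hΦ' : ∀ u, Function.Injective (mfderiv 𝓘(ℝ, (EuclideanSpace ℝ (Fin 4))) 𝓘(ℝ, (EuclideanSpace ℝ (Fin 4))) Φ u) :=
    ChartInverseSelf.injective_mfderiv_symm c₀
  have hdim : Module.finrank ℝ (EuclideanSpace ℝ (Fin 4)) = Module.finrank ℝ (EuclideanSpace ℝ (Fin 4)) := rfl
  have hpb : contMDiff_pullbackBilin 𝓘(ℝ, (EuclideanSpace ℝ (Fin 4))) M 𝓘(ℝ, (EuclideanSpace ℝ (Fin 4))) U ∞ := contMDiff_pullbackBilin_holds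
  set gU := g.comap hpb Φ hΦ hΦ' hdim with hgUdef
  haveI : gU.HasLeviCivita := gU.hasLeviCivita
  set G : (EuclideanSpace ℝ (Fin 4)) → (EuclideanSpace ℝ (Fin 4)) →L[ℝ] (EuclideanSpace ℝ (Fin 4)) →L[ℝ] ℝ :=
    Function.extend (Subtype.val : U → (EuclideanSpace ℝ (Fin 4)))
      (fun y : U ↦ (gU.val y : (EuclideanSpace ℝ (Fin 4)) →L[ℝ] (EuclideanSpace ℝ (Fin 4)) →L[ℝ] ℝ)) (fun _ ↦ 0) with hGdef
  have hG : ∀ y : U, gU.val y = G y := fun y ↦ by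
    rw [hGdef, Subtype.val_injective.extend_apply]
  have hmet : IsMetricOn G (U : Set (EuclideanSpace ℝ (Fin 4))) := OpensChart.isMetricOn_repr hG
  have hgUR : gU.IsRiemannian := fun z v hv ↦ by
    have h1 : gU.val z v v = g.val (Φ z) (mfderiv 𝓘(ℝ, (EuclideanSpace ℝ (Fin 4))) 𝓘(ℝ, (EuclideanSpace ℝ (Fin 4))) Φ z v)
        (mfderiv 𝓘(ℝ, (EuclideanSpace ℝ (Fin 4))) 𝓘(ℝ, (EuclideanSpace ℝ (Fin 4))) Φ z v) := rfl
    rw [h1]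
    exact hg _ _ fun h0 ↦ hv ((hΦ' z) (by
      rw [h0]
      exact ((mfderiv 𝓘(ℝ, (EuclideanSpace ℝ (Fin 4))) 𝓘(ℝ, (EuclideanSpace ℝ (Fin 4))) Φ z).map_zero).symm))
  set W : (EuclideanSpace ℝ (Fin 4)) → ℝ := fun z ↦ g.weylNormSq ((chartAt (EuclideanSpace ℝ (Fin 4)) c₀).symm z) with hWdef
  have hWy : ∀ y : U, W y = gU.weylNormSq y := fun y ↦
    (g.weylNormSq_comap hpb hΦ hΦ' hdim hg y).symm
  have hW : ContDiffOn ℝ ∞ W (U : Set (EuclideanSpace ℝ (Fin 4))) := contDiffOn_of_eq_weylNormSq gU hG hgUR hWy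
  set Q : (EuclideanSpace ℝ (Fin 4)) → ℝ := fun z ↦ q ((chartAt (EuclideanSpace ℝ (Fin 4)) c₀).symm z) with hQdef
  have hQ : ContDiffOn ℝ ∞ Q (U : Set (EuclideanSpace ℝ (Fin 4))) := contDiffOn_comp_chart_symm hq c₀ Subset.rfl
  /- (3) the structure function `𝒩`, the equation function `H`, the coefficient field `cf` -/
  obtain ⟨𝒩, h𝒩, h𝒩_eq⟩ := exists_contDiff_chartStructure (E := (EuclideanSpace ℝ (Fin 4)))
  set bE : OrthonormalBasis (Fin 4) ℝ (EuclideanSpace ℝ (Fin 4)) := EuclideanSpace.basisFun (Fin 4) ℝ with hbE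
  obtain ⟨H, hH_eq⟩ : ∃ H : (ℝ × (ℝ × ((EuclideanSpace ℝ (Fin 4) →L[ℝ] EuclideanSpace ℝ (Fin 4) →L[ℝ] ℝ) × (((EuclideanSpace ℝ (Fin 4) →L[ℝ] ℝ) →L[ℝ] EuclideanSpace ℝ (Fin 4)) × ((EuclideanSpace ℝ (Fin 4) →L[ℝ] EuclideanSpace ℝ (Fin 4) →L[ℝ] EuclideanSpace ℝ (Fin 4)) × (EuclideanSpace ℝ (Fin 4) →L[ℝ] EuclideanSpace ℝ (Fin 4) →L[ℝ] ℝ)))))) × CJet (Fin 4) 2 → ℝ, ∀ (p : (ℝ × (ℝ × ((EuclideanSpace ℝ (Fin 4) →L[ℝ] EuclideanSpace ℝ (Fin 4) →L[ℝ] ℝ) × (((EuclideanSpace ℝ (Fin 4) →L[ℝ] ℝ) →L[ℝ] EuclideanSpace ℝ (Fin 4)) × ((EuclideanSpace ℝ (Fin 4) →L[ℝ] EuclideanSpace ℝ (Fin 4) →L[ℝ] EuclideanSpace ℝ (Fin 4)) × (EuclideanSpace ℝ (Fin 4) →L[ℝ] EuclideanSpace ℝ (Fin 4) →L[ℝ]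 ℝ))))))) (J : CJet (Fin 4) 2),
      H (p, J) = -𝒩 (t, p, (J 0 Fin.elim0, pOf bE J, rOf bE J)) :=
    ⟨fun z => -𝒩 (t, z.1, (z.2 0 Fin.elim0, pOf bE z.2, rOf bE z.2)), fun _ _ => rfl⟩
  have hHfun : H = fun z => -𝒩 (t, z.1, (z.2 0 Fin.elim0, pOf bE z.2, rOf bE z.2)) :=
    funext fun z => hH_eq z.1 z.2
  have hH : ContDiff ℝ ∞ H := by
    have h0 : ContDiff ℝ ∞ (fun J : CJet (Fin 4) 2 ↦ J 0 Fin.elim0) :=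
      contDiff_pi.1 (contDiff_pi.1 contDiff_id 0) _
    have hin : ContDiff ℝ ∞ fun z : (ℝ × (ℝ × ((EuclideanSpace ℝ (Fin 4) →L[ℝ] EuclideanSpace ℝ (Fin 4) →L[ℝ] ℝ) × (((EuclideanSpace ℝ (Fin 4) →L[ℝ] ℝ) →L[ℝ] EuclideanSpace ℝ (Fin 4)) × ((EuclideanSpace ℝ (Fin 4) →L[ℝ] EuclideanSpace ℝ (Fin 4) →L[ℝ] EuclideanSpace ℝ (Fin 4)) × (EuclideanSpace ℝ (Fin 4) →L[ℝ] EuclideanSpace ℝ (Fin 4) →L[ℝ] ℝ)))))) × CJet (Fin 4) 2 =>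
        ((t, z.1, (z.2 0 Fin.elim0, pOf bE z.2, rOf bE z.2)) :
          ℝ × (ℝ × (ℝ × ((EuclideanSpace ℝ (Fin 4) →L[ℝ] EuclideanSpace ℝ (Fin 4) →L[ℝ] ℝ) × (((EuclideanSpace ℝ (Fin 4) →L[ℝ] ℝ) →L[ℝ] EuclideanSpace ℝ (Fin 4)) × ((EuclideanSpace ℝ (Fin 4) →L[ℝ] EuclideanSpace ℝ (Fin 4) →L[ℝ] EuclideanSpace ℝ (Fin 4)) × (EuclideanSpace ℝ (Fin 4) →L[ℝ] EuclideanSpace ℝ (Fin 4) →L[ℝ] ℝ)))))) × (ℝ × ((EuclideanSpace ℝ (Fin 4)) →L[ℝ] ℝ) × ((EuclideanSpace ℝ (Fin 4)) →L[ℝ] (EuclideanSpace ℝ (Fin 4)) →L[ℝ] ℝ))) :=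
      contDiff_const.prodMk (contDiff_fst.prodMk ((h0.comp contDiff_snd).prodMk
        (((isBoundedLinearMap_pOf bE).contDiff.comp contDiff_snd).prodMk
          ((isBoundedLinearMap_rOf bE).contDiff.comp contDiff_snd))))
    rw [hHfun]
    exact (h𝒩.comp hin).neg
  obtain ⟨cf, hcf_eq⟩ : ∃ cf : (EuclideanSpace ℝ (Fin 4)) → (ℝ × (ℝ × ((EuclideanSpace ℝ (Fin 4) →L[ℝ] EuclideanSpace ℝ (Fin 4) →L[ℝ] ℝ) × (((EuclideanSpace ℝ (Fin 4) →L[ℝ] ℝ) →L[ℝ] EuclideanSpace ℝ (Fin 4)) × ((EuclideanSpace ℝ (Fin 4) →L[ℝ] EuclideanSpace ℝ (Fin 4) →L[ℝ] EuclideanSpace ℝ (Fin 4)) × (EuclideanSpace ℝ (Fin 4) →L[ℝ] EuclideanSpace ℝ (Fin 4) →L[ℝ] ℝ)))))), ∀ y, cf y =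
      (W y, Q y, G y, sharpAt G y, chrAt G y, ricAt G y) := ⟨_, fun _ => rfl⟩
  have hcU : ContDiffOn ℝ ∞ cf (U : Set (EuclideanSpace ℝ (Fin 4))) := by
    rw [show cf = fun y => (W y, Q y, G y, sharpAt G y, chrAt G y, ricAt G y) from funext hcf_eq]
    exact hW.prodMk (hQ.prodMk (hmet.contDiffOn.prodMk (hmet.contDiffOn_sharpAt.prodMk
      (hmet.contDiffOn_chrAt.prodMk hmet.contDiffOn_ricAt))))
  -- the slice of `H` at a coefficient value `cf y`
  have hslice : ∀ (y : (EuclideanSpace ℝ (Fin 4))) (J : CJet (Fin 4) 2), H (cf y, J) =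
      -(chartOperator G t (W y) y (-pOf bE J) (-rOf bE J) - Q y * Real.exp (-4 * J 0 Fin.elim0)) := by
    intro y J
    rw [hH_eq, hcf_eq, h𝒩_eq]
  /- (4) the chart representative of `w` and its cut-off -/
  set wh : (EuclideanSpace ℝ (Fin 4)) → ℝ := fun z => w ((chartAt (EuclideanSpace ℝ (Fin 4)) c₀).symm z) with hwhdef
  have hwh2 : ∀ y ∈ (chartAt (EuclideanSpace ℝ (Fin 4)) c₀).target, ContDiffAt ℝ 2 wh y := fun y hy =>
    contDiffAt_comp_chart_symm_of_contMDiffAt c₀ hy (hw2 _)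
  have h4 : (0 : ℝ) < ε / 4 := by positivity
  let β : ContDiffBump y₀ := ⟨ε / 4, ε / 2, h4, by linarith⟩
  have hβs : tsupport β ⊆ (chartAt (EuclideanSpace ℝ (Fin 4)) c₀).target := by
    rw [β.tsupport_eq]
    exact (closedBall_subset_ball (by show ε / 2 < ε; linarith)).trans hεt
  obtain ⟨v, hv_eq⟩ : ∃ v : (EuclideanSpace ℝ (Fin 4)) → ℝ, ∀ y, v y = β y * wh y := ⟨_, fun _ => rfl⟩
  have hv : MemContDiffHolder 2 α v := by
    rw [show v = fun y => β y • w ((𝔄.chart j).symm y) from funext fun y => by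
      rw [hv_eq, smul_eq_mul]]
    exact memContDiffHolder_smul_comp_symm 𝔄 hα1.le w j β.contDiff β.hasCompactSupport hβs
  have hvwh : ∀ y ∈ ball y₀ (ε / 4), v =ᶠ[𝓝 y] wh := fun y hy => by
    filter_upwards [β.eventuallyEq_one_of_mem_ball hy] with z hz
    rw [hv_eq, hz, Pi.one_apply, one_mul]
  set R : ℝ := ε / 8 with hRdef
  have hR : 0 < R := by positivity
  have hRball : closedBall y₀ R ⊆ ball y₀ (ε / 4) :=
    closedBall_subset_ball (by show ε / 8 < ε / 4; linarith)
  have hballU : ball y₀ (ε / 4) ⊆ (chartAt (EuclideanSpace ℝ (Fin 4)) c₀).target :=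
    (ball_subset_ball (by linarith)).trans hεt
  have hbRU : ball y₀ R ⊆ (chartAt (EuclideanSpace ℝ (Fin 4)) c₀).target :=
    (ball_subset_closedBall.trans hRball).trans hballU
  /- (6) `C^{2,α}` data of `v` on the ball -/
  have hvC2 : ContDiff ℝ 2 v := hv.contDiff
  have hv_diff : ContDiffOn ℝ 2 v (Metric.ball y₀ R) := hvC2.contDiffOn
  have hv_data : ∃ Bv : ℝ≥0, (∀ y ∈ Metric.ball y₀ R, ∀ i ≤ 2, ‖iteratedFDeriv ℝ i v y‖ ≤ Bv) ∧
      HolderOnWith Bv α (iteratedFDeriv ℝ 2 v) (Metric.ball y₀ R) := by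
    obtain ⟨C0, hC0⟩ := eSupNorm_lt_top_iff.1 (hv.2.1 0 (by norm_num))
    obtain ⟨C1, hC1⟩ := eSupNorm_lt_top_iff.1 (hv.2.1 1 (by norm_num))
    obtain ⟨C2, hC2⟩ := eSupNorm_lt_top_iff.1 (hv.2.1 2 le_rfl)
    obtain ⟨Ch, hCh⟩ := hv.2.2
    refine ⟨(max C0 (max C1 C2)).toNNReal + Ch, fun y _ i hi => ?_, ?_⟩
    · have hle : ‖iteratedFDeriv ℝ i v y‖ ≤ max C0 (max C1 C2) := by
        interval_cases i
        · exact (hC0 y).trans (le_max_left _ _)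
        · exact (hC1 y).trans ((le_max_left _ _).trans (le_max_right _ _))
        · exact (hC2 y).trans ((le_max_right _ _).trans (le_max_right _ _))
      calc ‖iteratedFDeriv ℝ i v y‖ ≤ max C0 (max C1 C2) := hle
        _ ≤ ((max C0 (max C1 C2)).toNNReal : ℝ) := Real.le_coe_toNNReal _
        _ ≤ (((max C0 (max C1 C2)).toNNReal + Ch : ℝ≥0) : ℝ) := by
            exact_mod_cast le_self_add
    · exact (HolderOnWith.mono_const (fun x _ z _ => hCh x z) le_add_self)
  /- (7) `C^{m+1,α}` data of the coefficients on the ball, for every `m` -/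
  have hc_data : ∀ m : ℕ, ContDiffOn ℝ (m + 1) cf (Metric.ball y₀ R) ∧ ∃ Bc : ℝ≥0,
      (∀ y ∈ Metric.ball y₀ R, ∀ i ≤ m + 1, ‖iteratedFDeriv ℝ i cf y‖ ≤ Bc) ∧
      HolderOnWith Bc α (iteratedFDeriv ℝ (m + 1) cf) (Metric.ball y₀ R) := fun m =>
    holderData_succ_of_contDiffOn U.2 hcU (hRball.trans hballU) hα1.le m
  /- (8) the equation `H(cf y, J²v(y)) = 0` on the ball -/
  -- the chart equation for `w` at a point of the target
  have hce : ∀ y ∈ (chartAt (EuclideanSpace ℝ (Fin 4)) c₀).target, backgroundPathOperator g t w ((chartAt (EuclideanSpace ℝ (Fin 4)) c₀).symm y) =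
      chartOperator G t (W y) y (-fderiv ℝ wh y) (-fderiv ℝ (fderiv ℝ wh) y) := by
    intro y hyU
    have h := backgroundPathOperator_chart_eq_chartOperator_of_contMDiff_two g hg t
      (u := fun m => -w m) hw2.neg c₀ hyU
    simp only [neg_neg] at h
    have e1 : fderiv ℝ (fun z => -w ((chartAt (EuclideanSpace ℝ (Fin 4)) c₀).symm z)) y = -fderiv ℝ wh y := fderiv_neg
    have e2 : fderiv ℝ (fderiv ℝ fun z => -w ((chartAt (EuclideanSpace ℝ (Fin 4)) c₀).symm z)) y =
        -fderiv ℝ (fderiv ℝ wh) y := by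
      have e : fderiv ℝ (fun z => -w ((chartAt (EuclideanSpace ℝ (Fin 4)) c₀).symm z)) = fun z => -fderiv ℝ wh z := by
        funext z
        exact fderiv_neg
      rw [e]
      exact fderiv_neg
    rw [e1, e2] at h
    exact h
  -- jets of `v` are jets of `wh` on the small ball
  have hjet : ∀ y ∈ ball y₀ (ε / 4),
      cjetOf bE 2 v y 0 Fin.elim0 = wh y ∧ pOf bE (cjetOf bE 2 v y) = fderiv ℝ wh y ∧
        rOf bE (cjetOf bE 2 v y) = fderiv ℝ (fderiv ℝ wh) y := by
    intro y hy
    have hloc : v =ᶠ[𝓝 y] wh := hvwh y hy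
    have hvy : ContDiffAt ℝ 2 v y := (hwh2 y (hballU hy)).congr_of_eventuallyEq hloc
    refine ⟨?_, ?_, ?_⟩
    · rw [cjetOf_zero, hloc.eq_of_nhds]
    · rw [pOf_cjetOf, hloc.fderiv_eq]
    · rw [rOf_cjetOf bE hvy, hloc.fderiv.fderiv_eq]
  have hEq : ∀ y ∈ Metric.ball y₀ R, H (cf y, cjetOf bE 2 v y) = 0 := by
    intro y hy
    have hy4 : y ∈ ball y₀ (ε / 4) := hRball (ball_subset_closedBall hy)
    have hyU : y ∈ (chartAt (EuclideanSpace ℝ (Fin 4)) c₀).target := hballU hy4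
    obtain ⟨e0, e1, e2⟩ := hjet y hy4
    rw [hslice, e0, e1, e2, ← hce y hyU, heq]
    show -(q ((chartAt (EuclideanSpace ℝ (Fin 4)) c₀).symm y) * Real.exp (-4 * w ((chartAt (EuclideanSpace ℝ (Fin 4)) c₀).symm y)) -
      q ((chartAt (EuclideanSpace ℝ (Fin 4)) c₀).symm y) * Real.exp (-4 * w ((chartAt (EuclideanSpace ℝ (Fin 4)) c₀).symm y))) = 0
    rw [sub_self, neg_zero]
  /- (9) strict ellipticity along the graph over the closed ball -/
  have hopen : IsOpen {x : (EuclideanSpace ℝ (Fin 4)) × ℝ × CJet (Fin 4) 2 | x.1 ∈ (U : Set (EuclideanSpace ℝ (Fin 4)))} :=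
    U.2.preimage continuous_fst
  have hpos : ∀ y ∈ closedBall y₀ R, ∀ η : (EuclideanSpace ℝ (Fin 4)) →L[ℝ] ℝ, η ≠ 0 → 0 <
      fderiv ℝ H (cf y, cjetOf bE 2 v y) ((0 : (ℝ × (ℝ × ((EuclideanSpace ℝ (Fin 4) →L[ℝ] EuclideanSpace ℝ (Fin 4) →L[ℝ] ℝ) × (((EuclideanSpace ℝ (Fin 4) →L[ℝ] ℝ) →L[ℝ] EuclideanSpace ℝ (Fin 4)) × ((EuclideanSpace ℝ (Fin 4) →L[ℝ] EuclideanSpace ℝ (Fin 4) →L[ℝ] EuclideanSpace ℝ (Fin 4)) × (EuclideanSpace ℝ (Fin 4) →L[ℝ] EuclideanSpace ℝ (Fin 4) →L[ℝ] ℝ))))))), Pi.single (Fin.last 2)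
        (fun I : Fin 2 → Fin 4 => η (bE (I 0)) * η (bE (I 1)))) := by
    intro y hy η hη
    have hy4 : y ∈ ball y₀ (ε / 4) := hRball hy
    have hyU : y ∈ (chartAt (EuclideanSpace ℝ (Fin 4)) c₀).target := hballU hy4
    have hloc : v =ᶠ[𝓝 y] wh := hvwh y hy4
    have hwhy : ContDiffAt ℝ 2 wh y := hwh2 y hyU
    set J₁ : CJet (Fin 4) 2 := cjetOf bE 2 v y with hJ₁
    set D : CJet (Fin 4) 2 :=
      Pi.single (Fin.last 2) (fun I : Fin 2 → Fin 4 => η (bE (I 0)) * η (bE (I 1))) with hD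
    set Jf : (EuclideanSpace ℝ (Fin 4)) × ℝ × CJet (Fin 4) 2 → ℝ := fun x ↦
      chartOperator G x.2.1 (W x.1) x.1 (pOf bE x.2.2) (rOf bE x.2.2) -
        Q x.1 * Real.exp (4 * x.2.2 0 Fin.elim0) with hJf
    -- (a) the partial derivative of `H` along `(0, D)` as a derivative along a line
    have hHd : DifferentiableAt ℝ H (cf y, J₁) :=
      (hH.differentiable (by simp)).differentiableAt
    have hl1 : HasDerivAt (fun s : ℝ => ((cf y, J₁ + s • D) : (ℝ × (ℝ × ((EuclideanSpace ℝ (Fin 4) →L[ℝ] EuclideanSpace ℝ (Fin 4) →L[ℝ] ℝ) × (((EuclideanSpace ℝ (Fin 4) →L[ℝ] ℝ) →L[ℝ] EuclideanSpace ℝ (Fin 4)) × ((EuclideanSpace ℝ (Fin 4) →L[ℝ] EuclideanSpace ℝ (Fin 4) →L[ℝ] EuclideanSpace ℝ (Fin 4)) × (EuclideanSpace ℝ (Fin 4) →L[ℝ] EuclideanSpace ℝ (Fin 4) →L[ℝ] ℝ)))))) × CJet (Fin 4) 2))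
        (((0 : (ℝ × (ℝ × ((EuclideanSpace ℝ (Fin 4) →L[ℝ] EuclideanSpace ℝ (Fin 4) →L[ℝ] ℝ) × (((EuclideanSpace ℝ (Fin 4) →L[ℝ] ℝ) →L[ℝ] EuclideanSpace ℝ (Fin 4)) × ((EuclideanSpace ℝ (Fin 4) →L[ℝ] EuclideanSpace ℝ (Fin 4) →L[ℝ] EuclideanSpace ℝ (Fin 4)) × (EuclideanSpace ℝ (Fin 4) →L[ℝ] EuclideanSpace ℝ (Fin 4) →L[ℝ] ℝ))))))), D) : (ℝ × (ℝ × ((EuclideanSpace ℝ (Fin 4) →L[ℝ] EuclideanSpace ℝ (Fin 4) →L[ℝ] ℝ) × (((EuclideanSpace ℝ (Fin 4) →L[ℝ] ℝ) →L[ℝ] EuclideanSpace ℝ (Fin 4)) × ((EuclideanSpace ℝ (Fin 4) →L[ℝ] EuclideanSpace ℝ (Fin 4) →L[ℝ] EuclideanSpace ℝ (Fin 4)) × (EuclideanSpace ℝ (Fin 4) →L[ℝ] EuclideanSpace ℝ (Fin 4) →L[ℝ] ℝ)))))) × CJet (Fin 4) 2) 0 := by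
      have h1 : HasDerivAt (fun s : ℝ => J₁ + s • D) D 0 := by
        simpa using ((hasDerivAt_id (0 : ℝ)).smul_const D).const_add J₁
      exact (hasDerivAt_const (0 : ℝ) (cf y)).prodMk h1
    have hd1 : HasDerivAt (fun s : ℝ => H (cf y, J₁ + s • D))
        (fderiv ℝ H (cf y, J₁) ((0 : (ℝ × (ℝ × ((EuclideanSpace ℝ (Fin 4) →L[ℝ] EuclideanSpace ℝ (Fin 4) →L[ℝ] ℝ) × (((EuclideanSpace ℝ (Fin 4) →L[ℝ] ℝ) →L[ℝ] EuclideanSpace ℝ (Fin 4)) × ((EuclideanSpace ℝ (Fin 4) →L[ℝ] EuclideanSpace ℝ (Fin 4) →L[ℝ] EuclideanSpace ℝ (Fin 4)) × (EuclideanSpace ℝ (Fin 4) →L[ℝ] EuclideanSpace ℝ (Fin 4) →L[ℝ] ℝ))))))), D)) 0 :=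
      hHd.hasFDerivAt.comp_hasDerivAt_of_eq (0 : ℝ) hl1 (by simp)
    -- (b) the same function through the jet function `Jf`
    set x₁ : (EuclideanSpace ℝ (Fin 4)) × ℝ × CJet (Fin 4) 2 := (y, t, -J₁) with hx₁
    set v₁ : (EuclideanSpace ℝ (Fin 4)) × ℝ × CJet (Fin 4) 2 := ((0 : (EuclideanSpace ℝ (Fin 4))), (0 : ℝ), -D) with hv₁
    have hlp := (isBoundedLinearMap_pOf bE).toIsLinearMap
    have hlr := (isBoundedLinearMap_rOf bE).toIsLinearMap
    have hline : ∀ s : ℝ, H (cf y, J₁ + s • D) = -Jf (x₁ + s • v₁) := by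
      intro s
      have h1 : x₁ + s • v₁ = (y, t, -(J₁ + s • D)) := by
        simp only [hx₁, hv₁, Prod.smul_mk, smul_zero, Prod.mk_add_mk, add_zero, smul_neg, neg_add]
      rw [h1, hslice, hJf]
      simp only [hlp.map_neg, hlr.map_neg, Pi.neg_apply]
      congr 2
      ring_nf
    have hJd : DifferentiableAt ℝ Jf x₁ :=
      ((contDiffOn_jetOperator bE hmet hW hQ).differentiableOn (by simp)).differentiableAt
        (hopen.mem_nhds hyU)
    have hl2 : HasDerivAt (fun s : ℝ => x₁ + s • v₁) v₁ 0 := by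
      simpa using ((hasDerivAt_id (0 : ℝ)).smul_const v₁).const_add x₁
    have hd2 : HasDerivAt (fun s : ℝ => -Jf (x₁ + s • v₁)) (-(fderiv ℝ Jf x₁ v₁)) 0 :=
      (hJd.hasFDerivAt.comp_hasDerivAt_of_eq (0 : ℝ) hl2 (by simp)).neg
    rw [funext hline] at hd1
    have hident : fderiv ℝ H (cf y, J₁) ((0 : (ℝ × (ℝ × ((EuclideanSpace ℝ (Fin 4) →L[ℝ] EuclideanSpace ℝ (Fin 4) →L[ℝ] ℝ) × (((EuclideanSpace ℝ (Fin 4) →L[ℝ] ℝ) →L[ℝ] EuclideanSpace ℝ (Fin 4)) × ((EuclideanSpace ℝ (Fin 4) →L[ℝ] EuclideanSpace ℝ (Fin 4) →L[ℝ] EuclideanSpace ℝ (Fin 4)) × (EuclideanSpace ℝ (Fin 4) →L[ℝ] EuclideanSpace ℝ (Fin 4) →L[ℝ] ℝ))))))), D) =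
        fderiv ℝ Jf x₁ (((0 : (EuclideanSpace ℝ (Fin 4))), (0 : ℝ), D) : (EuclideanSpace ℝ (Fin 4)) × ℝ × CJet (Fin 4) 2) := by
      rw [hd1.unique hd2, hv₁,
        show ((((0 : (EuclideanSpace ℝ (Fin 4))), (0 : ℝ), -D)) : (EuclideanSpace ℝ (Fin 4)) × ℝ × CJet (Fin 4) 2) = -((0 : (EuclideanSpace ℝ (Fin 4))), (0 : ℝ), D) by
          simp, map_neg, neg_neg]
    -- (c) the jet of `-wh` at `y`
    have hJneg : -J₁ = cjetOf bE 2 (fun z => -wh z) y := by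
      rw [hJ₁]
      funext k I
      rw [Pi.neg_apply, Pi.neg_apply, cjetOf_apply, cjetOf_apply,
        (hloc.iteratedFDeriv ℝ (k : ℕ)).eq_of_nhds]
      rw [show (fun z => -wh z) = -wh from rfl, iteratedFDeriv_neg_apply]
      rfl
    -- (d) the equation and admissibility for the pulled-back metric at `⟨y, hyU⟩`
    have hyU' : y ∈ (U : Set (EuclideanSpace ℝ (Fin 4))) := hyU
    have hwΦ : ContMDiffAt (𝓡 4) 𝓘(ℝ) 2 (w : M → ℝ) (Φ ⟨y, hyU'⟩) := hw2 _
    have hfun : (fun z : U ↦ -(fun z : U => -wh (z : (EuclideanSpace ℝ (Fin 4)))) z) = ((w : M → ℝ) ∘ Φ) := by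
      funext z
      simp only [neg_neg, Function.comp_apply, hwhdef, hΦdef]
    have heqU : backgroundPathOperator gU t (fun z : U ↦ -(fun z : U => -wh (z : (EuclideanSpace ℝ (Fin 4)))) z) ⟨y, hyU'⟩ =
        Q y * Real.exp (-4 * (-(fun z : U => -wh (z : (EuclideanSpace ℝ (Fin 4)))) ⟨y, hyU'⟩)) := by
      rw [hfun]
      refine (backgroundPathOperator_comap_of_contMDiffAt_two g hpb hΦ hΦ' hdim hg t ⟨y, hyU'⟩
        hwΦ).trans ?_
      rw [heq]
      simp only [neg_neg, hΦdef, hQdef, hwhdef]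
    have hposU : 0 < backgroundScalar gU (fun z : U ↦ -(fun z : U => -wh (z : (EuclideanSpace ℝ (Fin 4)))) z) ⟨y, hyU'⟩ := by
      rw [hfun]
      exact lt_of_lt_of_eq (hadm _)
        (backgroundScalar_comap_of_contMDiffAt_two g hpb hΦ hΦ' hdim hg ⟨y, hyU'⟩ hwΦ).symm
    have key := fderiv_jetOperator_single_pos_of_contDiffAt_two gU hG hgUR bE hW hQ
      (f := fun z : U => -wh (z : (EuclideanSpace ℝ (Fin 4)))) (F := fun z => -wh z) (fun _ => rfl) ht ⟨y, hyU'⟩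
      hwhy.neg (hq0 _) heqU hposU hη
    rw [hident, hx₁, hJneg]
    exact key
  /- (10) uniform ellipticity near the graph -/
  have hc_cont : ContinuousOn cf (closedBall y₀ R) := hcU.continuousOn.mono (hRball.trans hballU)
  have hjv_cont : ContinuousOn (cjetOf bE 2 v) (closedBall y₀ R) := by
    refine Continuous.continuousOn (continuous_pi fun k => continuous_pi fun I => ?_)
    have hk : ((k : ℕ) : WithTop ℕ∞) ≤ 2 := by exact_mod_cast Fin.is_le k
    exact (ContinuousMultilinearMap.apply ℝ (fun _ : Fin (k : ℕ) => (EuclideanSpace ℝ (Fin 4))) ℝ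
      (fun l => bE (I l))).continuous.comp (hvC2.continuous_iteratedFDeriv hk)
  obtain ⟨l, δ, hl, hδ, hEll⟩ := exists_ellipticity_nhds_graph_of_pos bE
    (hH.of_le (by exact_mod_cast le_top)) hc_cont hjv_cont hpos
  /- (11) the induction, for every order -/
  have hreg : ∀ m : ℕ, ContDiffOn ℝ (m + 3) v (Metric.ball y₀ (R / 2)) := fun m =>
    (hind bE hα0 hα1 m H hH cf v y₀ R hR (hc_data m).1 (hc_data m).2 hv_diff hv_data hEq
      ⟨l, δ, hl, hδ, hEll⟩ (R / 2) (by positivity) (by linarith)).1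
  have hvinf : ContDiffOn ℝ ∞ v (ball y₀ (R / 2)) := by
    refine contDiffOn_infty.2 fun n => ?_
    exact (hreg n).of_le (by exact_mod_cast Nat.le_add_right n 3)
  have hvAt : ContDiffAt ℝ ∞ v y₀ := hvinf.contDiffAt (ball_mem_nhds y₀ (by positivity))
  have hwhAt : ContDiffAt ℝ ∞ wh y₀ :=
    hvAt.congr_of_eventuallyEq (hvwh y₀ (mem_ball_self h4)).symm
  -- (12) back to the manifold
  have h1 : ContMDiffAt 𝓘(ℝ, (EuclideanSpace ℝ (Fin 4))) 𝓘(ℝ) ∞ wh y₀ := contMDiffAt_iff_contDiffAt.2 hwhAt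
  have h2 : ContMDiffAt (𝓡 4) (𝓡 4) ∞ (chartAt (EuclideanSpace ℝ (Fin 4)) c₀) x₀ :=
    (contMDiffOn_chart (I := 𝓡 4) (x := c₀)).contMDiffAt ((chartAt (EuclideanSpace ℝ (Fin 4)) c₀).open_source.mem_nhds hx₀)
  have h3 : ContMDiffAt (𝓡 4) 𝓘(ℝ) ∞ (wh ∘ chartAt (EuclideanSpace ℝ (Fin 4)) c₀) x₀ := h1.comp x₀ h2
  refine h3.congr_of_eventuallyEq ?_
  filter_upwards [(chartAt (EuclideanSpace ℝ (Fin 4)) c₀).open_source.mem_nhds hx₀] with x hx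
  show w x = w ((chartAt (EuclideanSpace ℝ (Fin 4)) c₀).symm (chartAt (EuclideanSpace ℝ (Fin 4)) c₀ x))
  rw [(chartAt (EuclideanSpace ℝ (Fin 4)) c₀).left_inv hx]

end Literature.Geometry.Riemannian.GurskyViaclovskyOpen

end Part7

/-!
## Part 8 — port of `Summits/SmoothPoincare4/SmoothPoincare4/Theorems/EntropyRungChangGurskyYangHelperRegularityInduction.lean` (1 declarations kept)

# The elliptic regularity induction `C^{2,α} ⇒ C^{m+3,α}` from its two steps

For a smooth structure function `H` on `P × CJet ι 2`, a coefficient map `c ∈ C^{m+1,α}(B(x₀, R); P)` and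
a solution `v ∈ C^{2,α}(B(x₀, R))` of `H(c(y), cjet₂ v(y)) = 0` that is uniformly elliptic near the graph
`(c, cjet₂ v)`, the solution is `C^{m+3,α}` with bounds on every smaller concentric ball (Gilbarg–Trudinger
2001, Lemma 17.16, regularity half). `helper_regularityInduction_of` proves the induction on `m` FROM its two
steps taken as hypotheses (the difference-quotient step `C^{2,α} ⇒ C^{3,α}` and the differentiation of the
equation along a basis direction, both proved in the following Parts): `m → m + 1` differentiates the
equation with the enlarged parameter space `P♯ = P × (CJet ι 2 × P)`
(`Literature/Analysis/PDE/EllipticDifferentiatedProblem.lean`) and reassembles `D^{m+4}v` from the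
`D^{m+3}∂_k v` (`Literature.Analysis.FunctionSpaces.holderData_succ_of_basis`).

References: D. Gilbarg, N. S. Trudinger (2001), Lemma 17.16 [GilbargTrudinger2001].
-/

section Part8

namespace Literature.Geometry.Riemannian.GurskyViaclovskyOpen

open _root_.Metric

/-- **Rind from R3gen and Rdiff: the elliptic regularity induction** (Gilbarg–Trudinger 2001,
Lemma 17.16, regularity half).  Assume (R3gen) the difference-quotient step — a `C^{2,α}`
solution `v` of `H(c(y), cjet₂ v(y)) = 0` on `B(x₀, R)` with `H` smooth, `c ∈ C^{1,α}` and
uniform ellipticity near the graph is `C^{3,α}` with bounds on every smaller concentric ball — and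
(Rdiff) that such an equation with `c ∈ C¹`, `v ∈ C³` differentiates along each basis direction
`e_k` to `DH(c(y), cjet₂ v(y))·(Dc(y) e_k, cjet₂ (∂_{e_k} v)(y)) = 0`.  Then for every `m`, every
finite-dimensional parameter space `P`, smooth `H : P × CJet ι 2 → ℝ`, `c ∈ C^{m+1,α}(B(x₀, R))`
with bounds and every `C^{2,α}` solution `v` with bounds, uniformly elliptic near the graph,
`v ∈ C^{m+3,α}(B(x₀, ρ))` with bounds for all `0 < ρ < R` (induction on `m` generalizing `P`:
the directional derivatives solve the differentiated equation, whose parameter space is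
`P × (CJet ι 2 × P)`). [cite: GilbargTrudinger2001, Lemma 17.16] -/
theorem helper_regularityInduction_of :
    (∀ {ι : Type} [Fintype ι] [DecidableEq ι] {E : Type} [NormedAddCommGroup E] [InnerProductSpace ℝ E]
      [FiniteDimensional ℝ E] [MeasurableSpace E] [BorelSpace E] [Nontrivial E]
      {P : Type} [NormedAddCommGroup P] [NormedSpace ℝ P] [FiniteDimensional ℝ P]
      (bE : OrthonormalBasis ι ℝ E) {α : NNReal}, 0 < α → α < 1 →
      ∀ (H : P × Literature.Analysis.Calculus.CJet ι 2 → ℝ),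
      ContDiff ℝ ((⊤ : ℕ∞) : WithTop ℕ∞) H →
      ∀ (c : E → P) (v : E → ℝ) (x₀ : E) (R : ℝ), 0 < R →
      ContDiffOn ℝ 1 c (Metric.ball x₀ R) →
      (∃ Bc : NNReal, (∀ y ∈ Metric.ball x₀ R, ∀ j ≤ 1, ‖iteratedFDeriv ℝ j c y‖ ≤ Bc) ∧
        HolderOnWith Bc α (iteratedFDeriv ℝ 1 c) (Metric.ball x₀ R)) →
      ContDiffOn ℝ 2 v (Metric.ball x₀ R) →
      (∃ Bv : NNReal, (∀ y ∈ Metric.ball x₀ R, ∀ j ≤ 2, ‖iteratedFDeriv ℝ j v y‖ ≤ Bv) ∧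
        HolderOnWith Bv α (iteratedFDeriv ℝ 2 v) (Metric.ball x₀ R)) →
      (∀ y ∈ Metric.ball x₀ R, H (c y, Literature.Analysis.Calculus.cjetOf bE 2 v y) = 0) →
      (∃ l δ : ℝ, 0 < l ∧ 0 < δ ∧ ∀ y ∈ Metric.ball x₀ R,
        ∀ (p' : P) (J' : Literature.Analysis.Calculus.CJet ι 2),
          ‖p' - c y‖ < δ → ‖J' - Literature.Analysis.Calculus.cjetOf bE 2 v y‖ < δ →
          ∀ η : E →L[ℝ] ℝ, l * ‖η‖ ^ 2 ≤
            fderiv ℝ H (p', J') ((0 : P), Pi.single (Fin.last 2)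
              (fun I : Fin 2 → ι => η (bE (I 0)) * η (bE (I 1))))) →
      ∀ ρ : ℝ, 0 < ρ → ρ < R →
        ContDiffOn ℝ 3 v (Metric.ball x₀ ρ) ∧
        ∃ B' : NNReal, (∀ y ∈ Metric.ball x₀ ρ, ∀ j ≤ 3, ‖iteratedFDeriv ℝ j v y‖ ≤ B') ∧
          HolderOnWith B' α (iteratedFDeriv ℝ 3 v) (Metric.ball x₀ ρ)) →
    (∀ {ι : Type} [Fintype ι] [DecidableEq ι] {E : Type} [NormedAddCommGroup E] [InnerProductSpace ℝ E]
      [FiniteDimensional ℝ E] {P : Type} [NormedAddCommGroup P] [NormedSpace ℝ P]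
      (bE : OrthonormalBasis ι ℝ E) (H : P × Literature.Analysis.Calculus.CJet ι 2 → ℝ),
      ContDiff ℝ 1 H →
      ∀ (c : E → P) (v : E → ℝ) (U : Set E), IsOpen U → ContDiffOn ℝ 1 c U → ContDiffOn ℝ 3 v U →
      (∀ y ∈ U, H (c y, Literature.Analysis.Calculus.cjetOf bE 2 v y) = 0) →
      ∀ (k : ι), ∀ y ∈ U,
        fderiv ℝ H (c y, Literature.Analysis.Calculus.cjetOf bE 2 v y)
          (fderiv ℝ c y (bE k),
            Literature.Analysis.Calculus.cjetOf bE 2 (fun z => fderiv ℝ v z (bE k)) y) = 0) →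
    ∀ {ι : Type} [Fintype ι] [DecidableEq ι] {E : Type} [NormedAddCommGroup E] [InnerProductSpace ℝ E]
      [FiniteDimensional ℝ E] [MeasurableSpace E] [BorelSpace E] [Nontrivial E]
      (bE : OrthonormalBasis ι ℝ E) {α : NNReal}, 0 < α → α < 1 → ∀ (m : ℕ)
      {P : Type} [NormedAddCommGroup P] [NormedSpace ℝ P] [FiniteDimensional ℝ P]
      (H : P × Literature.Analysis.Calculus.CJet ι 2 → ℝ),
      ContDiff ℝ ((⊤ : ℕ∞) : WithTop ℕ∞) H →
      ∀ (c : E → P) (v : E → ℝ) (x₀ : E) (R : ℝ), 0 < R →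
      ContDiffOn ℝ (m + 1) c (Metric.ball x₀ R) →
      (∃ Bc : NNReal, (∀ y ∈ Metric.ball x₀ R, ∀ j ≤ m + 1, ‖iteratedFDeriv ℝ j c y‖ ≤ Bc) ∧
        HolderOnWith Bc α (iteratedFDeriv ℝ (m + 1) c) (Metric.ball x₀ R)) →
      ContDiffOn ℝ 2 v (Metric.ball x₀ R) →
      (∃ Bv : NNReal, (∀ y ∈ Metric.ball x₀ R, ∀ j ≤ 2, ‖iteratedFDeriv ℝ j v y‖ ≤ Bv) ∧
        HolderOnWith Bv α (iteratedFDeriv ℝ 2 v) (Metric.ball x₀ R)) →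
      (∀ y ∈ Metric.ball x₀ R, H (c y, Literature.Analysis.Calculus.cjetOf bE 2 v y) = 0) →
      (∃ l δ : ℝ, 0 < l ∧ 0 < δ ∧ ∀ y ∈ Metric.ball x₀ R,
        ∀ (p' : P) (J' : Literature.Analysis.Calculus.CJet ι 2),
          ‖p' - c y‖ < δ → ‖J' - Literature.Analysis.Calculus.cjetOf bE 2 v y‖ < δ →
          ∀ η : E →L[ℝ] ℝ, l * ‖η‖ ^ 2 ≤
            fderiv ℝ H (p', J') ((0 : P), Pi.single (Fin.last 2)
              (fun I : Fin 2 → ι => η (bE (I 0)) * η (bE (I 1))))) →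
      ∀ ρ : ℝ, 0 < ρ → ρ < R →
        ContDiffOn ℝ (m + 3) v (Metric.ball x₀ ρ) ∧
        ∃ B' : NNReal, (∀ y ∈ Metric.ball x₀ ρ, ∀ j ≤ m + 3, ‖iteratedFDeriv ℝ j v y‖ ≤ B') ∧
          HolderOnWith B' α (iteratedFDeriv ℝ (m + 3) v) (Metric.ball x₀ ρ) := by
  intro hR3 hRd ι _ _ E _ _ _ _ _ _ bE α hα0 hα1 m
  induction m with
  | zero =>
      intro P _ _ _ H hH c v x₀ R hR hc hcB hv hvB heq hell ρ hρ hρR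
      simp only [Nat.cast_zero, zero_add] at hc hcB ⊢
      exact hR3 bE hα0 hα1 H hH c v x₀ R hR hc hcB hv hvB heq hell ρ hρ hρR
  | succ m ih =>
      intro P _ _ _ H hH c v x₀ R hR hc hcB hv hvB heq hell ρ hρ hρR
      -- casts: `C^{(m+1)+1} = C^{m+2}`, `C^{(m+1)+3} = C^{(m+3)+1}`
      have hc2 : ContDiffOn ℝ (m + 2 : ℕ) c (ball x₀ R) := by
        have h : ((m + 2 : ℕ) : WithTop ℕ∞) = (m + 1 : ℕ) + 1 := by push_cast; ring
        rw [h]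
        exact hc
      have hcB2 : ∃ Bc : NNReal, (∀ y ∈ ball x₀ R, ∀ j ≤ m + 2, ‖iteratedFDeriv ℝ j c y‖ ≤ Bc) ∧
          HolderOnWith Bc α (iteratedFDeriv ℝ (m + 2) c) (ball x₀ R) := hcB
      -- the intermediate radius
      obtain ⟨ρ₁, hρρ₁, hρ₁R⟩ := exists_between hρR
      have hρ₁0 : 0 < ρ₁ := hρ.trans hρρ₁
      have hsub₁ : ball x₀ ρ₁ ⊆ ball x₀ R := ball_subset_ball hρ₁R.le
      have hsubρ : ball x₀ ρ ⊆ ball x₀ ρ₁ := ball_subset_ball hρρ₁.le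
      -- Step 1: the induction hypothesis for `(P, H, c, v)` on `B(x₀, ρ₁)`
      have hcLow := Literature.Analysis.FunctionSpaces.holderBallData_of_le (n := m + 1)
        (N := m + 2) (by omega) hα1.le hc2 hcB2
      have h1 := ih H hH c v x₀ R hR (by exact_mod_cast hcLow.1) hcLow.2 hv hvB heq hell ρ₁
        hρ₁0 hρ₁R
      have h1c : ContDiffOn ℝ (m + 3 : ℕ) v (ball x₀ ρ₁) := by exact_mod_cast h1.1
      -- Steps 2–5: each directional derivative is `C^{m+3,α}` on `B(x₀, ρ)`
      have hk : ∀ k : ι, ContDiffOn ℝ (m + 3 : ℕ) (fun z => fderiv ℝ v z (bE k)) (ball x₀ ρ) ∧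
          ∃ B : NNReal, (∀ y ∈ ball x₀ ρ, ∀ j ≤ m + 3,
            ‖iteratedFDeriv ℝ j (fun z => fderiv ℝ v z (bE k)) y‖ ≤ B) ∧
          HolderOnWith B α (iteratedFDeriv ℝ (m + 3) (fun z => fderiv ℝ v z (bE k)))
            (ball x₀ ρ) := by
        intro k
        -- the new unknown `v_k ∈ C^{2,α}(B(x₀, ρ₁))`
        have h2 := Literature.Analysis.PDE.holderData_fderiv_apply_basis_two bE hα1.le h1c
          h1.2 k
        -- the differentiated equation on `B(x₀, ρ₁)`
        have h3 : ∀ y ∈ ball x₀ ρ₁,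
            (fun q : (P × (Literature.Analysis.Calculus.CJet ι 2 × P)) ×
                Literature.Analysis.Calculus.CJet ι 2 =>
              fderiv ℝ H (q.1.1, q.1.2.1) (q.1.2.2, q.2))
              ((c y, Literature.Analysis.Calculus.cjetOf bE 2 v y, fderiv ℝ c y (bE k)),
                Literature.Analysis.Calculus.cjetOf bE 2 (fun z => fderiv ℝ v z (bE k)) y) = 0 :=
          hRd bE H (hH.of_le (by exact_mod_cast (le_top : (1 : ℕ∞) ≤ ⊤))) c v (ball x₀ ρ₁)
            isOpen_ball
            ((hc2.mono hsub₁).of_le (by norm_cast; omega))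
            (h1c.of_le (by norm_cast; omega)) (fun y hy => heq y (hsub₁ hy)) k
        -- the new coefficients `c♯ ∈ C^{m+1,α}(B(x₀, ρ₁))`
        have h4 := Literature.Analysis.PDE.holderData_linearisedCoeff bE hρ₁R.le hα1.le hc2 hcB2
          h1c h1.2 k
        -- ellipticity near the new graph
        obtain ⟨l, δ, hl, hδ, hell'⟩ := hell
        have h5 := Literature.Analysis.PDE.linearisedStructure_elliptic_near bE hH
          (fun y hy => hell' y (hsub₁ hy)) (fun y => fderiv ℝ c y (bE k))
          (Literature.Analysis.Calculus.cjetOf bE 2 (fun z => fderiv ℝ v z (bE k)))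
        -- the induction hypothesis for the differentiated problem
        have h6 := ih (P := P × (Literature.Analysis.Calculus.CJet ι 2 × P))
          (fun q => fderiv ℝ H (q.1.1, q.1.2.1) (q.1.2.2, q.2))
          (Literature.Analysis.PDE.contDiff_linearisedStructure hH)
          (fun y => (c y, Literature.Analysis.Calculus.cjetOf bE 2 v y, fderiv ℝ c y (bE k)))
          (fun z => fderiv ℝ v z (bE k)) x₀ ρ₁ hρ₁0 (by exact_mod_cast h4.1) h4.2 h2.1 h2.2 h3
          ⟨l, δ, hl, hδ, h5⟩ ρ hρ hρρ₁
        exact ⟨by exact_mod_cast h6.1, h6.2⟩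
      -- Step 6: reassemble `D^{m+4}v` on `B(x₀, ρ)`
      have h1ρ : ContDiffOn ℝ (m + 3 : ℕ) v (ball x₀ ρ) ∧ ∃ B : NNReal,
          (∀ y ∈ ball x₀ ρ, ∀ j ≤ m + 3, ‖iteratedFDeriv ℝ j v y‖ ≤ B) ∧
          HolderOnWith B α (iteratedFDeriv ℝ (m + 3) v) (ball x₀ ρ) := by
        obtain ⟨B, hB, hHo⟩ := h1.2
        exact ⟨h1c.mono hsubρ, B, fun y hy j hj => hB y (hsubρ hy) j hj, hHo.mono hsubρ⟩
      have h7 := Literature.Analysis.FunctionSpaces.holderData_succ_of_basis bE isOpen_ball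
        (n := m + 3) (by omega) h1ρ hk
      have hcast : ((m + 1 : ℕ) : WithTop ℕ∞) + 3 = ((m + 3 + 1 : ℕ) : WithTop ℕ∞) := by
        push_cast
        ring
      rw [hcast]
      exact h7

end Literature.Geometry.Riemannian.GurskyViaclovskyOpen

end Part8

/-!
## Part 9 — port of `Summits/SmoothPoincare4/SmoothPoincare4/Theorems/EntropyRungChangGurskyYangHelperDifferentiateEquation.lean` (1 declarations kept)

# Differentiating the jet equation once along a basis direction

Written in a chart as a jet equation `H(c(y), J²v(y)) = 0` with a `C¹` coefficient map `c` and a `C³`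
solution `v`, the directional derivative `∂_{e_k} v` solves the linearised equation
`DH(c(y), J²v(y)) · (Dc(y) e_k, J²(∂_{e_k} v)(y)) = 0` (`helper_differentiateEquation`; the specialisation
`m = 2` of `Literature.Analysis.Calculus.fderiv_apply_eq_zero_of_comp_prod_cjetOf`,
`CoordinateJetsDirectional.lean`).

References: D. Gilbarg, N. S. Trudinger (2001), §17.4 and Lemma 17.16 [GilbargTrudinger2001].
-/

section Part9

namespace Literature.Geometry.Riemannian.GurskyViaclovskyOpen

/-- **Rdiff: differentiating the equation once along a basis direction.** If
`H(c(y), J²v(y)) = 0` on an open set `U`, with `H` of class `C¹`, `c` of class `C¹` and `v` of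
class `C³` on `U`, then for every basis direction `e_k` and every `y ∈ U`,
`DH(c(y), J²v(y)) · (Dc(y) e_k, J²(∂_{e_k} v)(y)) = 0` (Gilbarg–Trudinger 2001, §17.4; the
tree's `Literature.Analysis.Calculus.fderiv_apply_eq_zero_of_comp_prod_cjetOf` with `m = 2`).
[cite: GilbargTrudinger2001, §17.4, Lemma 17.16] -/
theorem helper_differentiateEquation :
    ∀ {ι : Type} [Fintype ι] [DecidableEq ι] {E : Type} [NormedAddCommGroup E] [InnerProductSpace ℝ E]
      [FiniteDimensional ℝ E] {P : Type} [NormedAddCommGroup P] [NormedSpace ℝ P]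
      (bE : OrthonormalBasis ι ℝ E) (H : P × Literature.Analysis.Calculus.CJet ι 2 → ℝ),
      ContDiff ℝ 1 H →
      ∀ (c : E → P) (v : E → ℝ) (U : Set E), IsOpen U → ContDiffOn ℝ 1 c U → ContDiffOn ℝ 3 v U →
      (∀ y ∈ U, H (c y, Literature.Analysis.Calculus.cjetOf bE 2 v y) = 0) →
      ∀ (k : ι), ∀ y ∈ U,
        fderiv ℝ H (c y, Literature.Analysis.Calculus.cjetOf bE 2 v y)
          (fderiv ℝ c y (bE k),
            Literature.Analysis.Calculus.cjetOf bE 2 (fun z => fderiv ℝ v z (bE k)) y) = 0 := by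
  intro ι _ _ E _ _ _ P _ _ bE H hH c v U hU hc hv h0 k y hy
  have hv' : ContDiffOn ℝ ((2 + 1 : ℕ) : WithTop ℕ∞) v U := hv
  exact Literature.Analysis.Calculus.fderiv_apply_eq_zero_of_comp_prod_cjetOf bE hU
    (fun z _ => (hH.differentiable one_ne_zero).differentiableAt)
    (hc.differentiableOn one_ne_zero) hv' h0 k y hy

end Literature.Geometry.Riemannian.GurskyViaclovskyOpen

end Part9

/-!
## Part 10 — port of `Summits/SmoothPoincare4/SmoothPoincare4/Theorems/EntropyRungChangGurskyYangHelperDqRegularityStep.lean` (1 declarations kept)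

# The difference-quotient regularity step `C^{2,α} ⇒ C^{3,α}`

For a fully nonlinear uniformly elliptic equation `H(c(y), J²v(y)) = 0` with smooth structure `H`,
coefficients `c ∈ C^{1,α}` and a `C^{2,α}` solution `v` on a ball `B(x₀, R)`, uniformly elliptic on rank-one
top-slot jets near the graph, the solution is `C^{3,α}` on every smaller ball, with bounds
(`helper_dqRegularityStep`; the specialisation of
`Literature.Analysis.PDE.contDiffOn_three_and_bounds_of_holderTwo_solution`,
`Literature/Analysis/PDE/DifferenceQuotientRegularity.lean`).

References: D. Gilbarg, N. S. Trudinger (2001), Lemma 17.16 and Cor. 6.3 [GilbargTrudinger2001].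
-/

section Part10

namespace Literature.Geometry.Riemannian.GurskyViaclovskyOpen

/-- **R3gen: the difference-quotient regularity step `C^{2,α} ⇒ C^{3,α}`** for a fully
nonlinear uniformly elliptic equation `H(c(y), J²v(y)) = 0` with smooth structure `H`,
coefficients `c ∈ C^{1,α}` and a `C^{2,α}` solution `v` on `B(x₀, R)`: for every `0 < ρ < R`,
`v ∈ C³(B(x₀, ρ))` with bounds `‖Dʲv‖ ≤ B'` (`j ≤ 3`) and `[D³v]_α ≤ B'`
(Gilbarg–Trudinger 2001, Lemma 17.16; the tree's
`Literature.Analysis.PDE.contDiffOn_three_and_bounds_of_holderTwo_solution`).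
[cite: GilbargTrudinger2001, Lemma 17.16] -/
theorem helper_dqRegularityStep :
    ∀ {ι : Type} [Fintype ι] [DecidableEq ι] {E : Type} [NormedAddCommGroup E] [InnerProductSpace ℝ E]
      [FiniteDimensional ℝ E] [MeasurableSpace E] [BorelSpace E] [Nontrivial E]
      {P : Type} [NormedAddCommGroup P] [NormedSpace ℝ P] [FiniteDimensional ℝ P]
      (bE : OrthonormalBasis ι ℝ E) {α : NNReal}, 0 < α → α < 1 →
      ∀ (H : P × Literature.Analysis.Calculus.CJet ι 2 → ℝ),
      ContDiff ℝ ((⊤ : ℕ∞) : WithTop ℕ∞) H →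
      ∀ (c : E → P) (v : E → ℝ) (x₀ : E) (R : ℝ), 0 < R →
      ContDiffOn ℝ 1 c (Metric.ball x₀ R) →
      (∃ Bc : NNReal, (∀ y ∈ Metric.ball x₀ R, ∀ j ≤ 1, ‖iteratedFDeriv ℝ j c y‖ ≤ Bc) ∧
        HolderOnWith Bc α (iteratedFDeriv ℝ 1 c) (Metric.ball x₀ R)) →
      ContDiffOn ℝ 2 v (Metric.ball x₀ R) →
      (∃ Bv : NNReal, (∀ y ∈ Metric.ball x₀ R, ∀ j ≤ 2, ‖iteratedFDeriv ℝ j v y‖ ≤ Bv) ∧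
        HolderOnWith Bv α (iteratedFDeriv ℝ 2 v) (Metric.ball x₀ R)) →
      (∀ y ∈ Metric.ball x₀ R, H (c y, Literature.Analysis.Calculus.cjetOf bE 2 v y) = 0) →
      (∃ l δ : ℝ, 0 < l ∧ 0 < δ ∧ ∀ y ∈ Metric.ball x₀ R,
        ∀ (p' : P) (J' : Literature.Analysis.Calculus.CJet ι 2),
          ‖p' - c y‖ < δ → ‖J' - Literature.Analysis.Calculus.cjetOf bE 2 v y‖ < δ →
          ∀ η : E →L[ℝ] ℝ, l * ‖η‖ ^ 2 ≤
            fderiv ℝ H (p', J') ((0 : P), Pi.single (Fin.last 2)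
              (fun I : Fin 2 → ι => η (bE (I 0)) * η (bE (I 1))))) →
      ∀ ρ : ℝ, 0 < ρ → ρ < R →
        ContDiffOn ℝ 3 v (Metric.ball x₀ ρ) ∧
        ∃ B' : NNReal, (∀ y ∈ Metric.ball x₀ ρ, ∀ j ≤ 3, ‖iteratedFDeriv ℝ j v y‖ ≤ B') ∧
          HolderOnWith B' α (iteratedFDeriv ℝ 3 v) (Metric.ball x₀ ρ) := by
  intro ι _ _ E _ _ _ _ _ _ P _ _ _ bE α hα hα1 H hH c v x₀ R _hR hc hcB hv hvB heq hell ρ hρ hρR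
  obtain ⟨Bc, hBc, hHc⟩ := hcB
  obtain ⟨Bv, hBv, hHv⟩ := hvB
  obtain ⟨l, δ, hl, hδ, hell⟩ := hell
  exact Literature.Analysis.PDE.contDiffOn_three_and_bounds_of_holderTwo_solution bE hα hα1 hH
    hc hBc hHc hv hBv hHv heq hl hδ hell hρ hρR

end Literature.Geometry.Riemannian.GurskyViaclovskyOpen

end Part10

/-!
## Part 11 — port of `Summits/SmoothPoincare4/SmoothPoincare4/Theorems/EntropyRungChangGurskyYangHelperRegularityInductionHolds.lean` (1 declarations kept)

# The elliptic regularity induction `C^{2,α} ⇒ C^{m+3,α}`, unconditionally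

`helper_regularityInduction`: the regularity induction for `C^{2,α}` solutions of `H(c(y), cjet₂ v(y)) = 0`
with `H` smooth, `c ∈ C^{m+1,α}` and uniform ellipticity near the graph (Gilbarg–Trudinger 2001, Lemma 17.16,
regularity half), obtained by feeding the two steps `helper_dqRegularityStep` and
`helper_differentiateEquation` into the conditional form `helper_regularityInduction_of`.

References: D. Gilbarg, N. S. Trudinger (2001), Lemma 17.16 [GilbargTrudinger2001].
-/

section Part11

namespace Literature.Geometry.Riemannian.GurskyViaclovskyOpen

/-- **Rind: the elliptic regularity induction** (Gilbarg–Trudinger 2001, Lemma 17.16, regularity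
half): for every `m`, every finite-dimensional parameter space `P`, smooth
`H : P × CJet ι 2 → ℝ`, `c ∈ C^{m+1,α}(B(x₀, R))` with bounds and every `C^{2,α}` solution `v`
of `H(c(y), cjet₂ v(y)) = 0` on `B(x₀, R)` with bounds, uniformly elliptic near the graph
`(c, cjet₂ v)`, the solution is `C^{m+3,α}` with bounds on `B(x₀, ρ)` for all `0 < ρ < R`
(`helper_regularityInduction_of` applied to `helper_dqRegularityStep` and
`helper_differentiateEquation`). [cite: GilbargTrudinger2001, Lemma 17.16] -/
theorem helper_regularityInduction :
    ∀ {ι : Type} [Fintype ι] [DecidableEq ι] {E : Type} [NormedAddCommGroup E] [InnerProductSpace ℝ E]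
      [FiniteDimensional ℝ E] [MeasurableSpace E] [BorelSpace E] [Nontrivial E]
      (bE : OrthonormalBasis ι ℝ E) {α : NNReal}, 0 < α → α < 1 → ∀ (m : ℕ)
      {P : Type} [NormedAddCommGroup P] [NormedSpace ℝ P] [FiniteDimensional ℝ P]
      (H : P × Literature.Analysis.Calculus.CJet ι 2 → ℝ),
      ContDiff ℝ ((⊤ : ℕ∞) : WithTop ℕ∞) H →
      ∀ (c : E → P) (v : E → ℝ) (x₀ : E) (R : ℝ), 0 < R →
      ContDiffOn ℝ (m + 1) c (Metric.ball x₀ R) →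
      (∃ Bc : NNReal, (∀ y ∈ Metric.ball x₀ R, ∀ j ≤ m + 1, ‖iteratedFDeriv ℝ j c y‖ ≤ Bc) ∧
        HolderOnWith Bc α (iteratedFDeriv ℝ (m + 1) c) (Metric.ball x₀ R)) →
      ContDiffOn ℝ 2 v (Metric.ball x₀ R) →
      (∃ Bv : NNReal, (∀ y ∈ Metric.ball x₀ R, ∀ j ≤ 2, ‖iteratedFDeriv ℝ j v y‖ ≤ Bv) ∧
        HolderOnWith Bv α (iteratedFDeriv ℝ 2 v) (Metric.ball x₀ R)) →
      (∀ y ∈ Metric.ball x₀ R, H (c y, Literature.Analysis.Calculus.cjetOf bE 2 v y) = 0) →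
      (∃ l δ : ℝ, 0 < l ∧ 0 < δ ∧ ∀ y ∈ Metric.ball x₀ R,
        ∀ (p' : P) (J' : Literature.Analysis.Calculus.CJet ι 2),
          ‖p' - c y‖ < δ → ‖J' - Literature.Analysis.Calculus.cjetOf bE 2 v y‖ < δ →
          ∀ η : E →L[ℝ] ℝ, l * ‖η‖ ^ 2 ≤
            fderiv ℝ H (p', J') ((0 : P), Pi.single (Fin.last 2)
              (fun I : Fin 2 → ι => η (bE (I 0)) * η (bE (I 1))))) →
      ∀ ρ : ℝ, 0 < ρ → ρ < R →
        ContDiffOn ℝ (m + 3) v (Metric.ball x₀ ρ) ∧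
        ∃ B' : NNReal, (∀ y ∈ Metric.ball x₀ ρ, ∀ j ≤ m + 3, ‖iteratedFDeriv ℝ j v y‖ ≤ B') ∧
          HolderOnWith B' α (iteratedFDeriv ℝ (m + 3) v) (Metric.ball x₀ ρ) :=
  helper_regularityInduction_of helper_dqRegularityStep helper_differentiateEquation

end Literature.Geometry.Riemannian.GurskyViaclovskyOpen

end Part11

/-!
## Part 12 — port of `Summits/SmoothPoincare4/SmoothPoincare4/Theorems/EntropyRungChangGurskyYangStubBackgroundScalarTendsto.lean` (6 declarations kept)

# Admissibility persists along a `C^{2,α}_𝔄`-continuous family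

In the openness step of Gursky–Viaclovsky 2003, §5 ("`A^t_{u_t} ∈ Γ₂⁺` for `t` near `t₀`") the implicit
function theorem gives a family `t ↦ ψ_t` in `X = C^{2,α}_𝔄(M)`, continuous at `t₀`; then
`backgroundScalar g (ψ t) = R_g − 6Δ_g(ψ t) − 6|d(ψ t)|²_g → backgroundScalar g (ψ t₀)` UNIFORMLY on `M`
(`stub_backgroundScalarTendsto`). Chartwise (Gilbarg–Trudinger §6.1; the chart pieces of `w ∈ X` have
`‖Dʲpᵢ‖_∞ ≤ ‖w‖_X`, `j ≤ 2`): `sup_M |Δ_g w| ≤ C‖w‖_X` (`exists_bound_dalembertian`, from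
`dalembertian_eq_sum_piece`), `sup_M |g⁻¹(du, dv)| ≤ C‖u‖_X‖v‖_X` (`exists_bound_innerDual`, via
`innerDual_mvfderiv_eq_sum_localFrame` and `norm_fderiv_comp_symm_le`), whence
`sup_M |backgroundScalar g u − backgroundScalar g v| ≤ K(‖u − v‖ + ‖v‖‖u − v‖ + ‖u − v‖²) → 0`.

References: M. J. Gursky, J. A. Viaclovsky, J. Differential Geom. 63 (2003), §5 [GurskyViaclovsky2003];
D. Gilbarg, N. S. Trudinger (2001), §6.1 [GilbargTrudinger2001].
-/

section Part12

open _root_.Set _root_.Function _root_.Filter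
open scoped _root_.Manifold _root_.ContDiff _root_.Topology _root_.NNReal
open Literature.Analysis.FunctionSpaces Literature.Geometry.Riemannian
  Literature.Geometry.Riemannian.GurskyViaclovskyPath Literature.Geometry.Lorentzian
  Literature.Geometry.Lorentzian.PseudoRiemannianMetric

namespace Literature.Geometry.Riemannian.GurskyViaclovskyOpen

namespace BackgroundScalarTendsto

/-- **Finitely many coefficient functions continuous on a chart target are uniformly bounded on the
compact set `chartᵢ(tsupport ρᵢ)`** (which lies in the target, `isCompact_image_tsupport`). [cite: GurskyViaclovsky2003, §5 (admissibility persists along the implicit-function family); GilbargTrudinger2001, §6.1] -/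
theorem exists_forall_norm_le_of_continuousOn {ι : Type*} {E : Type*} [NormedAddCommGroup E]
    [NormedSpace ℝ E] {M : Type*} [TopologicalSpace M] [ChartedSpace E M] [CompactSpace M]
    (𝔄 : HolderChartData ι E M) (i : ι) {β : Type*} [Fintype β] (f : β → E → ℝ)
    (hf : ∀ b, ContinuousOn (f b) (𝔄.chart i).target) :
    ∃ C : ℝ, 0 ≤ C ∧ ∀ y ∈ 𝔄.chart i '' tsupport (𝔄.ρ i), ∀ b, ‖f b y‖ ≤ C := by
  obtain ⟨hKc, hKt⟩ := 𝔄.isCompact_image_tsupport i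
  have hc : ContinuousOn (fun y => ∑ b, ‖f b y‖) (𝔄.chart i).target :=
    continuousOn_finsetSum _ fun b _ => (hf b).norm
  obtain ⟨C, hC⟩ := hKc.exists_bound_of_continuousOn (hc.mono hKt)
  refine ⟨max C 0, le_max_right _ _, fun y hy b => ?_⟩
  have h := hC y hy
  rw [Real.norm_of_nonneg (Finset.sum_nonneg fun b _ => norm_nonneg _)] at h
  exact ((Finset.single_le_sum (f := fun b => ‖f b y‖) (fun b _ => norm_nonneg _)
    (Finset.mem_univ b)).trans h).trans (le_max_left _ _)

/-- **First chart derivatives are controlled by the `C^{k,r}_𝔄` norm (`k ≥ 1`)**: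
`‖D(w ∘ chartᵢ⁻¹)(chartᵢ x)‖ ≤ C‖w‖` for `w ∈ C^{k,r}_𝔄(M, F)`, all `i` and `x ∈ tsupport ρᵢ`. Near
`chartᵢ x`, `w ∘ chartᵢ⁻¹ = Σⱼ pⱼ ∘ (chartⱼ ∘ chartᵢ⁻¹)` over the `j` with `x ∈ tsupport ρⱼ` (chart pieces
`pⱼ`, `‖Dpⱼ‖_∞ ≤ ‖w‖`; the other summands vanish near `chartᵢ x`), and the derivatives of the smooth
transition maps are bounded on the compact sets `chartᵢ(tsupport ρᵢ ∩ tsupport ρⱼ)`. [cite: GurskyViaclovsky2003, §5 (admissibility persists along the implicit-function family); GilbargTrudinger2001, §6.1] -/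
theorem norm_fderiv_comp_symm_le {ι : Type*} [Fintype ι] {E : Type*} [NormedAddCommGroup E]
    [NormedSpace ℝ E] {M : Type*} [TopologicalSpace M] [ChartedSpace E M]
    [IsManifold 𝓘(ℝ, E) ∞ M] [CompactSpace M] (𝔄 : HolderChartData ι E M)
    {F : Type*} [NormedAddCommGroup F] [NormedSpace ℝ F] {k : ℕ} {r : ℝ≥0} (hk : k ≠ 0) :
    ∃ C : ℝ, 0 ≤ C ∧ ∀ (w : HolderManifoldFunction 𝔄 F k r) (i : ι) (x : M),
      x ∈ tsupport (𝔄.ρ i) →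
        ‖fderiv ℝ ((w : M → F) ∘ (𝔄.chart i).symm) (𝔄.chart i x)‖ ≤ C * ‖w‖ := by
  -- uniform bounds for the first derivatives of the transition maps on the compact overlaps
  have hT : ∀ i j : ι, ∃ T : ℝ, 0 ≤ T ∧ ∀ x ∈ tsupport (𝔄.ρ i) ∩ tsupport (𝔄.ρ j),
      ‖fderiv ℝ (𝔄.chart j ∘ (𝔄.chart i).symm) (𝔄.chart i x)‖ ≤ T := by
    intro i j
    have hKc : IsCompact (𝔄.chart i '' (tsupport (𝔄.ρ i) ∩ tsupport (𝔄.ρ j))) :=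
      (((isClosed_tsupport _).inter (isClosed_tsupport _)).isCompact).image_of_continuousOn
        ((𝔄.chart i).continuousOn.mono (inter_subset_left.trans (𝔄.isSubordinate i)))
    have hKU : 𝔄.chart i '' (tsupport (𝔄.ρ i) ∩ tsupport (𝔄.ρ j)) ⊆ 𝔄.transDomain i j := by
      rintro _ ⟨x, hx, rfl⟩
      refine ⟨(𝔄.chart i).map_source (𝔄.isSubordinate i hx.1), ?_⟩
      rw [mem_preimage, (𝔄.chart i).left_inv (𝔄.isSubordinate i hx.1)]
      exact 𝔄.isSubordinate j hx.2
    have hcont : ContinuousOn (fderiv ℝ (𝔄.chart j ∘ (𝔄.chart i).symm)) (𝔄.transDomain i j) :=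
      (𝔄.contDiffOn_trans i j).continuousOn_fderiv_of_isOpen (𝔄.isOpen_transDomain i j)
        (by exact_mod_cast le_top)
    obtain ⟨T, hT⟩ := hKc.exists_bound_of_continuousOn (hcont.mono hKU)
    exact ⟨max T 0, le_max_right _ _, fun x hx =>
      (hT _ (mem_image_of_mem _ hx)).trans (le_max_left _ _)⟩
  choose T hT0 hT using hT
  refine ⟨∑ i, ∑ j, T i j, Finset.sum_nonneg fun i _ => Finset.sum_nonneg fun j _ => hT0 i j, ?_⟩
  intro w i x hxi
  have hyt : 𝔄.chart i x ∈ (𝔄.chart i).target := (𝔄.chart i).map_source (𝔄.isSubordinate i hxi)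
  have hback : ∀ s : Set M, x ∈ s → 𝔄.chart i x ∈ (𝔄.chart i).symm ⁻¹' s := fun s hs => by
    rw [mem_preimage, (𝔄.chart i).left_inv (𝔄.isSubordinate i hxi)]
    exact hs
  -- each summand `z ↦ ρ_j (chart_i⁻¹ z) • w (chart_i⁻¹ z)` has a derivative of norm `≤ ‖w‖ T i j`
  have hsummand : ∀ j, ∃ D : E →L[ℝ] F,
      HasFDerivAt (fun z => 𝔄.ρ j ((𝔄.chart i).symm z) • w ((𝔄.chart i).symm z)) D
        (𝔄.chart i x) ∧ ‖D‖ ≤ ‖w‖ * T i j := by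
    intro j
    by_cases hxj : x ∈ tsupport (𝔄.ρ j)
    · have hyU : 𝔄.chart i x ∈ 𝔄.transDomain i j := ⟨hyt, hback _ (𝔄.isSubordinate j hxj)⟩
      have hev : (fun z => 𝔄.ρ j ((𝔄.chart i).symm z) • w ((𝔄.chart i).symm z))
          =ᶠ[𝓝 (𝔄.chart i x)] 𝔄.piece (w : M → F) j ∘ (𝔄.chart j ∘ (𝔄.chart i).symm) := by
        filter_upwards [(𝔄.isOpen_transDomain i j).mem_nhds hyU] with z hz
        exact 𝔄.smul_apply_eq_piece (w : M → F) hz.2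
      have hτ : DifferentiableAt ℝ (𝔄.chart j ∘ (𝔄.chart i).symm) (𝔄.chart i x) :=
        ((𝔄.contDiffOn_trans i j).differentiableOn (by simp)).differentiableAt
          ((𝔄.isOpen_transDomain i j).mem_nhds hyU)
      have hp : DifferentiableAt ℝ (𝔄.piece (w : M → F) j)
          ((𝔄.chart j ∘ (𝔄.chart i).symm) (𝔄.chart i x)) :=
        ((w.toPieces j).contDiff.differentiable (by exact_mod_cast hk)).differentiableAt
      refine ⟨_, (hp.hasFDerivAt.comp _ hτ.hasFDerivAt).congr_of_eventuallyEq hev, ?_⟩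
      refine (ContinuousLinearMap.opNorm_comp_le _ _).trans
        (mul_le_mul ?_ (hT i j x ⟨hxi, hxj⟩) (norm_nonneg _) (norm_nonneg _))
      rw [← norm_iteratedFDeriv_one]
      exact ((w.toPieces j).norm_iteratedFDeriv_le_norm (Nat.one_le_iff_ne_zero.mpr hk) _).trans
        (w.norm_toPieces_le j)
    · have hev : (fun z => 𝔄.ρ j ((𝔄.chart i).symm z) • w ((𝔄.chart i).symm z))
          =ᶠ[𝓝 (𝔄.chart i x)] fun _ => (0 : F) := by
        filter_upwards [((𝔄.chart i).continuousOn_symm.isOpen_inter_preimage (𝔄.chart i).open_target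
          (isClosed_tsupport (𝔄.ρ j)).isOpen_compl).mem_nhds ⟨hyt, hback _ hxj⟩] with z hz
        rw [image_eq_zero_of_notMem_tsupport hz.2, zero_smul]
      refine ⟨0, (hasFDerivAt_const (0 : F) _).congr_of_eventuallyEq hev, ?_⟩
      rw [norm_zero]
      exact mul_nonneg (norm_nonneg _) (hT0 i j)
  choose D hD hDle using hsummand
  have hsum : HasFDerivAt ((w : M → F) ∘ (𝔄.chart i).symm) (∑ j, D j) (𝔄.chart i x) := by
    have heq : ((w : M → F) ∘ (𝔄.chart i).symm) =
        fun z => ∑ j, 𝔄.ρ j ((𝔄.chart i).symm z) • w ((𝔄.chart i).symm z) :=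
      funext fun z => (𝔄.sum_smul_eq _ _).symm
    rw [heq]
    exact HasFDerivAt.fun_sum fun j _ => hD j
  rw [hsum.fderiv]
  calc ‖∑ j, D j‖ ≤ ∑ j, ‖w‖ * T i j := norm_sum_le_of_le _ fun j _ => hDle j
    _ = (∑ j, T i j) * ‖w‖ := by rw [← Finset.mul_sum, mul_comm]
    _ ≤ (∑ i, ∑ j, T i j) * ‖w‖ :=
        mul_le_mul_of_nonneg_right (Finset.single_le_sum (f := fun i => ∑ j, T i j)
          (fun i _ => Finset.sum_nonneg fun j _ => hT0 i j) (Finset.mem_univ i)) (norm_nonneg _)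

/-- **The `i`-th chart expression of `Δ_g` is controlled by the `C^{2,r}_𝔄` norm**: if `Ĝ^{ab}_i` and
`bˡ_i` are bounded by `G`, `B` on `chartᵢ(tsupport ρᵢ)`, then for `w ∈ C^{2,r}_𝔄(M)` and every `y`,
`|Σ_{ab} Ĝ^{ab}_i(y) D²pᵢ(y)(e_a, e_b) + Σ_l bˡ_i(y) Dpᵢ(y)(e_l)| ≤ (n²G(Σ‖e_a‖)² + nBΣ‖e_a‖)‖w‖`
(`pᵢ` the `i`-th chart piece: `‖Dʲpᵢ‖ ≤ ‖w‖`, and `pᵢ ≡ 0` off `chartᵢ(tsupport ρᵢ)`,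
`tsupport_piece_subset`). [cite: GilbargTrudinger2001, §6.1] -/
theorem norm_chartLaplacian_le {ι : Type*} [Fintype ι] {E : Type*} [NormedAddCommGroup E]
    [NormedSpace ℝ E] {M : Type*} [TopologicalSpace M] [ChartedSpace E M]
    [IsManifold 𝓘(ℝ, E) ∞ M] [CompactSpace M] (𝔄 : HolderChartData ι E M)
    (g : PseudoRiemannianMetric 𝓘(ℝ, E) ∞ E (TangentSpace 𝓘(ℝ, E) : M → Type _))
    {κ : Type*} [Fintype κ] [DecidableEq κ] (bE : Module.Basis κ ℝ E) (i : ι) {r : ℝ≥0} {G B : ℝ}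
    (hG0 : 0 ≤ G) (hB0 : 0 ≤ B)
    (hG : ∀ y ∈ 𝔄.chart i '' tsupport (𝔄.ρ i), ∀ a b, ‖gramInv bE g (𝔄.center i) y a b‖ ≤ G)
    (hB : ∀ y ∈ 𝔄.chart i '' tsupport (𝔄.ρ i), ∀ l, ‖firstOrderCoeff bE g (𝔄.center i) l y‖ ≤ B)
    (w : HolderManifoldFunction 𝔄 ℝ 2 r) (y : E) :
    ‖(∑ a, ∑ b, gramInv bE g (𝔄.center i) y a b *
        fderiv ℝ (fderiv ℝ (𝔄.piece (w : M → ℝ) i)) y (bE a) (bE b)) +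
      ∑ l, firstOrderCoeff bE g (𝔄.center i) l y * fderiv ℝ (𝔄.piece (w : M → ℝ) i) y (bE l)‖ ≤
      (Fintype.card κ * Fintype.card κ * G * (∑ a, ‖bE a‖) * (∑ a, ‖bE a‖) +
        Fintype.card κ * B * ∑ a, ‖bE a‖) * ‖w‖ := by
  set nb : ℝ := ∑ a, ‖bE a‖ with hnb
  have hnb0 : 0 ≤ nb := Finset.sum_nonneg fun a _ => norm_nonneg _
  have hba : ∀ a, ‖bE a‖ ≤ nb := fun a =>
    Finset.single_le_sum (f := fun a => ‖bE a‖) (fun a _ => norm_nonneg _) (Finset.mem_univ a)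
  -- sup bounds of the first two derivatives of the piece
  have hD1 : ∀ l, ‖fderiv ℝ (𝔄.piece (w : M → ℝ) i) y (bE l)‖ ≤ ‖w‖ * nb := fun l => by
    refine (ContinuousLinearMap.le_opNorm _ _).trans
      (mul_le_mul ?_ (hba l) (norm_nonneg _) (norm_nonneg _))
    rw [← norm_iteratedFDeriv_one]
    exact ((w.toPieces i).norm_iteratedFDeriv_le_norm (by norm_num) y).trans (w.norm_toPieces_le i)
  have hD2 : ∀ a b, ‖fderiv ℝ (fderiv ℝ (𝔄.piece (w : M → ℝ) i)) y (bE a) (bE b)‖ ≤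
      ‖w‖ * nb * nb := fun a b => by
    have h2 : ‖fderiv ℝ (fderiv ℝ (𝔄.piece (w : M → ℝ) i)) y‖ ≤ ‖w‖ := by
      rw [← norm_iteratedFDeriv_one, norm_iteratedFDeriv_fderiv]
      exact ((w.toPieces i).norm_iteratedFDeriv_le_norm le_rfl y).trans (w.norm_toPieces_le i)
    exact (ContinuousLinearMap.le_opNorm₂ _ _ _).trans (mul_le_mul
      (mul_le_mul h2 (hba a) (norm_nonneg _) (norm_nonneg _)) (hba b) (norm_nonneg _)
      (mul_nonneg (norm_nonneg _) hnb0))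
  -- the piece vanishes identically off `chart_i(tsupport ρ_i)`
  have hK : y ∉ 𝔄.chart i '' tsupport (𝔄.ρ i) → (∀ p, fderiv ℝ (𝔄.piece (w : M → ℝ) i) y p = 0) ∧
      ∀ p q, fderiv ℝ (fderiv ℝ (𝔄.piece (w : M → ℝ) i)) y p q = 0 := by
    intro hyK
    have hp0 : 𝔄.piece (w : M → ℝ) i =ᶠ[𝓝 y] fun _ => (0 : ℝ) :=
      notMem_tsupport_iff_eventuallyEq.1 fun h => hyK (𝔄.tsupport_piece_subset (w : M → ℝ) i h)
    have hd0 : fderiv ℝ (𝔄.piece (w : M → ℝ) i) =ᶠ[𝓝 y] fun _ => (0 : E →L[ℝ] ℝ) := by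
      have h := hp0.fderiv (𝕜 := ℝ)
      rw [fderiv_fun_const (𝕜 := ℝ) (E := E) (0 : ℝ)] at h
      exact h
    exact ⟨fun p => by rw [hd0.self_of_nhds]; rfl,
      fun p q => by rw [hd0.fderiv_eq, fderiv_const_apply (𝕜 := ℝ) (x := y)]; rfl⟩
  have hterm2 : ∀ a b, ‖gramInv bE g (𝔄.center i) y a b *
      fderiv ℝ (fderiv ℝ (𝔄.piece (w : M → ℝ) i)) y (bE a) (bE b)‖ ≤ G * (‖w‖ * nb * nb) := by
    intro a b
    by_cases hyK : y ∈ 𝔄.chart i '' tsupport (𝔄.ρ i)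
    · rw [norm_mul]
      exact mul_le_mul (hG y hyK a b) (hD2 a b) (norm_nonneg _) hG0
    · rw [(hK hyK).2, mul_zero, norm_zero]
      exact mul_nonneg hG0 (mul_nonneg (mul_nonneg (norm_nonneg _) hnb0) hnb0)
  have hterm1 : ∀ l, ‖firstOrderCoeff bE g (𝔄.center i) l y *
      fderiv ℝ (𝔄.piece (w : M → ℝ) i) y (bE l)‖ ≤ B * (‖w‖ * nb) := by
    intro l
    by_cases hyK : y ∈ 𝔄.chart i '' tsupport (𝔄.ρ i)
    · rw [norm_mul]
      exact mul_le_mul (hB y hyK l) (hD1 l) (norm_nonneg _) hB0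
    · rw [(hK hyK).1, mul_zero, norm_zero]
      exact mul_nonneg hB0 (mul_nonneg (norm_nonneg _) hnb0)
  refine (norm_add_le _ _).trans ?_
  refine (add_le_add (norm_sum_le_of_le _ fun a _ => norm_sum_le_of_le _ fun b _ => hterm2 a b)
    (norm_sum_le_of_le _ fun l _ => hterm1 l)).trans (le_of_eq ?_)
  simp only [Finset.sum_const, Finset.card_univ, nsmul_eq_mul]
  ring

/-- **`sup_M |Δ_g w| ≤ C ‖w‖_{C^{2,r}_𝔄}`** for a smooth pseudo-Riemannian metric on a compact manifold
with Hölder chart data `𝔄` (Gilbarg–Trudinger 2001, §6.1, through the piecewise chart formula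
`dalembertian_eq_sum_piece` and `norm_chartLaplacian_le`; the smooth coefficients `Ĝ^{ab}_i`, `bˡ_i`
are bounded on the compact sets `chartᵢ(tsupport ρᵢ)`). [cite: GilbargTrudinger2001, §6.1] -/
theorem exists_bound_dalembertian {ι : Type*} [Fintype ι] {E : Type} [NormedAddCommGroup E]
    [NormedSpace ℝ E] [FiniteDimensional ℝ E] {M : Type*} [TopologicalSpace M] [ChartedSpace E M]
    [IsManifold 𝓘(ℝ, E) ∞ M] [CompactSpace M] (𝔄 : HolderChartData ι E M)
    (g : PseudoRiemannianMetric 𝓘(ℝ, E) ∞ E (TangentSpace 𝓘(ℝ, E) : M → Type _))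
    [g.HasLeviCivita] {r : ℝ≥0} :
    ∃ C : ℝ, 0 ≤ C ∧ ∀ (w : HolderManifoldFunction 𝔄 ℝ 2 r) (x : M),
      |g.dalembertian w x| ≤ C * ‖w‖ := by
  classical
  obtain ⟨bE⟩ : Nonempty (Module.Basis (Fin (Module.finrank ℝ E)) ℝ E) := ⟨Module.finBasis ℝ E⟩
  choose G hG0 hG using fun i => exists_forall_norm_le_of_continuousOn 𝔄 i
    (fun (p : Fin (Module.finrank ℝ E) × Fin (Module.finrank ℝ E)) y =>
      gramInv bE g (𝔄.center i) y p.1 p.2)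
    fun p => (contDiffOn_gramInv bE g (𝔄.center i) p.1 p.2).continuousOn
  choose B hB0 hB using fun i => exists_forall_norm_le_of_continuousOn 𝔄 i
    (fun (l : Fin (Module.finrank ℝ E)) y => firstOrderCoeff bE g (𝔄.center i) l y)
    fun l => (contDiffOn_firstOrderCoeff bE g (𝔄.center i) l).continuousOn
  have hnb0 : 0 ≤ ∑ a, ‖bE a‖ := Finset.sum_nonneg fun a _ => norm_nonneg _
  refine ⟨∑ i, (Fintype.card (Fin (Module.finrank ℝ E)) * Fintype.card (Fin (Module.finrank ℝ E)) *
      G i * (∑ a, ‖bE a‖) * (∑ a, ‖bE a‖) + Fintype.card (Fin (Module.finrank ℝ E)) * B i *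
      ∑ a, ‖bE a‖), Finset.sum_nonneg fun i _ => ?_, fun w x => ?_⟩
  · have := hG0 i
    have := hB0 i
    positivity
  rw [dalembertian_eq_sum_piece 𝔄 bE g w.contMDiff x, ← Real.norm_eq_abs, Finset.sum_mul]
  exact norm_sum_le_of_le _ fun i _ => (norm_indicator_le_norm_self _ _).trans
    (norm_chartLaplacian_le 𝔄 g bE i (hG0 i) (hB0 i) (fun y hy a b => hG i y hy (a, b)) (hB i) w
      (𝔄.chart i x))

/-- **`sup_M |g⁻¹(du, dv)| ≤ C ‖u‖_{C^{2,r}_𝔄} ‖v‖_{C^{2,r}_𝔄}`** for a smooth pseudo-Riemannian metric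
on a compact manifold with Hölder chart data `𝔄`: at `x` choose `i` with `ρᵢ x ≠ 0`, so
`x ∈ tsupport ρᵢ ⊆ sourceᵢ`; there `g⁻¹(du, dv) = Σ_{ab} Ĝ^{ab}_i ∂_a û ∂_b v̂`
(`innerDual_mvfderiv_eq_sum_localFrame`, O'Neill 1983, Ch. 3, p. 60), with `Ĝ^{ab}_i` bounded on
`chartᵢ(tsupport ρᵢ)` and `‖Dû‖, ‖Dv̂‖` there bounded by `norm_fderiv_comp_symm_le`. [cite: GurskyViaclovsky2003, §5 (admissibility persists along the implicit-function family); GilbargTrudinger2001, §6.1] -/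
theorem exists_bound_innerDual {ι : Type*} [Fintype ι] {E : Type} [NormedAddCommGroup E]
    [NormedSpace ℝ E] [FiniteDimensional ℝ E] {M : Type*} [TopologicalSpace M] [ChartedSpace E M]
    [IsManifold 𝓘(ℝ, E) ∞ M] [CompactSpace M] (𝔄 : HolderChartData ι E M)
    (g : PseudoRiemannianMetric 𝓘(ℝ, E) ∞ E (TangentSpace 𝓘(ℝ, E) : M → Type _)) {r : ℝ≥0} :
    ∃ C : ℝ, 0 ≤ C ∧ ∀ (u v : HolderManifoldFunction 𝔄 ℝ 2 r) (x : M),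
      |g.innerDual x (mvfderiv 𝓘(ℝ, E) (u : M → ℝ) x).toLinearMap
          (mvfderiv 𝓘(ℝ, E) (v : M → ℝ) x).toLinearMap| ≤ C * ‖u‖ * ‖v‖ := by
  classical
  obtain ⟨bE⟩ : Nonempty (Module.Basis (Fin (Module.finrank ℝ E)) ℝ E) := ⟨Module.finBasis ℝ E⟩
  choose G hG0 hG using fun i => exists_forall_norm_le_of_continuousOn 𝔄 i
    (fun (p : Fin (Module.finrank ℝ E) × Fin (Module.finrank ℝ E)) y =>
      gramInv bE g (𝔄.center i) y p.1 p.2)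
    fun p => (contDiffOn_gramInv bE g (𝔄.center i) p.1 p.2).continuousOn
  obtain ⟨C₂, hC₂0, hC₂⟩ := norm_fderiv_comp_symm_le 𝔄 (F := ℝ) (k := 2) (r := r) two_ne_zero
  have hnb0 : 0 ≤ ∑ a, ‖bE a‖ := Finset.sum_nonneg fun a _ => norm_nonneg _
  have hba : ∀ a, ‖bE a‖ ≤ ∑ a, ‖bE a‖ := fun a =>
    Finset.single_le_sum (f := fun a => ‖bE a‖) (fun a _ => norm_nonneg _) (Finset.mem_univ a)
  have hGs0 : 0 ≤ ∑ i, G i := Finset.sum_nonneg fun i _ => hG0 i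
  refine ⟨Fintype.card (Fin (Module.finrank ℝ E)) * Fintype.card (Fin (Module.finrank ℝ E)) *
      (∑ i, G i) * (C₂ * ∑ a, ‖bE a‖) * (C₂ * ∑ a, ‖bE a‖), by positivity, fun u v x => ?_⟩
  -- a chart index with `ρ_i x ≠ 0`
  obtain ⟨i, -, hi⟩ := Finset.exists_ne_zero_of_sum_ne_zero (s := Finset.univ) (f := fun j => 𝔄.ρ j x)
    (by rw [← finsum_eq_sum_of_fintype, 𝔄.ρ.sum_eq_one (mem_univ x)]; exact one_ne_zero)
  have hxT : x ∈ tsupport (𝔄.ρ i) := subset_closure (mem_support.2 hi)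
  have hxs : x ∈ (𝔄.chart i).source := 𝔄.isSubordinate i hxT
  have hps : x ∈ (extChartAt 𝓘(ℝ, E) (𝔄.center i)).source := by
    simpa only [extChartAt_source] using hxs
  have h1 : extChartAt 𝓘(ℝ, E) (𝔄.center i) x = 𝔄.chart i x := by simp
  have hd : ∀ w : HolderManifoldFunction 𝔄 ℝ 2 r,
      MDifferentiableAt 𝓘(ℝ, E) 𝓘(ℝ, ℝ) (w : M → ℝ) x := fun w =>
    (w.contMDiff x).mdifferentiableAt (by norm_num)
  have hrep : ∀ w : HolderManifoldFunction 𝔄 ℝ 2 r, ((w : M → ℝ) ∘ (𝔄.chart i).symm)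
      =ᶠ[𝓝 (extChartAt 𝓘(ℝ, E) (𝔄.center i) x)] (w : M → ℝ) ∘ (extChartAt 𝓘(ℝ, E) (𝔄.center i)).symm :=
    fun w => EventuallyEq.of_eq (funext fun y => by simp)
  have hder : ∀ (w : HolderManifoldFunction 𝔄 ℝ 2 r) (a : Fin (Module.finrank ℝ E)),
      ‖fderiv ℝ ((w : M → ℝ) ∘ (𝔄.chart i).symm) (𝔄.chart i x) (bE a)‖ ≤
        C₂ * (∑ a, ‖bE a‖) * ‖w‖ := fun w a =>
    calc ‖fderiv ℝ ((w : M → ℝ) ∘ (𝔄.chart i).symm) (𝔄.chart i x) (bE a)‖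
        ≤ ‖fderiv ℝ ((w : M → ℝ) ∘ (𝔄.chart i).symm) (𝔄.chart i x)‖ * ‖bE a‖ :=
          ContinuousLinearMap.le_opNorm _ _
      _ ≤ C₂ * ‖w‖ * ∑ a, ‖bE a‖ :=
          mul_le_mul (hC₂ w i x hxT) (hba a) (norm_nonneg _) (mul_nonneg hC₂0 (norm_nonneg _))
      _ = C₂ * (∑ a, ‖bE a‖) * ‖w‖ := by ring
  have hmat : (Matrix.of fun a b => g.val x
      ((trivializationAt E (TangentSpace 𝓘(ℝ, E)) (𝔄.center i)).localFrame bE a x)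
      ((trivializationAt E (TangentSpace 𝓘(ℝ, E)) (𝔄.center i)).localFrame bE b x)) =
      Matrix.of (gram bE g (𝔄.center i) (extChartAt 𝓘(ℝ, E) (𝔄.center i) x)) := by
    ext a b
    simp only [Matrix.of_apply, gram]
    rw [(extChartAt 𝓘(ℝ, E) (𝔄.center i)).left_inv hps]
  have hterm : ∀ a b, ‖(Matrix.of fun a b => g.val x
      ((trivializationAt E (TangentSpace 𝓘(ℝ, E)) (𝔄.center i)).localFrame bE a x)
      ((trivializationAt E (TangentSpace 𝓘(ℝ, E)) (𝔄.center i)).localFrame bE b x))⁻¹ a b *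
      fderiv ℝ ((u : M → ℝ) ∘ (𝔄.chart i).symm) (𝔄.chart i x) (bE a) *
      fderiv ℝ ((v : M → ℝ) ∘ (𝔄.chart i).symm) (𝔄.chart i x) (bE b)‖ ≤
      (∑ i, G i) * (C₂ * (∑ a, ‖bE a‖) * ‖u‖) * (C₂ * (∑ a, ‖bE a‖) * ‖v‖) := fun a b => by
    have hcoef := (hG i (𝔄.chart i x) (mem_image_of_mem _ hxT) (a, b)).trans
      (Finset.single_le_sum (f := G) (fun i _ => hG0 i) (Finset.mem_univ i))
    rw [← h1] at hcoef
    rw [norm_mul, norm_mul, hmat]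
    exact mul_le_mul (mul_le_mul hcoef (hder u a) (norm_nonneg _) hGs0) (hder v b)
      (norm_nonneg _) (mul_nonneg hGs0 (by positivity))
  rw [innerDual_mvfderiv_eq_sum_localFrame g bE hxs (hd u) (hd v) (hrep u) (hrep v), h1,
    ← Real.norm_eq_abs]
  calc _ ≤ ∑ a : Fin (Module.finrank ℝ E), ∑ b : Fin (Module.finrank ℝ E),
        (∑ i, G i) * (C₂ * (∑ a, ‖bE a‖) * ‖u‖) * (C₂ * (∑ a, ‖bE a‖) * ‖v‖) :=
        norm_sum_le_of_le _ fun a _ => norm_sum_le_of_le _ fun b _ => hterm a b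
    _ = _ := by
        simp only [Finset.sum_const, Finset.card_univ, nsmul_eq_mul]
        ring

end BackgroundScalarTendsto

open BackgroundScalarTendsto in
/-- **ADMISSIBILITY PERSISTS: `X`-convergence ⇒ uniform convergence of `backgroundScalar`**
(the step "`A^t_{u_t} ∈ Γ₂⁺` for `t` near `t₀`" of Gursky–Viaclovsky 2003, §5, in the tree's vocabulary
`R_{h_t} > 0`): if `ψ t → W₀` in `X = C^{2,α}_𝔄(M)` as `t → t₀`, then
`backgroundScalar g (ψ t) = R_g − 6Δ_g(ψ t) − 6|d(ψ t)|²_g → backgroundScalar g W₀` uniformly on `M`: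
`sup_M |Δ_g w| ≤ C₁‖w‖_X` (`exists_bound_dalembertian`), `sup_M |g⁻¹(du, dv)| ≤ C₂‖u‖_X‖v‖_X`
(`exists_bound_innerDual`), and linearity give `sup_M |backgroundScalar g (ψ t) − backgroundScalar g W₀|
≤ 6C₁‖ψ t − W₀‖ + 6(2C₂‖W₀‖‖ψ t − W₀‖ + C₂‖ψ t − W₀‖²) → 0`.
[cite: GurskyViaclovsky2003, §5 (proof of Thm. 1)] -/
theorem stub_backgroundScalarTendsto :
    ∀ (M : Type) [TopologicalSpace M] [T2Space M] [ChartedSpace (EuclideanSpace ℝ (Fin 4)) M]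
      [IsManifold (𝓡 4) ∞ M] [CompactSpace M] {ι : Type} [Fintype ι]
      (𝔄 : HolderChartData ι (EuclideanSpace ℝ (Fin 4)) M)
      (g : PseudoRiemannianMetric (𝓡 4) ∞ (EuclideanSpace ℝ (Fin 4)) (TangentSpace (𝓡 4) : M → Type _))
      [g.HasLeviCivita] {α : ℝ≥0} (ψ : ℝ → HolderManifoldFunction 𝔄 ℝ 2 α)
      (W₀ : HolderManifoldFunction 𝔄 ℝ 2 α) (t₀ : ℝ), Tendsto ψ (𝓝 t₀) (𝓝 W₀) →
      TendstoUniformly (fun t x => backgroundScalar g (ψ t) x) (fun x => backgroundScalar g W₀ x) (𝓝 t₀) := by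
  intro M _ _ _ _ _ ι _ 𝔄 g _ α ψ W₀ t₀ hψ
  obtain ⟨C₁, -, hC₁⟩ := exists_bound_dalembertian 𝔄 g (r := α)
  obtain ⟨C₂, -, hC₂⟩ := exists_bound_innerDual 𝔄 g (r := α)
  -- the pointwise estimate
  have hbound : ∀ (u v : HolderManifoldFunction 𝔄 ℝ 2 α) (x : M),
      dist (backgroundScalar g v x) (backgroundScalar g u x) ≤
        6 * (C₁ * ‖u - v‖) + 6 * (2 * (C₂ * ‖v‖ * ‖u - v‖) + C₂ * ‖u - v‖ * ‖u - v‖) := by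
    intro u v x
    have hv2 : ContMDiffAt (𝓡 4) 𝓘(ℝ, ℝ) 2 (v : M → ℝ) x := v.contMDiff.contMDiffAt
    have hw2 : ContMDiffAt (𝓡 4) 𝓘(ℝ, ℝ) 2 ((u - v : HolderManifoldFunction 𝔄 ℝ 2 α) : M → ℝ) x :=
      (u - v).contMDiff.contMDiffAt
    have hfun : (u : M → ℝ) = fun y => v y + 1 * (u - v : HolderManifoldFunction 𝔄 ℝ 2 α) y := by
      funext y
      simp only [HolderManifoldFunction.coe_sub, Pi.sub_apply]
      ring
    have h1 := hC₁ (u - v) x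
    have h2 := hC₂ v (u - v) x
    have h3 : |g.gradSq (u - v : HolderManifoldFunction 𝔄 ℝ 2 α) x| ≤ C₂ * ‖u - v‖ * ‖u - v‖ :=
      hC₂ (u - v) (u - v) x
    simp only [Real.dist_eq, backgroundScalar]
    rw [hfun, g.dalembertian_add_const_mul_of_contMDiffAt hv2 hw2 1,
      g.gradSq_add_const_mul (hv2.mdifferentiableAt (by norm_num))
        (hw2.mdifferentiableAt (by norm_num)) 1]
    set Δw := g.dalembertian ((u - v : HolderManifoldFunction 𝔄 ℝ 2 α) : M → ℝ) x
    set I := g.innerDual x (mvfderiv (𝓡 4) (v : M → ℝ) x).toLinearMap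
      (mvfderiv (𝓡 4) ((u - v : HolderManifoldFunction 𝔄 ℝ 2 α) : M → ℝ) x).toLinearMap
    set Gw := g.gradSq ((u - v : HolderManifoldFunction 𝔄 ℝ 2 α) : M → ℝ) x
    have e : g.scalarCurvature x - 6 * g.dalembertian v x - 6 * g.gradSq v x -
        (g.scalarCurvature x - 6 * (g.dalembertian v x + 1 * Δw) -
          6 * (g.gradSq v x + 2 * 1 * I + 1 ^ 2 * Gw)) = 6 * Δw + 6 * (2 * I + Gw) := by
      ring
    obtain ⟨⟨h1a, h1b⟩, ⟨h2a, h2b⟩, h3a, h3b⟩ :=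
      And.intro (abs_le.1 h1) (And.intro (abs_le.1 h2) (abs_le.1 h3))
    rw [e, abs_le]
    constructor <;> linarith
  -- the right-hand side tends to `0` as `t → t₀`
  have h0 : Tendsto (fun t => ‖ψ t - W₀‖) (𝓝 t₀) (𝓝 0) := tendsto_iff_norm_sub_tendsto_zero.1 hψ
  have hlim : Tendsto (fun t => 6 * (C₁ * ‖ψ t - W₀‖) +
      6 * (2 * (C₂ * ‖W₀‖ * ‖ψ t - W₀‖) + C₂ * ‖ψ t - W₀‖ * ‖ψ t - W₀‖)) (𝓝 t₀) (𝓝 0) := by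
    have hc : Continuous fun d : ℝ => 6 * (C₁ * d) + 6 * (2 * (C₂ * ‖W₀‖ * d) + C₂ * d * d) := by
      fun_prop
    have h := (hc.tendsto 0).comp h0
    simp only [mul_zero, add_zero] at h
    exact h
  refine Metric.tendstoUniformly_iff.2 fun ε hε => ?_
  filter_upwards [(tendsto_order.1 hlim).2 ε hε] with t ht x
  exact (hbound (ψ t) W₀ x).trans_lt ht

end Literature.Geometry.Riemannian.GurskyViaclovskyOpen

end Part12

/-!
## Part 13 — port of `Summits/SmoothPoincare4/SmoothPoincare4/Theorems/EntropyRungChangGurskyYang.lean` (2 declarations kept)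

# Gursky–Viaclovsky openness (Prop. 2 + §5): `gurskyViaclovsky_pathOpen_weighted_four` HOLDS

* `stub_regularity` — admissible `C^{2,α}_𝔄` solutions of the weighted path equation with `t ≤ 1` are
  `C^∞`: `stub_regularity_of_induction` fed with `helper_regularityInduction`;
* `gurskyViaclovsky_pathOpen_weighted_four_holds` (EXACT name; in-tree original `…MargerinRails.stub_gvOpen`)
  — the implicit function theorem in `X = C^{2,α}_𝔄(M)`, `Y = C^{0,α}_𝔄(M)` (`HolderManifoldFunction`,
  Hölder chart data `𝔄`, `α = 1/2`) over the dictionary of `GurskyViaclovskyOpennessProofs.lean`, with the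
  zero-finding map of `stub_pathMapStrictFDeriv`, the invertible linearisation `stub_linearisedInvertible`
  (Prop. 2), persistence of admissibility `stub_backgroundScalarTendsto`, and `stub_regularity`.

References: M. J. Gursky, J. A. Viaclovsky, *A fully nonlinear equation on four-manifolds with positive
scalar curvature*, J. Differential Geom. 63 (2003) 131–154, Prop. 2 and §5 [GurskyViaclovsky2003];
D. Gilbarg, N. S. Trudinger (2001), Thm. 17.6, Lemma 17.16 [GilbargTrudinger2001].
-/

section Part13

open _root_.Set _root_.Function _root_.Filter
open scoped _root_.Manifold _root_.ContDiff _root_.Topology _root_.NNReal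

namespace Literature.Geometry.Riemannian.GurskyViaclovskyOpen

open Literature.Analysis.FunctionSpaces Literature.Geometry.Riemannian
open Literature.Geometry.Riemannian.GurskyViaclovskyPath
open Literature.Geometry.Lorentzian Literature.Geometry.Lorentzian.PseudoRiemannianMetric

/-- **ELLIPTIC REGULARITY: admissible `C^{2,α}_𝔄` solutions of the weighted path equation
with `t ≤ 1` are `C^∞`** (Gursky–Viaclovsky 2003, §5 "classical elliptic regularity theory" =
Gilbarg–Trudinger Lemma 17.16, regularity half): the manifold assembly
`stub_regularity_of_induction` applied to the chart-level induction `helper_regularityInduction`.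
[cite: GurskyViaclovsky2003, §5] [cite: GilbargTrudinger2001, Lemma 17.16] -/
theorem stub_regularity :
    ∀ (M : Type) [TopologicalSpace M] [T2Space M] [ChartedSpace (EuclideanSpace ℝ (Fin 4)) M]
      [IsManifold (𝓡 4) ∞ M] [CompactSpace M] {ι : Type} [Fintype ι]
      (𝔄 : HolderChartData ι (EuclideanSpace ℝ (Fin 4)) M)
      (g : PseudoRiemannianMetric (𝓡 4) ∞ (EuclideanSpace ℝ (Fin 4)) (TangentSpace (𝓡 4) : M → Type _))
      [g.HasLeviCivita], g.IsRiemannian →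
      ∀ (q : M → ℝ), ContMDiff (𝓡 4) 𝓘(ℝ) ∞ q → (∀ x, 0 < q x) → ∀ {α : ℝ≥0}, 0 < α → α < 1 →
      ∀ (t : ℝ), t ≤ 1 → ∀ (w : HolderManifoldFunction 𝔄 ℝ 2 α),
      (∀ x, 0 < backgroundScalar g w x) →
      (∀ x, backgroundPathOperator g t w x = q x * Real.exp (-4 * w x)) →
      ContMDiff (𝓡 4) 𝓘(ℝ) ∞ (w : M → ℝ) :=
  stub_regularity_of_induction helper_regularityInduction

/-- **GURSKY–VIACLOVSKY OPENNESS (Prop. 2 + §5) — the named fact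
`gurskyViaclovsky_pathOpen_weighted_four` (`GurskyViaclovskyOpenness.lean`) HOLDS** (EXACT discharge
`Literature.Geometry.Riemannian.gurskyViaclovsky_pathOpen_weighted_four_holds`; in-tree original:
`Summit.SmoothPoincare4.SmoothPoincare4.Theorems.MargerinRails.stub_gvOpen`, same proof). Hölder chart data `𝔄` on the compact `M`
(`HolderChartData.exists_of_compactSpace`), `α = 1/2`, the background solution `w₀` at `t₀`
(`solvable_iff_exists_background`) as a member `W₀ ∈ X` (`ofContMDiff`), the zero-finding map `Φ` of
`stub_pathMapStrictFDeriv` with `Φ(t₀, W₀) = 0`, invertibility of `∂_wΦ(t₀, W₀)`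
(`stub_linearisedInvertible`), the implicit function theorem (`exists_solution_nhds_of_hasStrictFDerivAt`)
giving `t ↦ ψ_t` with `Φ(t, ψ_t) = 0` and `ψ_t → W₀`, persistence of `backgroundScalar > 0`
(`stub_backgroundScalarTendsto`, `eventually_forall_pos_of_tendstoUniformly`), smoothness of `ψ_t` for
`t ≤ 1` (`stub_regularity`), and `solvable_of_background`; `exists_Ioo_of_eventually_nhds` produces the
interval. [cite: GurskyViaclovsky2003, Prop. 2 and §5] [cite: GilbargTrudinger2001, Thm. 17.6] -/
theorem _root_.Literature.Geometry.Riemannian.gurskyViaclovsky_pathOpen_weighted_four_holds :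
    gurskyViaclovsky_pathOpen_weighted_four := by
  intro M _ _ _ _ _ _ _ g _ hg q hq hqpos t₀ ht₀ hsolv
  classical
  -- Hölder chart data on the compact manifold, exponent `α = 1/2`
  obtain ⟨s, ⟨𝔄⟩⟩ := HolderChartData.exists_of_compactSpace (EuclideanSpace ℝ (Fin 4)) M
  set α : ℝ≥0 := 1 / 2 with hαdef
  have hα0 : 0 < α := by rw [hαdef]; positivity
  have hα1 : α < 1 := by rw [hαdef]; exact NNReal.half_lt_self one_ne_zero
  -- the smooth admissible background solution at `t₀`
  obtain ⟨w₀, hw₀, hpos₀, heq₀⟩ := (solvable_iff_exists_background g hg t₀ q).1 hsolv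
  set W₀ : HolderManifoldFunction 𝔄 ℝ 2 α := HolderManifoldFunction.ofContMDiff w₀ hw₀ hα1.le
    with hW₀def
  have hW₀ : ((W₀ : HolderManifoldFunction 𝔄 ℝ 2 α) : M → ℝ) = w₀ :=
    HolderManifoldFunction.coe_ofContMDiff w₀ hw₀ hα1.le
  -- the zero-finding map and its strict derivative at `(t₀, W₀)`
  obtain ⟨Φ, hΦeq, hΦd⟩ := stub_pathMapStrictFDeriv M 𝔄 g hg q hq hα1.le
  obtain ⟨Φ', hΦ', hΦ'eq⟩ := hΦd t₀ W₀
  -- its partial derivative in `w` is invertible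
  have hinv : (Φ' ∘L ContinuousLinearMap.inr ℝ ℝ (HolderManifoldFunction 𝔄 ℝ 2 α)).IsInvertible := by
    refine stub_linearisedInvertible M 𝔄 g hg q hq hqpos hα0 hα1 t₀ ht₀ w₀ hw₀ hpos₀ heq₀ _
      fun φ x => ?_
    rw [ContinuousLinearMap.comp_apply, ContinuousLinearMap.inr_apply, hΦ'eq φ x, hW₀]
  -- `Φ(t₀, W₀) = 0`
  have h0 : Φ (t₀, W₀) = 0 := by
    refine HolderManifoldFunction.ext fun x => ?_
    rw [hΦeq, hW₀, heq₀ x, sub_self, HolderManifoldFunction.coe_zero, Pi.zero_apply]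
  -- the implicit function theorem
  obtain ⟨ψ, hψ, hzero⟩ := exists_solution_nhds_of_hasStrictFDerivAt hΦ' hinv h0
  have heq : ∀ᶠ t in 𝓝 t₀, ∀ x,
      backgroundPathOperator g t (ψ t) x = q x * Real.exp (-4 * ψ t x) := by
    filter_upwards [hzero] with t ht x
    have h := congrArg (fun F : HolderManifoldFunction 𝔄 ℝ 0 α => F x) ht
    simp only [hΦeq, HolderManifoldFunction.coe_zero, Pi.zero_apply] at h
    linarith
  -- admissibility persists
  have hunif : TendstoUniformly (fun t x => backgroundScalar g (ψ t) x) (backgroundScalar g w₀)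
      (𝓝 t₀) := by
    have h := stub_backgroundScalarTendsto M 𝔄 g ψ W₀ t₀ hψ
    rwa [hW₀] at h
  have hposev : ∀ᶠ t in 𝓝 t₀, ∀ x, 0 < backgroundScalar g (ψ t) x :=
    eventually_forall_pos_of_tendstoUniformly (contMDiff_backgroundScalar g hw₀).continuous hpos₀
      hunif
  -- the solutions are smooth for `t ≤ 1`; conclude with the dictionary
  have key : ∀ᶠ t in 𝓝 t₀, t ≤ 1 → Solvable g t q := by
    filter_upwards [heq, hposev] with t ht hp htle
    exact solvable_of_background g hg
      (stub_regularity M 𝔄 g hg q hq hqpos hα0 hα1 t htle (ψ t) hp ht) hp ht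
  obtain ⟨ε, hε, hball⟩ := exists_Ioo_of_eventually_nhds key
  exact ⟨ε, hε, fun t h1 h2 h3 => hball t h1 h2 h3⟩

end Literature.Geometry.Riemannian.GurskyViaclovskyOpen

end Part13

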